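import Summits.HodgeConjecture.HodgeConjecture.Cruxes.BlochSeedDiscOne.DiamondLevelLaws

/-!
# CeilingTower — third workfile of the `h`-uniform ABSENT families of ◇_h (`h = 2m+4`): the node-2 LINE over a floor letter of any charge,
# the A2I⁻ origin interface climbing the charge, the apex `4I ∕ 6I` package, the first TOWER families (the ceiling-line column `y_d` for
# EVERY `d ≥ 1`), (§5) the FREE FOURTH LETTER over `{O, ℓ_φ, ·, cu_χ}` and `{ℓ_φ, ℓ_ψ, ·, cu_χ}` by ONE induction on its height, (§6, v0.4)
# the ceiling-free unit pair of distinct phases with the floor climb `P{ℓ_φ, 2ℓ_u, ·, cu}`, `N{ℓ_φ, 3ℓ_u, ·, cu}`, and (§7, v0.5, g22) the NODE-2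
# TOWER `{O, 2I + m·ℓ_v, W, hI}` by ONE downward induction on the level with the X⁺ fork at the ceiling, the apex rows `P{O, ℓ, cu, hI}`,
# `N{ℓ, ℓ′, cu, hI}` for ALL phases, and the §5 ∕ §6 families freed of their phase ∕ ceiling provisos (control lens, g22, v0.5)

STATUS: HC ∕ HC_CM ∕ HC_AV ∕ H2 = `BlochSeedDiscOne` (stmt-18881) ∕ (T_h) ∕ KAbsent_h are NOT proved here or anywhere; HC_CM is a displayed
binder of the route only.  This file is KERNEL ARITHMETIC on the typed first-order encoder model of `Summits/Ventures/HSemireg/Pad4Tower*.lean`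
(hypotheses: `C.InDiamond h`, RULE D on both levels, X⁺, `PermClosed C.upper`), census-neutral: every family below is checked against the
gs-eng-2 g54 j318002 peel tables (◇₈ a459e02921a60310 ∕ ◇₁₀ 74004db439790926) to have 0 SURVIVORS (§1–§3: only round ≤ 2 members; the
tower families §4–§6 legitimately reach peel rounds 3 – 5).

WHY A THIRD FILE. `CeilingPair.lean` (g20 v1.6, 198 828 B) and `CeilingPair2.lean` (g21 v1.4, 199 966 B) are at the 200 KB cap; neither is
importable on the farm yet (`unbuilt`), so §0 below restates VERBATIM (credited, not new) the 84 declarations that §1–§5 call: those of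
`CeilingPair.lean` v1.6 (sha16 776b0a3f2106ba61, control g20 — incl. §14's B4 `loneUnit_pair_N_absent` and the A2I⁻ origin interface; its own §0
credits `CeilingFork.lean` g18 ∕ `CeilingUnitApex.lean` g19) first, then those only in `CeilingPair2.lean` v1.4 (sha16 e1deb99c707df628, g21).
Booking: director-hodge g30 R19.743 booked the SECOND workfile at the cap; the BOOKING ASK for this third one is bus RESULT-3 of control g21
(2026-08-31 09:09Z) — retire this file if the director declines; its content is independent of the other two.

§1: the node-2 LINE `2I + n·ℓ_v` (`n ≥ 1`: `r₁, t₁, …` up to the ceiling letter `y_{m+1}`) over a floor letter `c·ℓ_ψ` of ANY charge with `2c ≠ h`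
[law-free: ◇_h, RULE D, X⁺, `S₄` on E₊] — UP1g `P{c·ℓ_ψ, 2I+nℓ_v, (h−2)I, cu_χ}` (sub-apex up-server → UN4), VN6 `N{c·ℓ_ψ, 2I+nℓ_v, (h−2)I,
cu_χ}` (floor pin, the line descends along `v` → UP1g ∕ UP4 ∕ UP2), WP1g `P{c·ℓ_ψ, 2I+nℓ_v, s_m(w), cu_χ}` (`χ ≠ w+2`; sub-top node up-server →
VN6 ∕ UN4): the general-charge UP1 ∕ VN1 ∕ WP1a; the one new ingredient is UP5g of `CeilingPair2` §5 (the apex child `2I` under a general floor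
letter).  §2: the A2I⁻ ORIGIN INTERFACE CLIMBS THE CHARGE [adds A2I⁻, `S₄` on E₋, `Δ` on E₊, via B4]: OP1 `P{O, ℓ_φ, (h−2)I, cu_χ}` (→ B4), VN7
`N{ℓ_ρ, c·ℓ_ψ, (h−2)I, cu_χ}` (floor pin → UP2 ∕ OP1), XP1 `P{ℓ_ρ, c·ℓ_ψ, s_m(w), cu_χ}` (`χ ≠ w+2`; → VN7 ∕ UN1; `c = 1` is TP20) and WN1g
`N{c·ℓ_ψ, 2I+nℓ_v, s_m(w), cu_χ}` (`2c ≠ h`, `χ ≠ w+2`; floor pin → WP1g ∕ WP1d ∕ XP1; `c = n = 1` is TN16) — the node-2 line with the sub-top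
letter is now typed at BOTH levels for every charge.  §3 (v0.2): the APEX `4I` as second letter over the three typed completions of `{ℓ_φ, 4I}`
(`apexFour_downRay`, the apex engines of `CeilingPair2` §4) — UN5 `N{ℓ, 4I, cu, cu'}`, UP8 `P{ℓ, 4I, cu, cu'}` (`h ≠ 4`), VN8 ∕ UP9 `{ℓ, 4I, (h−2)I,
cu_χ}`, WN3a ∕ WP4 `{ℓ, 4I, s_m(w), cu_χ}` (`χ ≠ w+2`) [law-free except WN3a] — UN6 `N{ℓ, 6I, cu, cu'}` (`6 < h`; `apexSix_downRay` → WP2 A1 A2) and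
WN3 `N{ℓ_φ, 4I+nℓ_u, s_m(w), cu_χ}` (`n ≥ 1`, `χ ≠ w+2`; the floor pin lowers the node-4 letter onto WP1a ∕ XP1) = the `N`-partner of WP1c.
§4 (v0.2): the first TOWER families — the ceiling-line column `y_d = (h−2−2d)I + (1+d)ℓ_v` for EVERY `d ≥ 1` (up to the full floor letter
`y_{m+1}`) by ONE induction on `d` (`upLine_ceilLetter`: the up-line of `y_d` pinned by `cu_χ` is `{y_{d−e} : 1 ≤ e ≤ d+1}`, base `y_0 = cu_v` (B4 ∕
B3), `y_{−1} = hI` (lone-unit apex ∕ g18 ceiling fork); the origin interface and the unit-pair descent close the loop at level `N`): OP_d `P{O, ℓ_φ,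
y_d, cu_χ}`, ON_d `N{O, ℓ_φ, y_d, cu_χ}`, TN_d `N{ℓ_φ, ℓ_ψ, y_d, cu_χ}`, TP_d `P{ℓ_φ, ℓ_ψ, y_d, cu_χ}` (`φ ≠ ψ`), YN_d `N{ℓ_φ, 2ℓ_u, y_d, cu_χ}`
(`φ ≠ u`) — `d = 1` of OP ∕ TN ∕ TP is TP18 ∕ TN17 ∕ TP19 of `CeilingPair.lean` §14.
§5 (v0.3): the FREE FOURTH LETTER — ONE induction on the height `h − X.1` of the fourth letter `X`, no case analysis on its shape: the floor pin
`O` lowers `ℓ_φ`, the A2I⁻ origin interface returns `P{ℓ_φ, O, X, cu_χ}`, the ceiling pin `cu_χ` serves `X` ABOVE along some ray (a frame of `X`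
with coordinate `≠ h` exists iff `X ≠ hI`, `exists_frame_ne_h`), the served letter is strictly higher, and `X = hI` is `loneUnit_apex_absent` (g19):
F1 `N{O, ℓ_φ, X, cu_χ} ∉ E₋` for EVERY `X`; F2 `P{O, ℓ_φ, X, cu_χ} ∉ E₊` (`X ≠ hI`); F3 `N{ℓ_φ, ℓ_ψ, X, cu_χ} ∉ E₋` (`X ≠ hI`, ALL phases); F4
`P{ℓ_φ, ℓ_ψ, X, cu_χ} ∉ E₊` (`X` below the ceiling, all phases); F5 `N{ℓ_φ, 2ℓ_u, X, cu_χ} ∉ E₋` (`X` below the ceiling, all `φ, u`) — subsuming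
B2 ∕ B3 ∕ B4, TP18 ∕ TN17 ∕ TP20, OP_d ∕ ON_d ∕ TN_d ∕ YN_d and every `{ℓ, ℓ′, s_k ∕ t_k ∕ r_k ∕ aI ∕ aI+nℓ ∕ cℓ″, cu}` class at once.
§6 (v0.4): over a unit pair of DISTINCT phases the served letter may be `hI` — the g18 ceiling fork — so F4 ∕ F5 hold for every `X ≠ hI` (F4c
`unitPairFreeCeil_P_absent`, F5c `unitFloorTwoFreeCeil_N_absent`, `φ ≠ ψ` ∕ `φ ≠ u`), and the floor letter climbs: F6 `unitFloorTwoFree_P_absent`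
`P{ℓ_φ, 2ℓ_u, X, cu_χ} ∉ E₊` and F7 `unitFloorThreeFree_N_absent` `N{ℓ_φ, 3ℓ_u, X, cu_χ} ∉ E₋` (`φ ≠ u`, `X` below the ceiling) — NEW classes; the
equal-phase rows and `P{ℓ, 3ℓ, X, cu}` stop at the deep rows `N{ℓ_φ, ℓ_φ, hI, cu}` (round 4) ∕ `N{ℓ_φ, 2ℓ_u, hI, cu}` (round 7).
§7 (v0.5, g22): THE NODE-2 TOWER over the pins `{O, ·, ·, hI}` — `T(m)[W] = {O, 2I + m·ℓ_v, W, hI}`, `h = 2μ`: T1 `T(m)[W] ∉ E₊` and `∉ E₋`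
for `1 ≤ m ≤ μ − 2` and EVERY `W ≠ O` by ONE downward ℕ-induction on `μ − 2 − m` (P-step: the apex pin raises the node-2 letter along its
up-line (`upLine_of_ruleDMu4P`) to the top server, RULE D there lowers it onto the ceiling line and the X⁺ FORK `xplus_fork` fires; N-step: the
floor pin lowers `W`, and the A2I⁻ origin interface FOR A FLOOR LETTER OF ANY CHARGE `a2i_origin_floor_interface` + `S₄` return a tower
`P`-cell); OPA `P{O, ℓ_φ, cu_χ, hI} ∉ E₊` and UPA `N{ℓ_φ, ℓ_ψ, cu_χ, hI} ∉ E₋` for ALL phases (the level `m = −1` of the tower; the apex row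
`N{O, 2I, cu, hI}` is excluded RELATIVE to OPA by a `Δ`-rotation onto a second child); hence F2⁺ ∕ F3⁺ for EVERY `X`, F4⁺ ∕ F5⁺ for `X ≠ hI`,
F6⁺ ∕ F7⁺ for `X` below the ceiling — ALL PHASES (the deep rows `N{ℓ_φ, ℓ_φ, hI, cu}` r4 and `P{O, ℓ, hI, cu}` r5 of memo g21 §4 are now typed).
Census (`tools/famP.py famQ.py famR.py famS.py famT.py famU.py famV.py 8 10` vs j318002): §1 ◇₈ 720 ∕ ◇₁₀ 1 280 member orbits, §2 668 ∕ 1 068, §3 134 ∕ 194,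
§4 432 ∕ 576, §5 1 322 ∕ 2 142, §6 1 298 ∕ 2 084 (`famU.py`; rounds 1 – 5, NEW ◇₁₀ 120 + 456 + 264 of rounds 2 ∕ 3 ∕ 4), §7 2 376 ∕ 3 956
(`famV.py`; tower `P` r1–4, tower `N` r1–5, OPA r3 ∕ r5, UPA r3 ∕ r4; NEW ◇₈ 142 + 172 of rounds 2 ∕ 3, ◇₁₀ 147 + 264 + 205 + 20 of rounds 2 ∕ 3 ∕ 4 ∕ 5);
0 SURVIVORS among the members of any family at any `h ∈ {4, 6, 8, 10}`; §1–§3 members are all of peel round ≤ 2,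
the towers reach deeper as they must (§4 rounds 2 – 3; §5 rounds 1 – 5: ◇₁₀ NEW 252 of round 2, 686 of round 3, 738 of round 4, 48 of round 5);
NEW (untyped by any earlier kernel family) ◇₈ 256 + 446 + 134 + 352 + 976 + 432 ∕ ◇₁₀ 624 + 798 + 194 + 496 + 1 724 + 840.  COVERAGE of the ◇₁₀ peel census
(round-2 orbits typed by a kernel family, cumulative over the three files): 59.7 % (CeilingPair2 v1.4) → 62.3 % (§1) → 65.6 % (§2) → 66.4 % (§3)
→ 67.4 % (§4) → 68.5 % (§5) → 69.0 % (§6) → 69.6 % (§7: 16 604 ∕ 23 861); ◇₈ 56.4 → 58.4 → 61.7 → 62.7 → 64.5 → 66.5 → 67.8 → 69.0 % (8 788 ∕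
12 744); round 1 ◇₁₀ 3 275 ∕ 3 357, ◇₈ 2 201 ∕ 2 255; orbits of peel round ≥ 3 typed: ◇₁₀ 2 945 (v0.4: 2 456, v0.3: 1 736), ◇₈ 1 280 (1 108, 844); of
ALL 432 711 ∕ 97 541 absent orbits 5.3 % ∕ 12.6 % are kernel-typed (the deep rounds are the bulk); 0 census disagreements (`tools/cover.py 8 10`).
NEXT (memo CEILING-TOWER-g22 §4): the tower's excluded deep columns `W = O` (`{O, 2I+mℓ, O, hI}` r6 ∕ r9) and apex level `{O, 2I, W, hI}`, the row
`N{ℓ_φ, 2ℓ_u, hI, cu}` (r5–7), `P{ℓ, ℓ′, hI, cu}` (r8); towers over other pin pairs (`{ℓ_φ, ·, ·, hI}`, `{O, ·, ·, cu}`); two free letters.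
-/

set_option linter.dupNamespace false
set_option linter.unusedSimpArgs false

namespace Summit.HodgeConjecture.HodgeConjecture.Cruxes.BlochSeedDiscOne.CeilingTower

open Finset Summit.Ventures.HSemireg.Pad4Tower
open Summit.HodgeConjecture.HodgeConjecture.Cruxes.BlochSeedDiscOne.DiamondLevelLaws

/-! ## §0 Restated verbatim — not new: from `CeilingPair.lean` v1.6 776b0a3f2106ba61 (control g20; g18 ∕ g19 lemmas as credited there), then from `CeilingPair2.lean` v1.4 e1deb99c707df628 (control g21) -/

/-- [g18 `CeilingFork.xplus_unit_fork`] the X⁺ fork at a ceiling apex with two UNIT children needs no side condition. -/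
theorem xplus_unit_fork {h : ℤ} {C : MConfig} (hU : C.InDiamond h) (hX : XPlusClosed C) {Z : MCell} (hZ : Z ∈ C.lower)
    {g f : Fin 4} (hfg : f ≠ g) (hg : Z g = (h, 0, 0)) (hf : Z f = (h, 0, 0)) {P₁ P₂ : MCell}
    (hP₁ : P₁ ∈ C.upper) (hP₂ : P₂ ∈ C.upper) {r₁ r₂ : Fin 4} (hr : r₂ ≠ r₁) (h1 : UPartner Z P₁ g r₁) (h2 : UPartner Z P₂ g r₂)
    (hd₁ : (P₁ g).1 = h - 1) (hd₂ : (P₂ g).1 = h - 1) : False := by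
  have hZg1 : (Z g).1 = h := by rw [hg]
  have h1ray : ((h, 0, 0) : BPoint) = ray (P₁ g) r₁ (h - (P₁ g).1) := by have := h1.2.2; rw [hg] at this; exact this
  refine hX (dualCell 0 P₁) (dualCell_mem_dual_lower hP₁) (dualCell 0 Z) (dualCell_mem_dual_upper hZ) (dualCell 0 P₂)
    (dualCell_mem_dual_lower hP₂) g r₁ r₂ f ⟨?_, hfg, (uPartner_dual 0 Z P₁ g r₁).mpr h1, ?_, hr, ?_, ?_, ?_, ?_, ?_⟩
  · exact fun hap => not_isApex_below_apex (by omega) h1ray ((isApex_dual 0 (P₁ g)).mp hap)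
  · intro P hP hPu
    obtain ⟨X, hXl, rfl⟩ := Finset.mem_image.mp hP
    have hu : UPartner X P₁ g r₁ := (uPartner_dual 0 X P₁ g r₁).mp hPu
    show 0 - (X g).1 ≤ 0 - (Z g).1
    have hlt : (P₁ g).1 < (X g).1 := hu.2.1
    have hle : (X g).1 ≤ h := fst_le_of_inDiamond (hU.1 X hXl g)
    omega
  · exact ⟨magree_dual.mpr (fun j hj => (h2.1 j hj).symm), (ray_dual_iff 0 (Z g) (P₂ g) r₂).mpr ⟨h2.2.1, h2.2.2⟩⟩
  · intro P hP _ hlt1 hlt2 _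
    obtain ⟨X, hXl, rfl⟩ := Finset.mem_image.mp hP
    exfalso
    change 0 - (Z g).1 < 0 - (X g).1 at hlt1
    change 0 - (X g).1 < 0 - (P₂ g).1 at hlt2
    have hle : (X g).1 ≤ h := fst_le_of_inDiamond (hU.1 X hXl g)
    omega
  · intro P hP _ _ _ _
    obtain ⟨X, hXl, rfl⟩ := Finset.mem_image.mp hP
    show Effective (bsub (dualPt 0 (X g)) (dualPt 0 (Z g)))
    rw [bsub_dualPt0, hg]
    exact effective_ceilingApex_sub (hU.1 X hXl g)
  · intro P hP _ hnb _
    obtain ⟨X, hXl, rfl⟩ := Finset.mem_image.mp hP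
    exfalso
    have e1 : (P₁ f).1 = h := by rw [(h1.1 f hfg).trans hf]
    have := hnb.1
    change 0 - (X f).1 < 0 - (P₁ f).1 at this
    have hle := fst_le_of_inDiamond (hU.1 X hXl f)
    omega
  · intro P hP hnb
    obtain ⟨X, hXl, rfl⟩ := Finset.mem_image.mp hP
    exfalso
    have e1 : (P₁ f).1 = h := by rw [(h1.1 f hfg).trans hf]
    have := hnb.1
    change 0 - (X f).1 < 0 - (P₁ f).1 at this
    have hle := fst_le_of_inDiamond (hU.1 X hXl f)
    omega

/-- [g18] the unit floor letter `ℓ_φ = O + n_φ`. -/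
abbrev floorUnit (φ : Fin 4) : BPoint := ray ((0, 0, 0) : BPoint) φ 1

/-- [g18] the unit ceiling letter `(h−2)I + ℓ_χ`. -/
abbrev ceilingUnit (h : ℤ) (χ : Fin 4) : BPoint := ray ((h - 2, 0, 0) : BPoint) χ 1

/-- [g18] the floor letter `c·ℓ_φ` (node `0`, top `2c`). -/
abbrev floorLetter (φ : Fin 4) (c : ℤ) : BPoint := ray ((0, 0, 0) : BPoint) φ c

/-- [g18] the letter `2I + n·ℓ_u` (node `2`, top `2 + 2n`). -/
abbrev nodeTwoLetter (u : Fin 4) (n : ℤ) : BPoint := ray ((2, 0, 0) : BPoint) u n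

theorem floorUnit_not_isApex (φ : Fin 4) : ¬ isApex (floorUnit φ) := by
  fin_cases φ <;> simp [ray, isApex]

theorem floorUnit_fst (φ : Fin 4) : (floorUnit φ).1 = 1 := by
  fin_cases φ <;> simp [ray]

theorem floorUnit_node (φ : Fin 4) : Adapted (floorUnit φ) (φ + 2) ∧ coord (floorUnit φ) (φ + 2) = 0 := by
  fin_cases φ <;> simp [ray, coord, Adapted]

theorem floorUnit_top (φ : Fin 4) : Adapted (floorUnit φ) φ ∧ coord (floorUnit φ) φ = 2 := by
  fin_cases φ <;> simp [ray, coord, Adapted]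

theorem ceilingUnit_not_isApex (h : ℤ) (χ : Fin 4) : ¬ isApex (ceilingUnit h χ) := by
  fin_cases χ <;> simp [ray, isApex]

theorem ceilingUnit_fst (h : ℤ) (χ : Fin 4) : (ceilingUnit h χ).1 = h - 1 := by
  fin_cases χ <;> simp [ray] <;> omega

theorem ceilingUnit_node (h : ℤ) (χ : Fin 4) : Adapted (ceilingUnit h χ) (χ + 2) ∧ coord (ceilingUnit h χ) (χ + 2) = h - 2 := by
  fin_cases χ <;> simp [ray, coord, Adapted]

theorem ceilingApex_eq_ray_ceilingUnit (h : ℤ) (χ : Fin 4) : ((h, 0, 0) : BPoint) = ray (ceilingUnit h χ) (χ + 2) 1 := by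
  fin_cases χ <;> simp [ray] <;> omega

/-- [g18] below a unit floor letter there is only `O`, along the letter's own ray. -/
theorem below_floorUnit {h : ℤ} {y : BPoint} (hy : InDiamond h y) {φ r : Fin 4} {d : ℤ} (hd : 0 < d)
    (he : floorUnit φ = ray y r d) : r = φ ∧ y = (0, 0, 0) := by
  obtain ⟨α, a, b⟩ := y
  obtain ⟨hax, h1, -, -⟩ := hy
  simp only [AxisPt, absCharge, chargeOf, ray, Prod.mk.injEq] at hax h1 he
  fin_cases φ <;> fin_cases r <;> simp at he hax ⊢ <;>
    (simp only [abs_eq_max_neg, max_def] at h1; split_ifs at h1 <;> omega)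

/-- [g18] above a unit ceiling letter there is only `hI`, along the node direction. -/
theorem above_ceilingUnit {h : ℤ} {y : BPoint} (hy : InDiamond h y) {χ r : Fin 4} {e : ℤ} (he0 : 0 < e)
    (he : y = ray (ceilingUnit h χ) r e) : r = χ + 2 ∧ y = (h, 0, 0) := by
  subst he
  obtain ⟨hax, h1, -, h3⟩ := hy
  simp only [AxisPt, absCharge, chargeOf, ray, Prod.mk.injEq] at hax h1 h3 ⊢
  fin_cases χ <;> fin_cases r <;> simp at hax h1 h3 ⊢ <;>
    (simp only [abs_eq_max_neg, max_def] at h1 h3; split_ifs at h1 h3 <;> omega)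

theorem deltaPt_ceilingUnit (h : ℤ) (χ : Fin 4) : deltaPt (ceilingUnit h χ) = ceilingUnit h (χ + 3) := by
  fin_cases χ <;> simp [ray, deltaPt]

theorem deltaPt_apex (a : ℤ) : deltaPt ((a, 0, 0) : BPoint) = (a, 0, 0) := by
  simp [deltaPt]

theorem floorUnit_inj {φ ψ : Fin 4} (e : floorUnit φ = floorUnit ψ) : φ = ψ :=
  ray_apex_dir_inj one_ne_zero e

theorem fin4_add3_ne (χ : Fin 4) : χ + 3 ≠ χ := by fin_cases χ <;> decide

theorem fin4_add33_ne (χ : Fin 4) : χ + 3 + 3 ≠ χ := by fin_cases χ <;> decide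

theorem fin4_add333_ne (χ : Fin 4) : χ + 3 + 3 + 3 ≠ χ := by fin_cases χ <;> decide

theorem floorLetter_not_isApex (φ : Fin 4) {c : ℤ} (hc : c ≠ 0) : ¬ isApex (floorLetter φ c) := by
  fin_cases φ <;> simp [ray, isApex, hc]

theorem nodeTwoLetter_not_isApex (u : Fin 4) {n : ℤ} (hn : n ≠ 0) : ¬ isApex (nodeTwoLetter u n) := by
  fin_cases u <;> simp [ray, isApex, hn]

theorem floorLetter_node (φ : Fin 4) (c : ℤ) : Adapted (floorLetter φ c) (φ + 2) ∧ coord (floorLetter φ c) (φ + 2) = 0 :=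
  ⟨(adapted_ray_apex 0 φ c).2, coord_ray_apex_antip 0 φ c⟩

theorem nodeTwoLetter_node (u : Fin 4) (n : ℤ) : Adapted (nodeTwoLetter u n) (u + 2) ∧ coord (nodeTwoLetter u n) (u + 2) = 2 :=
  ⟨(adapted_ray_apex 2 u n).2, coord_ray_apex_antip 2 u n⟩

/-- [g18] below a floor-node letter `c·ℓ_φ` (`c ≥ 0`) only its own ray. -/
theorem below_floorLetter {h c d : ℤ} {z : BPoint} (hz : InDiamond h z) {φ r : Fin 4} (hc : 0 ≤ c) (hd : 0 < d)
    (he : floorLetter φ c = ray z r d) : r = φ := by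
  obtain ⟨α, a, b⟩ := z
  obtain ⟨hax, h1, -, -⟩ := hz
  simp only [AxisPt, absCharge, chargeOf, ray, Prod.mk.injEq] at hax h1 he
  fin_cases φ <;> fin_cases r <;> simp at hax h1 he ⊢ <;>
    (simp only [abs_eq_max_neg, max_def] at h1; split_ifs at h1 <;> omega)

/-- [g18 `descent_of_floorUnitPair`] two unit floor letters force the descent `Z(c ↦ O)`. -/
theorem descent_of_floorUnitPair {h : ℤ} {C : MConfig} (hU : C.InDiamond h) {Z : MCell} (hD : RuleDMu4N C Z)
    {b c : Fin 4} (hbc : b ≠ c) {φ ψ : Fin 4} (hb : Z b = floorUnit φ) (hc : Z c = floorUnit ψ) :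
    ∃ P ∈ C.upper, MAgree P Z c ∧ P c = (0, 0, 0) := by
  have hk : Adapted (Z b) (φ + 2) := by rw [hb]; exact (floorUnit_node φ).1
  have hk0 : coord (Z b) (φ + 2) = 0 := by rw [hb]; exact (floorUnit_node φ).2
  have hk' : Adapted (Z c) ψ := by rw [hc]; exact (floorUnit_top ψ).1
  have hk'2 : coord (Z c) ψ = 2 := by rw [hc]; exact (floorUnit_top ψ).2
  have hne : coord (Z b) (φ + 2) ≠ coord (Z c) ψ := by rw [hk0, hk'2]; decide
  have nob : ∀ P ∈ C.upper, ∀ r : Fin 4, UPartner Z P b r → r = φ ∧ P b = (0, 0, 0) := fun P hP r hZP => by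
    have hd : 0 < (Z b).1 - (P b).1 := by have := hZP.2.1; omega
    have e : floorUnit φ = ray (P b) r ((Z b).1 - (P b).1) := by rw [← hb]; exact hZP.2.2
    exact below_floorUnit (hU.2 P hP b) hd e
  rcases hD b c hbc (φ + 2) ψ hk hk' hne with ⟨r, hr, P, hP, hZP⟩ | ⟨r, hr, P, hP, hZP⟩ | ⟨a, a', ha, -, P, hP, -, hb1, hb2, -, -⟩
  · exact absurd ((nob P hP r hZP).1.trans (fin4_add_two_add_two φ).symm) hr
  · have hd : 0 < (Z c).1 - (P c).1 := by have := hZP.2.1; omega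
    have e : floorUnit ψ = ray (P c) r ((Z c).1 - (P c).1) := by rw [← hc]; exact hZP.2.2
    exact ⟨P, hP, hZP.1, (below_floorUnit (hU.2 P hP c) hd e).2⟩
  · have ha' : a = φ + 2 := by
      rcases ha with e | ⟨hap, _⟩
      · exact e
      · exact absurd hap (by rw [hb]; exact floorUnit_not_isApex φ)
    have hd : 0 < (Z b).1 - (P b).1 := by omega
    have e : floorUnit φ = ray (P b) a ((Z b).1 - (P b).1) := by rw [← hb]; exact hb2
    have := (below_floorUnit (hU.2 P hP b) hd e).1
    rw [ha'] at this
    exact absurd (this.trans (fin4_add_two_add_two φ).symm) (by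
      intro h4; have := congrArg (· + 2) h4; simp at this)

/-- [g18 `lift_of_ceilingUnit`] a unit ceiling letter next to a ceiling letter forces the lift `P(d ↦ hI)`, as a `(χ+2)`-partner. -/
theorem lift_of_ceilingUnit {h : ℤ} {C : MConfig} (hU : C.InDiamond h) {P : MCell} (hP : P ∈ C.upper) (hD : RuleDMu4P C P)
    {a d : Fin 4} (had : a ≠ d) (hac : OnCeiling h (P a)) {χ : Fin 4} (hd : P d = ceilingUnit h χ) :
    ∃ N ∈ C.lower, UPartner N P d (χ + 2) ∧ N d = (h, 0, 0) := by
  have hna : ¬ isApex (P d) := by rw [hd]; exact ceilingUnit_not_isApex h χ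
  have hk : Adapted (P d) (χ + 2) := by rw [hd]; exact (ceilingUnit_node h χ).1
  have hkh : coord (P d) (χ + 2) ≠ h := by rw [hd, (ceilingUnit_node h χ).2]; omega
  obtain ⟨N, hN, hNP⟩ := upLine_of_ruleDMu4P hU hP hD had hac hna hk hkh
  have he0 : 0 < (N d).1 - (P d).1 := by have := hNP.2.1; omega
  have e : N d = ray (ceilingUnit h χ) (χ + 2) ((N d).1 - (P d).1) := by rw [← hd]; exact hNP.2.2
  exact ⟨N, hN, hNP, (above_ceilingUnit (hU.1 N hN d) he0 e).2⟩

/-- [g18 `fork_core`] `X = N{·, ·, hI, hI}` (slots 2, 3 apices) with two `P`-children `X(2 ↦ cu_χ)`, `X(2 ↦ cu_χ')`, `χ ≠ χ'` ⇒ X⁺ violated. -/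
theorem fork_core {h : ℤ} {C : MConfig} (hU : C.InDiamond h) (hX : XPlusClosed C) {X : MCell} (hXl : X ∈ C.lower)
    (hX2 : X 2 = (h, 0, 0)) (hX3 : X 3 = (h, 0, 0)) {P₁ P₂ : MCell} (hP₁ : P₁ ∈ C.upper) (hP₂ : P₂ ∈ C.upper)
    {χ χ' : Fin 4} (hχ : χ' ≠ χ) (h1 : MAgree P₁ X 2) (hP₁2 : P₁ 2 = ceilingUnit h χ) (h2 : MAgree P₂ X 2) (hP₂2 : P₂ 2 = ceilingUnit h χ') :
    False := by
  have u1 : UPartner X P₁ 2 (χ + 2) := by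
    refine ⟨h1, by rw [hP₁2, hX2, ceilingUnit_fst]; omega, ?_⟩
    rw [hX2, hP₁2, ceilingUnit_fst, show h - (h - 1) = 1 by ring]
    exact ceilingApex_eq_ray_ceilingUnit h χ
  have u2 : UPartner X P₂ 2 (χ' + 2) := by
    refine ⟨h2, by rw [hP₂2, hX2, ceilingUnit_fst]; omega, ?_⟩
    rw [hX2, hP₂2, ceilingUnit_fst, show h - (h - 1) = 1 by ring]
    exact ceilingApex_eq_ray_ceilingUnit h χ'
  have hr : χ' + 2 ≠ χ + 2 := fun e => hχ (add_right_cancel e)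
  exact xplus_unit_fork hU hX hXl (g := 2) (f := 3) (by decide) hX2 hX3 hP₁ hP₂ hr u1 u2
    (by rw [hP₁2, ceilingUnit_fst]) (by rw [hP₂2, ceilingUnit_fst])

/-- [g18 `ceilingForkFamily_absent`] THE CEILING FORK `N{ℓ_φ, ℓ_ψ, cu_χ, hI}`, `φ ≠ ψ`, is absent. -/
theorem ceilingForkFamily_absent {h : ℤ} {C : MConfig} (hU : C.InDiamond h) (hDN : ∀ Z ∈ C.lower, RuleDMu4N C Z)
    (hDP : ∀ P ∈ C.upper, RuleDMu4P C P) (hX : XPlusClosed C) (hGu : PermClosed C.upper) (hΔu : DeltaClosed C.upper)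
    {Z : MCell} {φ ψ χ : Fin 4} (hφψ : φ ≠ ψ) (h0 : Z 0 = floorUnit φ) (h1 : Z 1 = floorUnit ψ) (h2 : Z 2 = ceilingUnit h χ)
    (h3 : Z 3 = (h, 0, 0)) : Z ∉ C.lower := fun hZ => by
  obtain ⟨Px, hPx, hPxZ, hPx0⟩ := descent_of_floorUnitPair hU (hDN Z hZ) (b := 1) (c := 0) (by decide) h1 h0
  obtain ⟨Py, hPy, hPyZ, hPy1⟩ := descent_of_floorUnitPair hU (hDN Z hZ) (b := 0) (c := 1) (by decide) h0 h1
  have hPx1 : Px 1 = floorUnit ψ := (hPxZ 1 (by decide)).trans h1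
  have hPx2 : Px 2 = ceilingUnit h χ := (hPxZ 2 (by decide)).trans h2
  have hPx3 : Px 3 = (h, 0, 0) := (hPxZ 3 (by decide)).trans h3
  have hPy0 : Py 0 = floorUnit φ := (hPyZ 0 (by decide)).trans h0
  have hPy2 : Py 2 = ceilingUnit h χ := (hPyZ 2 (by decide)).trans h2
  have hPy3 : Py 3 = (h, 0, 0) := (hPyZ 3 (by decide)).trans h3
  obtain ⟨X, hXl, hXP, hXd⟩ := lift_of_ceilingUnit hU hPx (hDP Px hPx) (a := 3) (d := 2) (by decide)
    (by rw [hPx3]; exact onCeiling_apex h) hPx2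
  have hX0 : X 0 = (0, 0, 0) := (hXP.1 0 (by decide)).symm.trans hPx0
  have hX1 : X 1 = floorUnit ψ := (hXP.1 1 (by decide)).symm.trans hPx1
  have hX3 : X 3 = (h, 0, 0) := (hXP.1 3 (by decide)).symm.trans hPx3
  have child : ∀ Q ∈ C.upper, Q 0 = floorUnit ψ → Q 1 = (0, 0, 0) → (∃ χ', χ' ≠ χ ∧ Q 2 = ceilingUnit h χ') → Q 3 = (h, 0, 0) → False :=
    fun Q hQ hQ0 hQ1 ⟨χ', hχ', hQ2⟩ hQ3 => by
      have hQ' := hGu (Equiv.swap 0 1) Q hQ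
      refine fork_core hU hX hXl hXd hX3 hPx hQ' hχ' hXP.1 hPx2 (fun g hg => ?_) ?_
      · show Q (Equiv.swap (0 : Fin 4) 1 g) = X g
        fin_cases g
        · simpa using hQ1.trans hX0.symm
        · simpa using hQ0.trans hX1.symm
        · exact absurd rfl hg
        · simpa [Equiv.swap_apply_of_ne_of_ne] using hQ3.trans hX3.symm
      · show Q (Equiv.swap (0 : Fin 4) 1 2) = ceilingUnit h χ'
        simpa [Equiv.swap_apply_of_ne_of_ne] using hQ2
  have d1 : ∀ Q : MCell, ∀ f, Q.delta f = deltaPt (Q f) := fun Q f => rfl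
  rcases deltaPt_align 0 1 ψ φ with e | e | e | e
  · exact hφψ (floorUnit_inj e).symm
  · refine child Py.delta (hΔu Py hPy) ?_ ?_ ⟨χ + 3, fin4_add3_ne χ, ?_⟩ ?_
    · rw [d1, hPy0]; exact e.symm
    · rw [d1, hPy1, deltaPt_apex]
    · rw [d1, hPy2, deltaPt_ceilingUnit]
    · rw [d1, hPy3, deltaPt_apex]
  · refine child Py.delta.delta (hΔu _ (hΔu Py hPy)) ?_ ?_ ⟨χ + 3 + 3, fin4_add33_ne χ, ?_⟩ ?_
    · rw [d1, d1, hPy0]; exact e.symm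
    · rw [d1, d1, hPy1, deltaPt_apex, deltaPt_apex]
    · rw [d1, d1, hPy2, deltaPt_ceilingUnit, deltaPt_ceilingUnit]
    · rw [d1, d1, hPy3, deltaPt_apex, deltaPt_apex]
  · refine child Py.delta.delta.delta (hΔu _ (hΔu _ (hΔu Py hPy))) ?_ ?_ ⟨χ + 3 + 3 + 3, fin4_add333_ne χ, ?_⟩ ?_
    · rw [d1, d1, d1, hPy0]; exact e.symm
    · rw [d1, d1, d1, hPy1, deltaPt_apex, deltaPt_apex, deltaPt_apex]
    · rw [d1, d1, d1, hPy2, deltaPt_ceilingUnit, deltaPt_ceilingUnit, deltaPt_ceilingUnit]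
    · rw [d1, d1, d1, hPy3, deltaPt_apex, deltaPt_apex, deltaPt_apex]

/-- [g19 `CeilingUnitApex.apexCeilingUnit_absent_of_secondChild`] THE SECOND-CHILD THEOREM. -/
theorem apexCeilingUnit_absent_of_secondChild {h : ℤ} {C : MConfig} (hU : C.InDiamond h) (hDP : ∀ P ∈ C.upper, RuleDMu4P C P)
    (hX : XPlusClosed C) {Z Z' : MCell} {d f : Fin 4} (hfd : f ≠ d) {χ χ' : Fin 4} (hχ : χ' ≠ χ)
    (hd : Z d = ceilingUnit h χ) (hf : Z f = (h, 0, 0)) (hZ' : Z ∈ C.upper → Z' ∈ C.upper) (hagree : ∀ j, j ≠ d → Z' j = Z j)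
    (hd' : Z' d = ceilingUnit h χ') : Z ∉ C.upper := fun hZ => by
  obtain ⟨X, hXl, hXZ, hXd⟩ := lift_of_ceilingUnit hU hZ (hDP Z hZ) hfd (by rw [hf]; exact onCeiling_apex h) hd
  have hXf : X f = (h, 0, 0) := (hXZ.1 f hfd).symm.trans hf
  have u2 : UPartner X Z' d (χ' + 2) := by
    refine ⟨fun j hj => ?_, ?_, ?_⟩
    · rw [hagree j hj]; exact hXZ.1 j hj
    · rw [hd', ceilingUnit_fst, hXd]; omega
    · rw [hd', hXd, ceilingUnit_fst, show h - (h - 1) = 1 by ring]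
      exact ceilingApex_eq_ray_ceilingUnit h χ'
  have hr : χ' + 2 ≠ χ + 2 := fun e => hχ (add_right_cancel e)
  have hd₁ : (Z d).1 = h - 1 := by rw [hd, ceilingUnit_fst]
  have hd₂ : (Z' d).1 = h - 1 := by rw [hd', ceilingUnit_fst]
  exact xplus_unit_fork hU hX hXl hfd hXd hXf hZ (hZ' hZ) hr hXZ u2 hd₁ hd₂

/-- [g19 CUA sub-family A] `P{pure, pure, cu_χ, hI}`-type cells (`Δ`-fixed off `d`) are absent. -/
theorem apexCeilingUnitFamily_absent {h : ℤ} {C : MConfig} (hU : C.InDiamond h) (hDP : ∀ P ∈ C.upper, RuleDMu4P C P)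
    (hX : XPlusClosed C) (hΔu : DeltaClosed C.upper) {Z : MCell} {d f : Fin 4} (hfd : f ≠ d) {χ : Fin 4}
    (hd : Z d = ceilingUnit h χ) (hf : Z f = (h, 0, 0)) (hpure : ∀ j, j ≠ d → deltaPt (Z j) = Z j) : Z ∉ C.upper :=
  have d1 : ∀ j, Z.delta j = deltaPt (Z j) := fun _ => rfl
  apexCeilingUnit_absent_of_secondChild hU hDP hX hfd (fin4_add3_ne χ) hd hf (hΔu Z) (fun j hj => by rw [d1, hpure j hj])
    (by rw [d1, hd, deltaPt_ceilingUnit])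

/-- the unit ceiling letter lies on the ceiling: causal top `h`. -/
theorem onCeiling_ceilingUnit (h : ℤ) (χ : Fin 4) : OnCeiling h (ceilingUnit h χ) := by
  show (ray ((h - 2, 0, 0) : BPoint) χ 1).1 + absCharge (ray ((h - 2, 0, 0) : BPoint) χ 1) = h
  rw [top_ray_apex (h - 2) χ (by decide)]; ring

/-- **DESCENT NEXT TO A FLOOR NODE** (KERNEL, every `h`; RULE D at the `N`-cell): an `N`-cell `Z` with a floor-node letter `Z b = c₀·ℓ_φ` (`c₀ ≥ 0`; `c₀ = 0` is … (memo §1) -/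
theorem descent_of_floorNode_floorUnit {h c₀ : ℤ} {C : MConfig} (hU : C.InDiamond h) {Z : MCell} (hD : RuleDMu4N C Z)
    {b c : Fin 4} (hbc : b ≠ c) {φ ψ : Fin 4} (hc₀ : 0 ≤ c₀) (hb : Z b = floorLetter φ c₀) (hc : Z c = floorUnit ψ) :
    ∃ P ∈ C.upper, MAgree P Z c ∧ P c = (0, 0, 0) := by
  have hk : Adapted (Z b) (φ + 2) := by rw [hb]; exact (floorLetter_node φ c₀).1
  have hk0 : coord (Z b) (φ + 2) = 0 := by rw [hb]; exact (floorLetter_node φ c₀).2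
  have hk' : Adapted (Z c) ψ := by rw [hc]; exact (floorUnit_top ψ).1
  have hk'2 : coord (Z c) ψ = 2 := by rw [hc]; exact (floorUnit_top ψ).2
  have hne : coord (Z b) (φ + 2) ≠ coord (Z c) ψ := by rw [hk0, hk'2]; decide
  -- below the floor-node letter only its own ray
  have nob : ∀ P ∈ C.upper, ∀ r : Fin 4, (P b).1 < (Z b).1 → Z b = ray (P b) r ((Z b).1 - (P b).1) → r = φ :=
    fun P hP r hlt hray => by
      have e : floorLetter φ c₀ = ray (P b) r ((Z b).1 - (P b).1) := by rw [← hb]; exact hray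
      exact below_floorLetter (hU.2 P hP b) hc₀ (by omega) e
  rcases hD b c hbc (φ + 2) ψ hk hk' hne with ⟨r, hr, P, hP, hZP⟩ | ⟨r, hr, P, hP, hZP⟩ | ⟨a, a', ha, -, P, hP, -, hb1, hb2, -, -⟩
  · -- `(b, φ+2)` settled below in a direction `r ≠ φ` — impossible
    exact absurd ((nob P hP r hZP.2.1 hZP.2.2).trans (fin4_add_two_add_two φ).symm) hr
  · -- `(c, ψ)` settled below: the server is `Z(c ↦ O)`
    have hd : 0 < (Z c).1 - (P c).1 := by have := hZP.2.1; omega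
    have e : floorUnit ψ = ray (P c) r ((Z c).1 - (P c).1) := by rw [← hc]; exact hZP.2.2
    exact ⟨P, hP, hZP.1, (below_floorUnit (hU.2 P hP c) hd e).2⟩
  · -- covered below: the cover moves the floor-node letter down in a direction `a` with `DirOK (Z b) (φ+2) a`, i.e. `a ≠ φ` — impossible
    have hφ := nob P hP a hb1 hb2
    rcases ha with e | ⟨-, hne2⟩
    · exact absurd (e.symm.trans hφ) (fin4_ne_add_two φ).symm
    · exact (hne2 (hφ.trans (fin4_add_two_add_two φ).symm)).elim

/-- **BELOW `2I + n·ℓ_u` OFF ITS OWN RAY THERE IS ONLY `(n+1)·ℓ_u`, ONE STEP DOWN THE NODE DIRECTION** (every `h`, `n ≥ 1`): a point `z` of ◇_h with `2I + n ℓ_u = …` (memo §1) -/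
theorem below_nodeTwo_offRay {h n d : ℤ} {z : BPoint} {u r : Fin 4} (hn : 1 ≤ n) (hz : InDiamond h z) (hd : 0 < d) (hr : r ≠ u)
    (he : nodeTwoLetter u n = ray z r d) : r = u + 2 ∧ d = 1 ∧ z = floorLetter u (n + 1) := by
  obtain ⟨α, a, b⟩ := z
  obtain ⟨hax, h1, -, -⟩ := hz
  simp only [AxisPt, absCharge, chargeOf, ray, Prod.mk.injEq] at hax h1 he ⊢
  fin_cases u <;> fin_cases r <;> simp at hax h1 he hr ⊢ <;>
    (simp only [abs_eq_max_neg, max_def] at h1; split_ifs at h1 <;> omega)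

/-- **DESCENT OF `2I + n·ℓ_u` NEXT TO A FLOOR NODE** (KERNEL, every `h`; RULE D at the `N`-cell): an `N`-cell `N` with a floor-node letter `N b = c₀·ℓ_φ` (`c₀ ≥ …` (memo §1) -/
theorem descent_of_floorNode_nodeTwo {h c₀ n : ℤ} {C : MConfig} (hU : C.InDiamond h) (hc₀ : 0 ≤ c₀) (hn : 1 ≤ n) {N : MCell}
    (hD : RuleDMu4N C N) {b c : Fin 4} (hbc : b ≠ c) {φ u : Fin 4} (hb : N b = floorLetter φ c₀) (hc : N c = nodeTwoLetter u n) :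
    ∃ P' ∈ C.upper, UPartner N P' c (u + 2) ∧ P' c = floorLetter u (n + 1) := by
  have hk : Adapted (N b) (φ + 2) := by rw [hb]; exact (floorLetter_node φ c₀).1
  have hk0 : coord (N b) (φ + 2) = 0 := by rw [hb]; exact (floorLetter_node φ c₀).2
  have hk' : Adapted (N c) (u + 2) := by rw [hc]; exact (nodeTwoLetter_node u n).1
  have hk'2 : coord (N c) (u + 2) = 2 := by rw [hc]; exact (nodeTwoLetter_node u n).2
  have hne : coord (N b) (φ + 2) ≠ coord (N c) (u + 2) := by rw [hk0, hk'2]; decide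
  have nob : ∀ P ∈ C.upper, ∀ r : Fin 4, (P b).1 < (N b).1 → N b = ray (P b) r ((N b).1 - (P b).1) → r = φ :=
    fun P hP r hlt hray => by
      have e : floorLetter φ c₀ = ray (P b) r ((N b).1 - (P b).1) := by rw [← hb]; exact hray
      exact below_floorLetter (hU.2 P hP b) hc₀ (by omega) e
  rcases hD b c hbc (φ + 2) (u + 2) hk hk' hne with ⟨r, hr, P, hP, hZP⟩ | ⟨r, hr, P, hP, hZP⟩ | ⟨a, a', ha, -, P, hP, -, hb1, hb2, -, -⟩
  · exact absurd ((nob P hP r hZP.2.1 hZP.2.2).trans (fin4_add_two_add_two φ).symm) hr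
  · have hd : 0 < (N c).1 - (P c).1 := by have := hZP.2.1; omega
    have e : nodeTwoLetter u n = ray (P c) r ((N c).1 - (P c).1) := by rw [← hc]; exact hZP.2.2
    have hr' : r ≠ u := fun e' => hr (by rw [e', fin4_add_two_add_two])
    obtain ⟨hr2, -, hz⟩ := below_nodeTwo_offRay hn (hU.2 P hP c) hd hr' e
    subst hr2
    exact ⟨P, hP, hZP, hz⟩
  · have hφ := nob P hP a hb1 hb2
    rcases ha with e | ⟨-, hne2⟩
    · exact absurd (e.symm.trans hφ) (fin4_ne_add_two φ).symm
    · exact (hne2 (hφ.trans (fin4_add_two_add_two φ).symm)).elim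

/-- **THE PAIR CORE** (KERNEL, every `h`). Let `P = P{x, y, cu_χ, cu_χ'}` (`χ ≠ χ'`) be present and suppose a DESCENT RULE: every present `N`-cell `N{x, y, z, w}` … (memo §1) -/
theorem ceilingPair_core {h : ℤ} {C : MConfig} (hU : C.InDiamond h) (hDP : ∀ P ∈ C.upper, RuleDMu4P C P) (hX : XPlusClosed C)
    (hGu : PermClosed C.upper) {P : MCell} (hP : P ∈ C.upper) {χ χ' : Fin 4} (hχ : χ' ≠ χ)
    (h2 : P 2 = ceilingUnit h χ) (h3 : P 3 = ceilingUnit h χ') {x' y' : BPoint}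
    (hdesc : ∀ N ∈ C.lower, N 0 = P 0 → N 1 = P 1 →
      (N 2 = ceilingUnit h χ ∧ N 3 = (h, 0, 0)) ∨ (N 2 = (h, 0, 0) ∧ N 3 = ceilingUnit h χ') →
      ∃ P' ∈ C.upper, P' 0 = x' ∧ P' 1 = y' ∧ P' 2 = N 2 ∧ P' 3 = N 3) : False := by
  -- the two lifts `N₁ = P(3 ↦ hI)`, `N₂ = P(2 ↦ hI)`
  obtain ⟨N₁, hN₁, hN₁P, hN₁3⟩ := lift_of_ceilingUnit hU hP (hDP P hP) (a := 2) (d := 3) (by decide)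
    (by rw [h2]; exact onCeiling_ceilingUnit h χ) h3
  obtain ⟨N₂, hN₂, hN₂P, hN₂2⟩ := lift_of_ceilingUnit hU hP (hDP P hP) (a := 3) (d := 2) (by decide)
    (by rw [h3]; exact onCeiling_ceilingUnit h χ') h2
  have e12 : N₁ 2 = ceilingUnit h χ := (hN₁P.1 2 (by decide)).symm.trans h2
  have e23 : N₂ 3 = ceilingUnit h χ' := (hN₂P.1 3 (by decide)).symm.trans h3
  -- the two descents
  obtain ⟨P₁, hP₁, h10, h11, h12, h13⟩ :=
    hdesc N₁ hN₁ (hN₁P.1 0 (by decide)).symm (hN₁P.1 1 (by decide)).symm (Or.inl ⟨e12, hN₁3⟩)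
  obtain ⟨P₂, hP₂, h20, h21, h22, h23⟩ :=
    hdesc N₂ hN₂ (hN₂P.1 0 (by decide)).symm (hN₂P.1 1 (by decide)).symm (Or.inr ⟨hN₂2, e23⟩)
  rw [e12] at h12; rw [hN₁3] at h13; rw [hN₂2] at h22; rw [e23] at h23
  -- the lift `X = P₁(2 ↦ hI) = N{x', y', hI, hI}`
  obtain ⟨X, hXl, hXP, hX2⟩ := lift_of_ceilingUnit hU hP₁ (hDP P₁ hP₁) (a := 3) (d := 2) (by decide)
    (by rw [h13]; exact onCeiling_apex h) h12
  have hX0 : X 0 = x' := (hXP.1 0 (by decide)).symm.trans h10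
  have hX1 : X 1 = y' := (hXP.1 1 (by decide)).symm.trans h11
  have hX3 : X 3 = (h, 0, 0) := (hXP.1 3 (by decide)).symm.trans h13
  -- the second child `(2 3)·P₂`
  have hQ := hGu (Equiv.swap 2 3) P₂ hP₂
  refine fork_core hU hX hXl hX2 hX3 hP₁ hQ hχ hXP.1 h12 (fun g hg => ?_) ?_
  · show P₂ (Equiv.swap (2 : Fin 4) 3 g) = X g
    fin_cases g
    · simpa [Equiv.swap_apply_of_ne_of_ne] using h20.trans hX0.symm
    · simpa [Equiv.swap_apply_of_ne_of_ne] using h21.trans hX1.symm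
    · exact absurd rfl hg
    · simpa using h22.trans hX3.symm
  · show P₂ (Equiv.swap (2 : Fin 4) 3 2) = ceilingUnit h χ'
    simpa using h23

/-- **PAIR FORK A2** `P{ℓ_φ, c₀·ℓ_ψ, cu_χ, cu_χ'}` (`c₀ ≥ 0`, `χ ≠ χ'`; slots 0,1,2,3; `φ = ψ` allowed, `c₀ = 0` = the origin) **IS ABSENT** from every two-level … (memo §1) -/
theorem pairFork_floorUnit_absent {h c₀ : ℤ} {C : MConfig} (hU : C.InDiamond h) (hDN : ∀ Z ∈ C.lower, RuleDMu4N C Z)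
    (hDP : ∀ P ∈ C.upper, RuleDMu4P C P) (hX : XPlusClosed C) (hGu : PermClosed C.upper) (hc₀ : 0 ≤ c₀) {P : MCell}
    {φ ψ χ χ' : Fin 4} (hχ : χ' ≠ χ) (h0 : P 0 = floorUnit φ) (h1 : P 1 = floorLetter ψ c₀) (h2 : P 2 = ceilingUnit h χ)
    (h3 : P 3 = ceilingUnit h χ') : P ∉ C.upper := fun hP =>
  ceilingPair_core hU hDP hX hGu hP hχ h2 h3 (x' := (0, 0, 0)) (y' := floorLetter ψ c₀) fun N hN hN0 hN1 _ => by
    obtain ⟨P', hP', hagree, hP'0⟩ := descent_of_floorNode_floorUnit hU (hDN N hN) (b := 1) (c := 0) (by decide) hc₀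
      (hN1.trans h1) (hN0.trans h0)
    exact ⟨P', hP', hP'0, (hagree 1 (by decide)).trans (hN1.trans h1), hagree 2 (by decide), hagree 3 (by decide)⟩

/-- **PAIR FORK A1** `P{c₀·ℓ_φ, 2I + n·ℓ_u, cu_χ, cu_χ'}` (`c₀ ≥ 0`, `n ≥ 1`, `χ ≠ χ'`; slots 0,1,2,3) **IS ABSENT** (KERNEL, every `h`, law-free, no `Δ`; same … (memo §1) -/
theorem pairFork_nodeTwo_absent {h c₀ n : ℤ} {C : MConfig} (hU : C.InDiamond h) (hDN : ∀ Z ∈ C.lower, RuleDMu4N C Z)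
    (hDP : ∀ P ∈ C.upper, RuleDMu4P C P) (hX : XPlusClosed C) (hGu : PermClosed C.upper) (hc₀ : 0 ≤ c₀) (hn : 1 ≤ n)
    {P : MCell} {φ u χ χ' : Fin 4} (hχ : χ' ≠ χ) (h0 : P 0 = floorLetter φ c₀) (h1 : P 1 = nodeTwoLetter u n)
    (h2 : P 2 = ceilingUnit h χ) (h3 : P 3 = ceilingUnit h χ') : P ∉ C.upper := fun hP =>
  ceilingPair_core hU hDP hX hGu hP hχ h2 h3 (x' := floorLetter φ c₀) (y' := floorLetter u (n + 1)) fun N hN hN0 hN1 _ => by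
    obtain ⟨P', hP', hNP', hP'1⟩ := descent_of_floorNode_nodeTwo hU hc₀ hn (hDN N hN) (b := 0) (c := 1) (by decide)
      (hN0.trans h0) (hN1.trans h1)
    exact ⟨P', hP', (hNP'.1 0 (by decide)).trans (hN0.trans h0), hP'1, hNP'.1 2 (by decide), hNP'.1 3 (by decide)⟩

/-- **B1** `N{O, ℓ_φ, cu_χ, hI}` (slots 0,1,2,3) **IS ABSENT** (KERNEL, every `h`; ◇_h, RULE D, X⁺, `Δ` on the `P`-level): the descent `N(1 ↦ O) = P{O, O, cu_χ, …` (memo §1) -/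
theorem loneUnit_apex_absent {h : ℤ} {C : MConfig} (hU : C.InDiamond h) (hDN : ∀ Z ∈ C.lower, RuleDMu4N C Z)
    (hDP : ∀ P ∈ C.upper, RuleDMu4P C P) (hX : XPlusClosed C) (hΔu : DeltaClosed C.upper) {N : MCell} {φ χ : Fin 4}
    (h0 : N 0 = (0, 0, 0)) (h1 : N 1 = floorUnit φ) (h2 : N 2 = ceilingUnit h χ) (h3 : N 3 = (h, 0, 0)) : N ∉ C.lower := fun hN => by
  have h0' : N 0 = floorLetter φ 0 := h0.trans (ray_zero _ φ).symm
  obtain ⟨P₁, hP₁, hagree, hP₁1⟩ := descent_of_floorNode_floorUnit hU (hDN N hN) (b := 0) (c := 1) (by decide) le_rfl h0' h1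
  have hP₁0 : P₁ 0 = (0, 0, 0) := (hagree 0 (by decide)).trans h0
  have hP₁2 : P₁ 2 = ceilingUnit h χ := (hagree 2 (by decide)).trans h2
  have hP₁3 : P₁ 3 = (h, 0, 0) := (hagree 3 (by decide)).trans h3
  exact apexCeilingUnitFamily_absent hU hDP hX hΔu (d := 2) (f := 3) (by decide) hP₁2 hP₁3 (fun j hj => by
    fin_cases j
    · show deltaPt (P₁ 0) = P₁ 0; rw [hP₁0, deltaPt_apex]
    · show deltaPt (P₁ 1) = P₁ 1; rw [hP₁1, deltaPt_apex]
    · exact absurd rfl hj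
    · show deltaPt (P₁ 3) = P₁ 3; rw [hP₁3, deltaPt_apex]) hP₁

/-- **B2** `P{O, ℓ_φ, cu_χ, cu_χ'}` (slots 0,1,2,3; ALL `χ, χ'`, equal included) **IS ABSENT** (KERNEL, every `h`; ◇_h, RULE D, X⁺, `Δ` on the `P`-level): the lift … (memo §1) -/
theorem loneUnit_pair_absent {h : ℤ} {C : MConfig} (hU : C.InDiamond h) (hDN : ∀ Z ∈ C.lower, RuleDMu4N C Z)
    (hDP : ∀ P ∈ C.upper, RuleDMu4P C P) (hX : XPlusClosed C) (hΔu : DeltaClosed C.upper) {P : MCell} {φ χ χ' : Fin 4}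
    (h0 : P 0 = (0, 0, 0)) (h1 : P 1 = floorUnit φ) (h2 : P 2 = ceilingUnit h χ) (h3 : P 3 = ceilingUnit h χ') : P ∉ C.upper :=
  fun hP => by
  obtain ⟨N, hN, hNP, hN3⟩ := lift_of_ceilingUnit hU hP (hDP P hP) (a := 2) (d := 3) (by decide)
    (by rw [h2]; exact onCeiling_ceilingUnit h χ) h3
  exact loneUnit_apex_absent hU hDN hDP hX hΔu ((hNP.1 0 (by decide)).symm.trans h0) ((hNP.1 1 (by decide)).symm.trans h1)
    ((hNP.1 2 (by decide)).symm.trans h2) hN3 hN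

/-- **B3** `N{ℓ_φ, ℓ_ψ, cu_χ, cu_χ'}` (slots 0,1,2,3; ALL `φ, ψ, χ, χ'`) **IS ABSENT** (KERNEL, every `h`; same hypotheses): the descent `N(0 ↦ O)` is B2. (memo §1) -/
theorem unitPair_pair_absent {h : ℤ} {C : MConfig} (hU : C.InDiamond h) (hDN : ∀ Z ∈ C.lower, RuleDMu4N C Z)
    (hDP : ∀ P ∈ C.upper, RuleDMu4P C P) (hX : XPlusClosed C) (hΔu : DeltaClosed C.upper) {N : MCell} {φ ψ χ χ' : Fin 4}
    (h0 : N 0 = floorUnit φ) (h1 : N 1 = floorUnit ψ) (h2 : N 2 = ceilingUnit h χ) (h3 : N 3 = ceilingUnit h χ') : N ∉ C.lower :=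
  fun hN => by
  obtain ⟨P, hP, hagree, hP0⟩ := descent_of_floorUnitPair hU (hDN N hN) (b := 1) (c := 0) (by decide) h1 h0
  exact loneUnit_pair_absent hU hDN hDP hX hΔu hP0 ((hagree 1 (by decide)).trans h1) ((hagree 2 (by decide)).trans h2)
    ((hagree 3 (by decide)).trans h3) hP

theorem nodeTwoLetter_top (u : Fin 4) (n : ℤ) : Adapted (nodeTwoLetter u n) u ∧ coord (nodeTwoLetter u n) u = 2 + 2 * n := by
  refine ⟨(adapted_ray_apex 2 u n).1, ?_⟩
  rw [coord_ray_self, coord_of_isApex ⟨rfl, rfl⟩]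

/-- the top direction `φ` of the floor letter `c·ℓ_φ` carries the coordinate `2c`. -/
theorem floorLetter_top (φ : Fin 4) (c : ℤ) : Adapted (floorLetter φ c) φ ∧ coord (floorLetter φ c) φ = 2 * c := by
  refine ⟨(adapted_ray_apex 0 φ c).1, ?_⟩
  rw [coord_ray_self, coord_of_isApex ⟨rfl, rfl⟩]; show (0 : ℤ) + 2 * c = 2 * c; ring

/-- **TN2** `N{ℓ_φ, 2I + n·ℓ_u, cu_χ, cu_χ'}` (slots 0,1,2,3; `n ≥ 1`, `χ ≠ χ'`) **IS ABSENT** (KERNEL, every `h`; ◇_h, RULE D, X⁺, `S₄` on the `P`-level): the §1 … (memo §1) -/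
theorem unitNodeTwo_pair_N_absent {h n : ℤ} {C : MConfig} (hU : C.InDiamond h) (hDN : ∀ Z ∈ C.lower, RuleDMu4N C Z)
    (hDP : ∀ P ∈ C.upper, RuleDMu4P C P) (hX : XPlusClosed C) (hGu : PermClosed C.upper) (hn : 1 ≤ n) {N : MCell}
    {φ u χ χ' : Fin 4} (hχ : χ' ≠ χ) (h0 : N 0 = floorUnit φ) (h1 : N 1 = nodeTwoLetter u n) (h2 : N 2 = ceilingUnit h χ)
    (h3 : N 3 = ceilingUnit h χ') : N ∉ C.lower := fun hN => by
  have h0' : N 0 = floorLetter φ 1 := h0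
  obtain ⟨P, hP, hNP, hP1⟩ := descent_of_floorNode_nodeTwo hU zero_le_one hn (hDN N hN) (b := 0) (c := 1) (by decide) h0' h1
  exact pairFork_floorUnit_absent hU hDN hDP hX hGu (by omega : (0 : ℤ) ≤ n + 1) hχ ((hNP.1 0 (by decide)).trans h0) hP1
    ((hNP.1 2 (by decide)).trans h2) ((hNP.1 3 (by decide)).trans h3) hP

/-- the CEILING-LINE letter `y_d = (h − 2 − 2d)·I + (1 + d)·ℓ_χ` (`d = 0`: `cu_χ`; top coordinate `h`). -/
abbrev ceilLetter (h : ℤ) (χ : Fin 4) (d : ℤ) : BPoint := ray ((h - 2 - 2 * d, 0, 0) : BPoint) χ (1 + d)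

/-- the SUB-CEILING-LINE letter `s_k = 2k·I + (m + 1 − k)·ℓ_v` of ◇_{2m+4} (`k = 1`: `2I + m·ℓ_v`; top coordinate `h − 2`). -/
abbrev subCeilLetter (m : ℤ) (v : Fin 4) (k : ℤ) : BPoint := ray ((2 * k, 0, 0) : BPoint) v (m + 1 - k)

theorem ceilLetter_node (h : ℤ) (χ : Fin 4) (d : ℤ) :
    Adapted (ceilLetter h χ d) (χ + 2) ∧ coord (ceilLetter h χ d) (χ + 2) = h - 2 - 2 * d :=
  ⟨(adapted_ray_apex _ χ _).2, coord_ray_apex_antip _ χ _⟩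

theorem subCeilLetter_node (m : ℤ) (v : Fin 4) (k : ℤ) :
    Adapted (subCeilLetter m v k) (v + 2) ∧ coord (subCeilLetter m v k) (v + 2) = 2 * k :=
  ⟨(adapted_ray_apex _ v _).2, coord_ray_apex_antip _ v _⟩

theorem subCeilLetter_not_isApex {m k : ℤ} (v : Fin 4) (hk : m + 1 - k ≠ 0) : ¬ isApex (subCeilLetter m v k) := by
  fin_cases v <;> simp [ray, isApex, hk] <;> omega

/-- one diamond step above the sub-ceiling apex `(h−2)·I`. -/
theorem above_subApex {h e : ℤ} {z : BPoint} {r : Fin 4} (he : 0 < e) (hz : InDiamond h z)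
    (hze : z = ray ((h - 2, 0, 0) : BPoint) r e) : e = 1 := by
  have htop := hz.2.2.2
  rw [hze, top_ray_apex (h - 2) r (by omega)] at htop
  omega

theorem ceilLetter_zero (h : ℤ) (χ : Fin 4) : ceilLetter h χ 0 = ceilingUnit h χ := by
  show ray ((h - 2 - 2 * 0, 0, 0) : BPoint) χ (1 + 0) = ray ((h - 2, 0, 0) : BPoint) χ 1
  rw [mul_zero, sub_zero, add_zero]

theorem ceilLetter_not_isApex {h d : ℤ} (v : Fin 4) (hd : 1 + d ≠ 0) : ¬ isApex (ceilLetter h v d) := by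
  fin_cases v <;> simp [ray, isApex, hd] <;> omega

theorem ceilLetter_neg_one (h : ℤ) (v : Fin 4) : ceilLetter h v (-1) = (h, 0, 0) := by
  fin_cases v <;> simp [ray]

/-- ABOVE a ceiling-line letter `y_d` (`d ≥ 0`) in ◇_h: only the off-ray step up the node direction, `y_d + e·ℓ_{v+2} = y_{d−e}`, `e ≤ d + 1`. -/
theorem above_ceilLetter_offRay {h d e : ℤ} {z : BPoint} {v r : Fin 4} (hd : 0 ≤ d) (hz : InDiamond h z) (he : 0 < e)
    (heq : z = ray (ceilLetter h v d) r e) : r = v + 2 ∧ e ≤ d + 1 ∧ z = ceilLetter h v (d - e) := by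
  subst heq
  obtain ⟨hax, h1, -, h3⟩ := hz
  simp only [AxisPt, absCharge, chargeOf, ray, Prod.mk.injEq] at hax h1 h3 ⊢
  fin_cases v <;> fin_cases r <;> simp at hax h1 h3 ⊢ <;>
    (simp only [abs_eq_max_neg, max_def] at h1 h3; split_ifs at h1 h3 <;> omega)

theorem fst_nonneg_of_inDiamond {h : ℤ} {z : BPoint} (hz : InDiamond h z) : 0 ≤ z.1 := by
  have h1 : absCharge z ≤ z.1 := hz.2.1
  have h2 : 0 ≤ absCharge z := abs_nonneg _
  omega

/-- a letter of ◇_h is never spacelike-separated from the origin. -/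
theorem not_spacelike_of_inDiamond {h : ℤ} {z : BPoint} (hz : InDiamond h z) : ¬ Spacelike (bsub z (0, 0, 0)) := by
  obtain ⟨α, a, b⟩ := z
  obtain ⟨hax, h1, -, -⟩ := hz
  simp only [AxisPt, absCharge, chargeOf, Prod.mk.injEq] at hax h1
  have key : a ^ 2 + b ^ 2 ≤ α ^ 2 := by
    rcases hax with ⟨rfl, rfl⟩ | ⟨-, rfl⟩ | ⟨rfl, -⟩
    · simp only [sub_self, abs_zero] at h1; nlinarith
    · simp only [sub_zero] at h1
      obtain ⟨l, r⟩ := abs_le.mp h1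
      nlinarith [mul_nonneg (sub_nonneg.mpr r) (show (0:ℤ) ≤ α + a by linarith)]
    · simp only [zero_sub, abs_neg] at h1
      obtain ⟨l, r⟩ := abs_le.mp h1
      nlinarith [mul_nonneg (sub_nonneg.mpr r) (show (0:ℤ) ≤ α + b by linarith)]
  simp only [Spacelike, bsub, sub_zero, not_lt]
  exact key

/-- **THE A2I⁻ INTERFACE AT THE ORIGIN** (KERNEL, every `h`) [◇_h, A2I⁻, `S₄` on E₋]. -/
theorem a2i_origin_interface {h : ℤ} {C : MConfig} (hU : C.InDiamond h) (hA : A2IMinusClosed C) (hGl : PermClosed C.lower)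
    {Z : MCell} (hZ : Z ∈ C.lower) {a b : Fin 4} (hab : a ≠ b) {φ : Fin 4} (ha : Z a = (0, 0, 0)) (hb : Z b = floorUnit φ)
    {q : MCell} (hq : q ∈ C.upper) (hqZ : MAgree q Z b) (hqb : q b = (0, 0, 0)) :
    ∃ P ∈ C.upper, MAgree2 P Z a b ∧ P a = floorUnit φ ∧ P b = (0, 0, 0) := by
  by_contra hno
  have hN' : Z.perm (Equiv.swap a b) ∈ C.lower := hGl (Equiv.swap a b) Z hZ
  have eNa : Z.perm (Equiv.swap a b) a = floorUnit φ := by show Z (Equiv.swap a b a) = _; rw [Equiv.swap_apply_left, hb]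
  have eNb : Z.perm (Equiv.swap a b) b = (0, 0, 0) := by show Z (Equiv.swap a b b) = _; rw [Equiv.swap_apply_right, ha]
  have hqa : q a = (0, 0, 0) := (hqZ a hab).trans ha
  have hZb1 : (Z b).1 = 1 := by rw [hb, floorUnit_fst]
  have hqb1 : (q b).1 = 0 := by rw [hqb]
  have hZa1 : (Z a).1 = 0 := by rw [ha]
  have hqa1 : (q a).1 = 0 := by rw [hqa]
  have nob : ∀ P ∈ C.upper, ∀ w : Fin 4, UPartner Z P b w → w = φ ∧ P b = (0, 0, 0) := fun P hP w hZP => by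
    have hd : 0 < (Z b).1 - (P b).1 := by have := hZP.2.1; omega
    have e : floorUnit φ = ray (P b) w ((Z b).1 - (P b).1) := by rw [← hb]; exact hZP.2.2
    exact below_floorUnit (hU.2 P hP b) hd e
  refine hA Z hZ q hq _ hN' b φ a φ ⟨by rw [hb]; exact floorUnit_not_isApex φ, ?_, ?_, fun _ => ?_, hab, ?_, ?_, ?_, ?_, ?_, ?_⟩
  · rw [hb]; fin_cases φ <;> simp [EncDir, cabs, ray]
  · exact ⟨hqZ, by omega, by rw [hZb1, hqb1, hb, hqb]; norm_num⟩
  · rw [hZb1, hqb1, hb]; fin_cases φ <;> simp [cabs, ray]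
  · refine ⟨fun g hg => ?_, by rw [eNa, floorUnit_fst, hqa1]; norm_num, by rw [eNa, floorUnit_fst, hqa1, hqa]; norm_num⟩
    by_cases hgb : g = b
    · rw [hgb, hqb, eNb]
    · show q g = Z (Equiv.swap a b g)
      rw [Equiv.swap_apply_of_ne_of_ne hg hgb]; exact hqZ g hgb
  · exact fun P hP w hw hZP => hw (nob P hP w hZP).1
  · exact fun P hP hZP => by rw [(nob P hP φ hZP).2, hqb]
  · exact fun P hP hqP => by
      have h1 := hqP.2.1; have h2 := fst_nonneg_of_inDiamond (hU.2 P hP b); rw [hqb1] at h1; exact absurd h1 (by omega)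
  · exact fun P hP hnb _ => by
      have h1 := hnb.1; have h2 := fst_nonneg_of_inDiamond (hU.2 P hP a); rw [hZa1] at h1; exact absurd h1 (by omega)
  · intro P hP hPg hul
    refine ⟨fun h3b => ?_, fun h3d => not_spacelike_of_inDiamond (hU.2 P hP a) (by rw [ha] at h3d; exact h3d.2)⟩
    have hNa1 : (Z.perm (Equiv.swap a b) a).1 = 1 := by rw [eNa, floorUnit_fst]
    have hPa1 : (P a).1 = 1 := by have := h3b.1; have := h3b.2.1; omega
    have hPa : P a = floorUnit φ := by
      have e := h3b.2.2; rw [hPa1, hZa1, ha] at e; rw [e]; norm_num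
    have hPb1 : (P b).1 = 0 := by have := hul.1; have := fst_nonneg_of_inDiamond (hU.2 P hP b); omega
    have hPb : P b = (0, 0, 0) := by
      have e := hul.2; rw [hqb1, hPb1, show ((0:ℤ) - 0) = 0 by norm_num, ray_zero] at e; rw [← e, hqb]
    exact hno ⟨P, hP, fun g hga hgb => hPg g hgb hga, hPa, hPb⟩

/-- **B4** `N{O, ℓ_φ, cu_χ, cu_χ'} ∉ C.lower` [◇_h, RULE D, X⁺, `S₄` both levels, `Δ` on E₊, A2I⁻]: `q = N(1 ↦ O)` (RULE D at `O` × the top of `ℓ_φ`),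
then the interface gives B2 after (0 1).  Census: the 10 `[Am]`-dependent round-1 orbits (kind `P:Xp`) of every diamond. -/
theorem loneUnit_pair_N_absent {h : ℤ} {C : MConfig} (hU : C.InDiamond h) (hDN : ∀ Z ∈ C.lower, RuleDMu4N C Z)
    (hDP : ∀ P ∈ C.upper, RuleDMu4P C P) (hX : XPlusClosed C) (hA : A2IMinusClosed C) (hGl : PermClosed C.lower)
    (hGu : PermClosed C.upper) (hΔu : DeltaClosed C.upper) {N : MCell} {φ χ χ' : Fin 4}
    (h0 : N 0 = (0, 0, 0)) (h1 : N 1 = floorUnit φ) (h2 : N 2 = ceilingUnit h χ) (h3 : N 3 = ceilingUnit h χ') : N ∉ C.lower := fun hN => by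
  have h0' : N 0 = floorLetter φ 0 := h0.trans (ray_zero _ φ).symm
  obtain ⟨q, hq, hqN, hq1⟩ := descent_of_floorNode_floorUnit hU (hDN N hN) (b := 0) (c := 1) (by decide) le_rfl h0' h1
  obtain ⟨P, hP, hPN, hP0, hP1⟩ := a2i_origin_interface hU hA hGl hN (a := 0) (b := 1) (by decide) h0 h1 hq hqN hq1
  exact loneUnit_pair_absent hU hDN hDP hX hΔu (P := P.perm (Equiv.swap 0 1)) (φ := φ) (χ := χ) (χ' := χ')
    (by show P (Equiv.swap (0 : Fin 4) 1 0) = _; simpa using hP1)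
    (by show P (Equiv.swap (0 : Fin 4) 1 1) = _; simpa using hP0)
    (by show P (Equiv.swap (0 : Fin 4) 1 2) = _; simpa [Equiv.swap_apply_of_ne_of_ne] using (hPN 2 (by decide) (by decide)).trans h2)
    (by show P (Equiv.swap (0 : Fin 4) 1 3) = _; simpa [Equiv.swap_apply_of_ne_of_ne] using (hPN 3 (by decide) (by decide)).trans h3)
    (hGu _ P hP)

/-- below a floor letter along its own ray sit the shorter floor letters (and `O`). -/
theorem floorLetter_downRay {h c d : ℤ} {z : BPoint} {ψ : Fin 4} (hz : InDiamond h z)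
    (heq : floorLetter ψ c = ray z ψ d) : 0 ≤ c - d ∧ z = floorLetter ψ (c - d) := by
  obtain ⟨α, a, b⟩ := z
  obtain ⟨hax, h1, -, -⟩ := hz
  simp only [AxisPt, absCharge, chargeOf, ray, Prod.mk.injEq] at hax h1 heq ⊢
  fin_cases ψ <;> simp at hax h1 heq ⊢ <;>
    (simp only [abs_eq_max_neg, max_def] at h1; split_ifs at h1 <;> omega)

/-- below the node-4 letter `4I + n·ℓ_u` in its node direction `u+2` sit exactly `2I + (n+1)·ℓ_u` and `(n+2)·ℓ_u`. -/
theorem nodeFourLine_downRay {h n d : ℤ} {z : BPoint} {u : Fin 4} (hn : 0 ≤ n) (hz : InDiamond h z) (hd : 0 < d)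
    (heq : ray ((4, 0, 0) : BPoint) u n = ray z (u + 2) d) : z = nodeTwoLetter u (n + 1) ∨ z = floorLetter u (n + 2) := by
  obtain ⟨α, a, b⟩ := z
  obtain ⟨hax, h1, -, -⟩ := hz
  simp only [AxisPt, absCharge, chargeOf, ray, Prod.mk.injEq] at hax h1 heq ⊢
  fin_cases u <;> simp at hax h1 heq ⊢ <;>
    (simp only [abs_eq_max_neg, max_def] at h1; split_ifs at h1 <;> omega)

theorem nodeFourLine_not_isApex (u : Fin 4) {n : ℤ} (hn : n ≠ 0) : ¬ isApex (ray ((4, 0, 0) : BPoint) u n) := by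
  fin_cases u <;> simp [isApex] <;> omega

/-- **UN1.** `N{ℓ_φ, c·ℓ_ψ, cu_χ, cu_χ'} ∉ C.lower` (`c ≥ 1`, `χ' ≠ χ`; ALL `φ, ψ`) [◇_h, RULE D, X⁺, `S₄` on E₊; every `h`]: the floor engine at the pin `ℓ_φ`
serves `c·ℓ_ψ` below along its ray — the children `P{ℓ_φ, c'·ℓ_ψ, cu_χ, cu_χ'}` (`0 ≤ c' < c`) are the pair fork A2.  (`c = 1` is B3 without `Δ`.)
Census: ◇₈ 88 ∕ ◇₁₀ 112 orbits (16 round 1 `P:Xp`, the rest round 2 `B:DN`), 72 ∕ 96 untyped before. -/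
theorem unitPairFloor_N_absent {h c : ℤ} {C : MConfig} (hU : C.InDiamond h) (hDN : ∀ Z ∈ C.lower, RuleDMu4N C Z)
    (hDP : ∀ P ∈ C.upper, RuleDMu4P C P) (hX : XPlusClosed C) (hGu : PermClosed C.upper) (hc : 1 ≤ c) {N : MCell}
    {φ ψ χ χ' : Fin 4} (hχ : χ' ≠ χ) (h0 : N 0 = floorUnit φ) (h1 : N 1 = floorLetter ψ c) (h2 : N 2 = ceilingUnit h χ)
    (h3 : N 3 = ceilingUnit h χ') : N ∉ C.lower := fun hN => by
  have hfl : OnFloor (N 0) := onFloor_of_coord_zero (hU.1 N hN 0) (k := φ + 2) (by rw [h0]; exact (floorLetter_node φ 1).2)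
  have hna : ¬ isApex (N 1) := by rw [h1]; exact floorLetter_not_isApex ψ (by omega)
  have hk : Adapted (N 1) ψ := by rw [h1]; exact (floorLetter_top ψ c).1
  have hk0 : coord (N 1) ψ ≠ 0 := by rw [h1, (floorLetter_top ψ c).2]; omega
  obtain ⟨P, hP, hZP⟩ := servedBelow_of_floorLetter hU hN (hDN N hN) (i := 0) (g := 1) (by decide) hfl hna hk hk0
  obtain ⟨hc', hP1⟩ := floorLetter_downRay (hU.2 P hP 1) (h1.symm.trans hZP.2.2)
  exact pairFork_floorUnit_absent hU hDN hDP hX hGu hc' hχ ((hZP.1 0 (by decide)).trans h0) hP1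
    ((hZP.1 2 (by decide)).trans h2) ((hZP.1 3 (by decide)).trans h3) hP

/-- **UN2.** `N{ℓ_φ, 4I + n·ℓ_u, cu_χ, cu_χ'} ∉ C.lower` (`n ≥ 1`, `χ' ≠ χ`; the node-4 line `t_2, s_2, y_2, …` of ◇_h, up to the ceiling) [same
hypotheses; every `h`]: the floor engine serves `4I + nℓ_u` below in its node direction — the children are A1 (`2I + (n+1)ℓ_u`) and A2 (`(n+2)ℓ_u`).
Census: ◇₈ 48 ∕ ◇₁₀ 72 orbits, all round 2 `B:DN`, all untyped before. -/
theorem unitPairNodeFour_N_absent {h n : ℤ} {C : MConfig} (hU : C.InDiamond h) (hDN : ∀ Z ∈ C.lower, RuleDMu4N C Z)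
    (hDP : ∀ P ∈ C.upper, RuleDMu4P C P) (hX : XPlusClosed C) (hGu : PermClosed C.upper) (hn : 1 ≤ n) {N : MCell}
    {φ u χ χ' : Fin 4} (hχ : χ' ≠ χ) (h0 : N 0 = floorUnit φ) (h1 : N 1 = ray ((4, 0, 0) : BPoint) u n)
    (h2 : N 2 = ceilingUnit h χ) (h3 : N 3 = ceilingUnit h χ') : N ∉ C.lower := fun hN => by
  have hfl : OnFloor (N 0) := onFloor_of_coord_zero (hU.1 N hN 0) (k := φ + 2) (by rw [h0]; exact (floorLetter_node φ 1).2)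
  have hna : ¬ isApex (N 1) := by rw [h1]; exact nodeFourLine_not_isApex u (by omega)
  have hk : Adapted (N 1) (u + 2) := by rw [h1]; exact (adapted_ray_apex 4 u n).2
  have hk0 : coord (N 1) (u + 2) ≠ 0 := by rw [h1, coord_ray_apex_antip]; norm_num
  obtain ⟨P, hP, hZP⟩ := servedBelow_of_floorLetter hU hN (hDN N hN) (i := 0) (g := 1) (by decide) hfl hna hk hk0
  have hP0 : P 0 = floorUnit φ := (hZP.1 0 (by decide)).trans h0
  have hP2 : P 2 = ceilingUnit h χ := (hZP.1 2 (by decide)).trans h2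
  have hP3 : P 3 = ceilingUnit h χ' := (hZP.1 3 (by decide)).trans h3
  rcases nodeFourLine_downRay (by omega) (hU.2 P hP 1) (by have := hZP.2.1; omega) (h1.symm.trans hZP.2.2) with hP1 | hP1
  · exact pairFork_nodeTwo_absent hU hDN hDP hX hGu (by norm_num : (0 : ℤ) ≤ 1) (by omega : 1 ≤ n + 1) hχ hP0 hP1 hP2 hP3 hP
  · exact pairFork_floorUnit_absent hU hDN hDP hX hGu (by omega : (0 : ℤ) ≤ n + 2) hχ hP0 hP1 hP2 hP3 hP

/-- the sub-apex up-server of §2 with the frame of `(h−2)I` as a parameter: the serving ceiling unit `cu_r` has `r ≠ k' + 2`. -/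
theorem subApex_upServer' {h : ℤ} {C : MConfig} (hU : C.InDiamond h) {P : MCell} (hP : P ∈ C.upper) (hD : RuleDMu4P C P) {g j : Fin 4}
    (hgj : g ≠ j) (hgc : OnCeiling h (P g)) (hj : P j = (h - 2, 0, 0)) (k' : Fin 4) :
    ∃ N ∈ C.lower, ∃ r : Fin 4, r ≠ k' + 2 ∧ (∀ i, i ≠ j → N i = P i) ∧ N j = ceilingUnit h r := by
  obtain ⟨m, hm, hmh⟩ := exists_top_dir hgc (hU.2 P hP g).1
  have hk' : Adapted (P j) k' := by rw [hj]; fin_cases k' <;> simp [Adapted]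
  have hk'c : coord (P j) k' = h - 2 := by rw [hj]; exact coord_of_isApex ⟨rfl, rfl⟩ k'
  have hne : coord (P g) m ≠ coord (P j) k' := by rw [hmh, hk'c]; omega
  have above : ∀ N ∈ C.lower, ∀ a : Fin 4, a ≠ m + 2 → (P g).1 < (N g).1 → N g = ray (P g) a ((N g).1 - (P g).1) → False :=
    fun N hN a ha hlt hray =>
      not_inDiamond_above_offnode hgc (hU.2 P hP g).1 hm hmh ha (by omega) hray (hU.1 N hN g).1 (hU.1 N hN g).2.2.2
  rcases hD g j hgj m k' hm hk' hne with ⟨r, hr, N, hN, hNP⟩ | ⟨r, hr, N, hN, hNP⟩ | ⟨a, b, ha, -, N, hN, -, hg1, hg2, -, -⟩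
  · exact (above N hN r hr hNP.2.1 hNP.2.2).elim
  · have he0 : 0 < (N j).1 - (P j).1 := by have := hNP.2.1; omega
    have e : N j = ray ((h - 2, 0, 0) : BPoint) r ((N j).1 - (P j).1) := by rw [← hj]; exact hNP.2.2
    have he1 := above_subApex he0 (hU.1 N hN j) e
    rw [he1] at e
    exact ⟨N, hN, r, hr, fun i hi => (hNP.1 i hi).symm, e⟩
  · have ha' : a ≠ m + 2 := by
      rcases ha with e | ⟨_, hne2⟩
      · rw [e]; exact fin4_ne_add_two m
      · exact hne2
    exact (above N hN a ha' hg1 hg2).elim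

/-- **UP1.** `P{ℓ_φ, 2I + n·ℓ_u, (h−2)·I, cu_χ} ∉ C.upper` (`n ≥ 1`) [◇_h, RULE D, X⁺, `S₄` on E₊; every `h`]: the sub-apex up-server in the frame `χ+2`
(pin `cu_χ`) gives `N{ℓ_φ, 2I + nℓ_u, cu_r, cu_χ}` with `r ≠ χ` = TN2.  Census: ◇₈ 48 ∕ ◇₁₀ 64 orbits (round 2 `B:DP`), 32 ∕ 48 untyped before. -/
theorem unitNodeTwoSubApex_P_absent {h n : ℤ} {C : MConfig} (hU : C.InDiamond h) (hDN : ∀ Z ∈ C.lower, RuleDMu4N C Z)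
    (hDP : ∀ P ∈ C.upper, RuleDMu4P C P) (hX : XPlusClosed C) (hGu : PermClosed C.upper) (hn : 1 ≤ n) {P : MCell}
    {φ u χ : Fin 4} (h0 : P 0 = floorUnit φ) (h1 : P 1 = nodeTwoLetter u n) (h2 : P 2 = (h - 2, 0, 0))
    (h3 : P 3 = ceilingUnit h χ) : P ∉ C.upper := fun hP => by
  obtain ⟨N, hN, r, hr, hNP, hN2⟩ := subApex_upServer' hU hP (hDP P hP) (g := 3) (j := 2) (by decide)
    (by rw [h3]; exact onCeiling_ceilingUnit h χ) h2 (χ + 2)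
  have hrχ : χ ≠ r := by rintro rfl; exact hr (fin4_add_two_add_two χ).symm
  exact unitNodeTwo_pair_N_absent hU hDN hDP hX hGu hn hrχ ((hNP 0 (by decide)).trans h0) ((hNP 1 (by decide)).trans h1)
    hN2 ((hNP 3 (by decide)).trans h3) hN

/-- **UP2.** `P{ℓ_φ, c·ℓ_ψ, (h−2)·I, cu_χ} ∉ C.upper` (`c ≥ 1`; ALL `φ, ψ`) [same; every `h`]: the sub-apex up-server gives UN1.  Census: ◇₈ 58 ∕ ◇₁₀ 74
orbits (round 2 `B:DP`), all untyped before. -/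
theorem unitFloorSubApex_P_absent {h c : ℤ} {C : MConfig} (hU : C.InDiamond h) (hDN : ∀ Z ∈ C.lower, RuleDMu4N C Z)
    (hDP : ∀ P ∈ C.upper, RuleDMu4P C P) (hX : XPlusClosed C) (hGu : PermClosed C.upper) (hc : 1 ≤ c) {P : MCell}
    {φ ψ χ : Fin 4} (h0 : P 0 = floorUnit φ) (h1 : P 1 = floorLetter ψ c) (h2 : P 2 = (h - 2, 0, 0))
    (h3 : P 3 = ceilingUnit h χ) : P ∉ C.upper := fun hP => by
  obtain ⟨N, hN, r, hr, hNP, hN2⟩ := subApex_upServer' hU hP (hDP P hP) (g := 3) (j := 2) (by decide)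
    (by rw [h3]; exact onCeiling_ceilingUnit h χ) h2 (χ + 2)
  have hrχ : χ ≠ r := by rintro rfl; exact hr (fin4_add_two_add_two χ).symm
  exact unitPairFloor_N_absent hU hDN hDP hX hGu hc hrχ ((hNP 0 (by decide)).trans h0) ((hNP 1 (by decide)).trans h1)
    hN2 ((hNP 3 (by decide)).trans h3) hN

/-- **VN1.** `N{ℓ_φ, 2I + n·ℓ_u, (h−2)·I, cu_χ} ∉ C.lower` (`n ≥ 1`) [same; every `h`]: the floor engine serves `2I + nℓ_u` below in its node direction —
the only child is `P{ℓ_φ, (n+1)ℓ_u, (h−2)I, cu_χ}` = UP2.  Census: ◇₈ 48 ∕ ◇₁₀ 64 orbits (round 2 `B:DN`), 32 ∕ 48 untyped before. -/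
theorem unitNodeTwoSubApex_N_absent {h n : ℤ} {C : MConfig} (hU : C.InDiamond h) (hDN : ∀ Z ∈ C.lower, RuleDMu4N C Z)
    (hDP : ∀ P ∈ C.upper, RuleDMu4P C P) (hX : XPlusClosed C) (hGu : PermClosed C.upper) (hn : 1 ≤ n) {N : MCell}
    {φ u χ : Fin 4} (h0 : N 0 = floorUnit φ) (h1 : N 1 = nodeTwoLetter u n) (h2 : N 2 = (h - 2, 0, 0))
    (h3 : N 3 = ceilingUnit h χ) : N ∉ C.lower := fun hN => by
  obtain ⟨P, hP, hNP, hP1⟩ := descent_of_floorNode_nodeTwo hU (by norm_num : (0 : ℤ) ≤ 1) hn (hDN N hN) (b := 0) (c := 1)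
    (by decide) h0 h1
  exact unitFloorSubApex_P_absent hU hDN hDP hX hGu (by omega : 1 ≤ n + 1) ((hNP.1 0 (by decide)).trans h0) hP1
    ((hNP.1 2 (by decide)).trans h2) ((hNP.1 3 (by decide)).trans h3) hP

/-- above the sub-top letter `s_m(w) = (h−4)I + ℓ_w` in its node direction `w+2` sit exactly `(h−2)I` and `cu_{w+2}`. -/
theorem subTop_upNode {h m e : ℤ} {z : BPoint} {w : Fin 4} (hh : h = 2 * m + 4) (hz : InDiamond h z) (he : 0 < e)
    (heq : z = ray (subCeilLetter m w m) (w + 2) e) : z = (h - 2, 0, 0) ∨ z = ceilingUnit h (w + 2) := by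
  subst heq hh
  obtain ⟨hax, h1, -, h3⟩ := hz
  simp only [AxisPt, absCharge, chargeOf, ray, Prod.mk.injEq] at hax h1 h3 ⊢
  fin_cases w <;> simp at hax h1 h3 ⊢ <;>
    (simp only [abs_eq_max_neg, max_def] at h1 h3; split_ifs at h1 h3 <;> omega)

/-- the SUB-TOP NODE UP-SERVER: in a `P`-cell with a ceiling letter at `g` and `s_m(w)` at `j`, the slot `j` is served above in the node direction of
`s_m` by `(h−2)I` or by `cu_{w+2}` (`upLine_of_ruleDMu4P` + `subTop_upNode`). -/
theorem subTopNode_upServer {h m : ℤ} {C : MConfig} (hU : C.InDiamond h) (hh : h = 2 * m + 4) {P : MCell}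
    (hP : P ∈ C.upper) (hD : RuleDMu4P C P) {g j : Fin 4} (hgj : g ≠ j) (hgc : OnCeiling h (P g)) {w : Fin 4}
    (hj : P j = subCeilLetter m w m) :
    ∃ N ∈ C.lower, (∀ i, i ≠ j → N i = P i) ∧ (N j = (h - 2, 0, 0) ∨ N j = ceilingUnit h (w + 2)) := by
  have hna : ¬ isApex (P j) := by rw [hj]; exact subCeilLetter_not_isApex w (by omega)
  have hk : Adapted (P j) (w + 2) := by rw [hj]; exact (subCeilLetter_node m w m).1
  have hkh : coord (P j) (w + 2) ≠ h := by rw [hj, (subCeilLetter_node m w m).2]; omega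
  obtain ⟨N, hN, hNP⟩ := upLine_of_ruleDMu4P hU hP hD hgj hgc hna hk hkh
  have e : N j = ray (subCeilLetter m w m) (w + 2) ((N j).1 - (P j).1) := by rw [← hj]; exact hNP.2.2
  exact ⟨N, hN, fun i hi => (hNP.1 i hi).symm, subTop_upNode hh (hU.1 N hN j) (by have := hNP.2.1; omega) e⟩

/-- **WP1a.** `P{ℓ_φ, 2I + n·ℓ_u, s_m(w), cu_χ} ∉ C.upper` (`n ≥ 1`, `χ ≠ w + 2`; `s_m(w) = (h−4)I + ℓ_w`) [◇_h, RULE D, X⁺, `S₄` on E₊]: the sub-top node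
up-server (pin `cu_χ`) gives `N{ℓ_φ, 2I + nℓ_u, (h−2)I, cu_χ}` = VN1 or `N{ℓ_φ, 2I + nℓ_u, cu_{w+2}, cu_χ}` = TN2.  Census: ◇₈ 144 ∕ ◇₁₀ 192 orbits
(◇₁₀: all round 2 `B:DP`; ◇₈: 48 round 1), 96 ∕ 144 untyped before — the classes `P{ℓ, t_1 ∕ r_1 ∕ y_m ∕ B, s_m, cu}` with `χ ≠ w+2`. -/
theorem unitNodeTwoSubTop_P_absent {h m n : ℤ} {C : MConfig} (hU : C.InDiamond h) (hDN : ∀ Z ∈ C.lower, RuleDMu4N C Z)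
    (hDP : ∀ P ∈ C.upper, RuleDMu4P C P) (hX : XPlusClosed C) (hGu : PermClosed C.upper) (hh : h = 2 * m + 4)
    (hn : 1 ≤ n) {P : MCell} {φ u w χ : Fin 4} (hχ : χ ≠ w + 2) (h0 : P 0 = floorUnit φ) (h1 : P 1 = nodeTwoLetter u n)
    (h2 : P 2 = subCeilLetter m w m) (h3 : P 3 = ceilingUnit h χ) : P ∉ C.upper := fun hP => by
  obtain ⟨N, hN, hNP, hN2 | hN2⟩ := subTopNode_upServer hU hh hP (hDP P hP) (g := 3) (j := 2) (by decide)
    (by rw [h3]; exact onCeiling_ceilingUnit h χ) h2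
  · exact unitNodeTwoSubApex_N_absent hU hDN hDP hX hGu hn ((hNP 0 (by decide)).trans h0) ((hNP 1 (by decide)).trans h1) hN2
      ((hNP 3 (by decide)).trans h3) hN
  · exact unitNodeTwo_pair_N_absent hU hDN hDP hX hGu hn hχ ((hNP 0 (by decide)).trans h0) ((hNP 1 (by decide)).trans h1) hN2
      ((hNP 3 (by decide)).trans h3) hN

/-- **WP2.** `P{ℓ_φ, 4I + n·ℓ_u, cu_χ, cu_χ'} ∉ C.upper` (`n ≥ 1`, `χ' ≠ χ`, the node-4 letter strictly below the ceiling: `4 + 2n < h`) [same; every `h`]: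
the up-line of `4I + nℓ_u` along its ray (pin `cu_χ`) stays on the node-4 line — UN2.  Census: ◇₈ 24 ∕ ◇₁₀ 48 orbits (round 2 `B:DP`), all untyped
before. -/
theorem unitPairNodeFour_P_absent {h n : ℤ} {C : MConfig} (hU : C.InDiamond h) (hDN : ∀ Z ∈ C.lower, RuleDMu4N C Z)
    (hDP : ∀ P ∈ C.upper, RuleDMu4P C P) (hX : XPlusClosed C) (hGu : PermClosed C.upper) (hn : 1 ≤ n) (hnh : 4 + 2 * n < h)
    {P : MCell} {φ u χ χ' : Fin 4} (hχ : χ' ≠ χ) (h0 : P 0 = floorUnit φ) (h1 : P 1 = ray ((4, 0, 0) : BPoint) u n)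
    (h2 : P 2 = ceilingUnit h χ) (h3 : P 3 = ceilingUnit h χ') : P ∉ C.upper := fun hP => by
  have hna : ¬ isApex (P 1) := by rw [h1]; exact nodeFourLine_not_isApex u (by omega)
  have hk : Adapted (P 1) u := by rw [h1]; exact (adapted_ray_apex 4 u n).1
  have hkh : coord (P 1) u ≠ h := by rw [h1, coord_ray_self, coord_of_isApex ⟨rfl, rfl⟩]; simp only; omega
  obtain ⟨N, hN, hNP⟩ := upLine_of_ruleDMu4P hU hP (hDP P hP) (g := 2) (j := 1) (by decide)
    (by rw [h2]; exact onCeiling_ceilingUnit h χ) hna hk hkh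
  have e : N 1 = ray ((4, 0, 0) : BPoint) u (n + ((N 1).1 - (P 1).1)) := by rw [ray_add, ← h1]; exact hNP.2.2
  exact unitPairNodeFour_N_absent hU hDN hDP hX hGu (by have := hNP.2.1; omega) hχ ((hNP.1 0 (by decide)).symm.trans h0) e
    ((hNP.1 2 (by decide)).symm.trans h2) ((hNP.1 3 (by decide)).symm.trans h3) hN

/-- below the apex `2I` in any direction `r` sits only the floor unit `ℓ_{r+2}`. -/
theorem apexTwo_downRay {h d : ℤ} {z : BPoint} {r : Fin 4} (hz : InDiamond h z) (hd : 0 < d)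
    (heq : ((2 : ℤ), (0 : ℤ), (0 : ℤ)) = ray z r d) : z = floorUnit (r + 2) := by
  obtain ⟨α, a, b⟩ := z
  obtain ⟨hax, h1, -, -⟩ := hz
  simp only [floorUnit, AxisPt, absCharge, chargeOf, ray, Prod.mk.injEq] at hax h1 heq ⊢
  fin_cases r <;> simp at hax h1 heq ⊢ <;>
    (simp only [abs_eq_max_neg, max_def] at h1; split_ifs at h1 <;> omega)

/-- **SERVICE BELOW OF AN APEX FORCED BY A FLOOR LETTER** (= `servedBelow_of_floorLetter` of the tree for an apex at `g`: served in SOME direction). -/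
theorem servedBelow_floor_apex {h : ℤ} {C : MConfig} (hU : C.InDiamond h) {Z : MCell} (hZ : Z ∈ C.lower) (hD : RuleDMu4N C Z) {i g : Fin 4}
    (hig : i ≠ g) (hi : OnFloor (Z i)) {k : Fin 4} (hk : Adapted (Z g) k) (hk0 : coord (Z g) k ≠ 0) : ∃ r, MServedBelow C Z g r := by
  obtain ⟨m, hm, hm0⟩ := exists_node_dir (hU.1 Z hZ i).1
  have hm0' : coord (Z i) m = 0 := by rw [hm0, hi, sub_self]
  have hne : coord (Z i) m ≠ coord (Z g) k := by rw [hm0']; exact Ne.symm hk0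
  have below : ∀ P ∈ C.upper, ∀ a : Fin 4, a ≠ m + 2 → (P i).1 < (Z i).1 → Z i = ray (P i) a ((Z i).1 - (P i).1) → False :=
    fun P hP a ha hlt hray =>
      not_inDiamond_below_offtop hi (hU.1 Z hZ i).1 hm hm0' ha (by omega) hray (hU.2 P hP i).1 (hU.2 P hP i).2.1
  rcases hD i g hig m k hm hk hne with ⟨r, hr, P, hP, hZP⟩ | ⟨r, -, P, hP, hZP⟩ | ⟨a, b, ha, -, P, hP, -, hi1, hi2, -, -⟩
  · exact (below P hP r hr hZP.2.1 hZP.2.2).elim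
  · exact ⟨r, P, hP, hZP⟩
  · have ha' : a ≠ m + 2 := by
      rcases ha with e | ⟨-, hne2⟩
      · rw [e]; exact fin4_ne_add_two m
      · exact hne2
    exact (below P hP a ha' hi1 hi2).elim

/-- **SERVICE ABOVE OF AN APEX FORCED BY A CEILING LETTER** (= `upLine_of_ruleDMu4P` of the tree for an apex at `j`: served in SOME direction). -/
theorem servedAbove_ceiling_apex {h : ℤ} {C : MConfig} (hU : C.InDiamond h) {P : MCell} (hP : P ∈ C.upper) (hD : RuleDMu4P C P) {g j : Fin 4}
    (hgj : g ≠ j) (hgc : OnCeiling h (P g)) {k : Fin 4} (hk : Adapted (P j) k) (hkh : coord (P j) k ≠ h) : ∃ r, MServedAbove C P j r := by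
  obtain ⟨m, hm, hmh⟩ := exists_top_dir hgc (hU.2 P hP g).1
  have hne : coord (P g) m ≠ coord (P j) k := by rw [hmh]; exact Ne.symm hkh
  have above : ∀ N ∈ C.lower, ∀ a : Fin 4, a ≠ m + 2 → (P g).1 < (N g).1 → N g = ray (P g) a ((N g).1 - (P g).1) → False :=
    fun N hN a ha hlt hray =>
      not_inDiamond_above_offnode hgc (hU.2 P hP g).1 hm hmh ha (by omega) hray (hU.1 N hN g).1 (hU.1 N hN g).2.2.2
  rcases hD g j hgj m k hm hk hne with ⟨r, hr, N, hN, hNP⟩ | ⟨r, -, N, hN, hNP⟩ | ⟨a, b, ha, -, N, hN, -, hg1, hg2, -, -⟩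
  · exact (above N hN r hr hNP.2.1 hNP.2.2).elim
  · exact ⟨r, N, hN, hNP⟩
  · have ha' : a ≠ m + 2 := by
      rcases ha with e | ⟨-, hne2⟩
      · rw [e]; exact fin4_ne_add_two m
      · exact hne2
    exact (above N hN a ha' hg1 hg2).elim

theorem adapted_apexTwo (k : Fin 4) : Adapted (((2 : ℤ), (0 : ℤ), (0 : ℤ)) : BPoint) k := by fin_cases k <;> simp [Adapted]

theorem coord_apexTwo (k : Fin 4) : coord (((2 : ℤ), (0 : ℤ), (0 : ℤ)) : BPoint) k = 2 := coord_of_isApex ⟨rfl, rfl⟩ k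

/-- **UN3.** `N{c·ℓ_ψ, 2I, cu_χ, cu_χ'} ∉ C.lower` (`c ≥ 1`, `χ' ≠ χ`) [◇_h, RULE D, X⁺, `S₄` on E₊; every `h`]: the floor pin serves the apex `2I` below in some
direction `r`, by the floor unit `ℓ_{r+2}` — the child `P{c·ℓ_ψ, ℓ_{r+2}, cu_χ, cu_χ'}` is the pair fork A2 (slots 0 ↔ 1 by `S₄`).  Census: ◇₈ 24 ∕ ◇₁₀ 30
orbits (round 2 `B:DN`), all untyped before. -/
theorem floorApexTwo_pair_N_absent {h c : ℤ} {C : MConfig} (hU : C.InDiamond h) (hDN : ∀ Z ∈ C.lower, RuleDMu4N C Z)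
    (hDP : ∀ P ∈ C.upper, RuleDMu4P C P) (hX : XPlusClosed C) (hGu : PermClosed C.upper) (hc : 1 ≤ c) {N : MCell}
    {ψ χ χ' : Fin 4} (hχ : χ' ≠ χ) (h0 : N 0 = floorLetter ψ c) (h1 : N 1 = (2, 0, 0)) (h2 : N 2 = ceilingUnit h χ)
    (h3 : N 3 = ceilingUnit h χ') : N ∉ C.lower := fun hN => by
  have hfl : OnFloor (N 0) := onFloor_of_coord_zero (hU.1 N hN 0) (k := ψ + 2) (by rw [h0]; exact (floorLetter_node ψ c).2)
  obtain ⟨r, P, hP, hZP⟩ := servedBelow_floor_apex hU hN (hDN N hN) (i := 0) (g := 1) (by decide) hfl (k := 0)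
    (by rw [h1]; exact adapted_apexTwo 0) (by rw [h1, coord_apexTwo]; norm_num)
  have hP1 : P 1 = floorUnit (r + 2) := apexTwo_downRay (hU.2 P hP 1) (by have := hZP.2.1; omega) (h1.symm.trans hZP.2.2)
  exact pairFork_floorUnit_absent hU hDN hDP hX hGu (by omega : 0 ≤ c) hχ (P := P.perm (Equiv.swap 0 1)) (φ := r + 2) (ψ := ψ)
    (by show P (Equiv.swap (0 : Fin 4) 1 0) = _; simpa using hP1)
    (by show P (Equiv.swap (0 : Fin 4) 1 1) = _; simpa using (hZP.1 0 (by decide)).trans h0)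
    (by show P (Equiv.swap (0 : Fin 4) 1 2) = _; simpa [Equiv.swap_apply_of_ne_of_ne] using (hZP.1 2 (by decide)).trans h2)
    (by show P (Equiv.swap (0 : Fin 4) 1 3) = _; simpa [Equiv.swap_apply_of_ne_of_ne] using (hZP.1 3 (by decide)).trans h3)
    (hGu _ P hP)

/-- **UP4.** `P{c·ℓ_ψ, 2I, (h−2)·I, cu_χ} ∉ C.upper` (`c ≥ 1`) [same; every `h`]: the sub-apex up-server (frame `χ+2`, pin `cu_χ`) gives UN3.  Census: ◇₈ 16 ∕
◇₁₀ 20 orbits (round 2 `B:DP`), all untyped before. -/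
theorem floorApexTwoSubApex_P_absent {h c : ℤ} {C : MConfig} (hU : C.InDiamond h) (hDN : ∀ Z ∈ C.lower, RuleDMu4N C Z)
    (hDP : ∀ P ∈ C.upper, RuleDMu4P C P) (hX : XPlusClosed C) (hGu : PermClosed C.upper) (hc : 1 ≤ c) {P : MCell}
    {ψ χ : Fin 4} (h0 : P 0 = floorLetter ψ c) (h1 : P 1 = (2, 0, 0)) (h2 : P 2 = (h - 2, 0, 0)) (h3 : P 3 = ceilingUnit h χ) :
    P ∉ C.upper := fun hP => by
  obtain ⟨N, hN, r, hr, hNP, hN2⟩ := subApex_upServer' hU hP (hDP P hP) (g := 3) (j := 2) (by decide)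
    (by rw [h3]; exact onCeiling_ceilingUnit h χ) h2 (χ + 2)
  have hrχ : χ ≠ r := by rintro rfl; exact hr (fin4_add_two_add_two χ).symm
  exact floorApexTwo_pair_N_absent hU hDN hDP hX hGu hc hrχ ((hNP 0 (by decide)).trans h0) ((hNP 1 (by decide)).trans h1) hN2
    ((hNP 3 (by decide)).trans h3) hN

/-- **VN4.** `N{c·ℓ_ψ, 2I, (h−2)·I, cu_χ} ∉ C.lower` (`c ≥ 1`) [same; every `h`]: the floor pin serves `2I` below by a floor unit `ℓ_{r+2}`; the child
`P{c·ℓ_ψ, ℓ_{r+2}, (h−2)I, cu_χ}` is UP2 (slots 0 ↔ 1).  Census: ◇₈ 16 ∕ ◇₁₀ 20 orbits (round 2 `B:DN`), all untyped before. -/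
theorem floorApexTwoSubApex_N_absent {h c : ℤ} {C : MConfig} (hU : C.InDiamond h) (hDN : ∀ Z ∈ C.lower, RuleDMu4N C Z)
    (hDP : ∀ P ∈ C.upper, RuleDMu4P C P) (hX : XPlusClosed C) (hGu : PermClosed C.upper) (hc : 1 ≤ c) {N : MCell}
    {ψ χ : Fin 4} (h0 : N 0 = floorLetter ψ c) (h1 : N 1 = (2, 0, 0)) (h2 : N 2 = (h - 2, 0, 0)) (h3 : N 3 = ceilingUnit h χ) :
    N ∉ C.lower := fun hN => by
  have hfl : OnFloor (N 0) := onFloor_of_coord_zero (hU.1 N hN 0) (k := ψ + 2) (by rw [h0]; exact (floorLetter_node ψ c).2)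
  obtain ⟨r, P, hP, hZP⟩ := servedBelow_floor_apex hU hN (hDN N hN) (i := 0) (g := 1) (by decide) hfl (k := 0)
    (by rw [h1]; exact adapted_apexTwo 0) (by rw [h1, coord_apexTwo]; norm_num)
  have hP1 : P 1 = floorUnit (r + 2) := apexTwo_downRay (hU.2 P hP 1) (by have := hZP.2.1; omega) (h1.symm.trans hZP.2.2)
  exact unitFloorSubApex_P_absent hU hDN hDP hX hGu hc (P := P.perm (Equiv.swap 0 1)) (φ := r + 2) (ψ := ψ) (χ := χ)
    (by show P (Equiv.swap (0 : Fin 4) 1 0) = _; simpa using hP1)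
    (by show P (Equiv.swap (0 : Fin 4) 1 1) = _; simpa using (hZP.1 0 (by decide)).trans h0)
    (by show P (Equiv.swap (0 : Fin 4) 1 2) = _; simpa [Equiv.swap_apply_of_ne_of_ne] using (hZP.1 2 (by decide)).trans h2)
    (by show P (Equiv.swap (0 : Fin 4) 1 3) = _; simpa [Equiv.swap_apply_of_ne_of_ne] using (hZP.1 3 (by decide)).trans h3)
    (hGu _ P hP)

/-- **WP1d.** `P{c·ℓ_ψ, 2I, s_m(w), cu_χ} ∉ C.upper` (`c ≥ 1`, `χ ≠ w + 2`, `h = 2m+4`) [same]: the sub-top node up-server gives VN4 or UN3.  Census: ◇₈ 48 ∕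
◇₁₀ 60 orbits (round 2 `B:DP`), 36 ∕ 48 untyped before. -/
theorem floorApexTwoSubTop_P_absent {h m c : ℤ} {C : MConfig} (hU : C.InDiamond h) (hDN : ∀ Z ∈ C.lower, RuleDMu4N C Z)
    (hDP : ∀ P ∈ C.upper, RuleDMu4P C P) (hX : XPlusClosed C) (hGu : PermClosed C.upper) (hh : h = 2 * m + 4) (hc : 1 ≤ c)
    {P : MCell} {ψ w χ : Fin 4} (hχ : χ ≠ w + 2) (h0 : P 0 = floorLetter ψ c) (h1 : P 1 = (2, 0, 0))
    (h2 : P 2 = subCeilLetter m w m) (h3 : P 3 = ceilingUnit h χ) : P ∉ C.upper := fun hP => by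
  obtain ⟨N, hN, hNP, hN2 | hN2⟩ := subTopNode_upServer hU hh hP (hDP P hP) (g := 3) (j := 2) (by decide)
    (by rw [h3]; exact onCeiling_ceilingUnit h χ) h2
  · exact floorApexTwoSubApex_N_absent hU hDN hDP hX hGu hc ((hNP 0 (by decide)).trans h0) ((hNP 1 (by decide)).trans h1) hN2
      ((hNP 3 (by decide)).trans h3) hN
  · exact floorApexTwo_pair_N_absent hU hDN hDP hX hGu hc hχ ((hNP 0 (by decide)).trans h0) ((hNP 1 (by decide)).trans h1) hN2
      ((hNP 3 (by decide)).trans h3) hN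

theorem nodeTwoLetter_downRay {h n d : ℤ} {z : BPoint} {v : Fin 4} (hz : InDiamond h z)
    (heq : nodeTwoLetter v n = ray z v d) : (1 ≤ n - d ∧ z = nodeTwoLetter v (n - d)) ∨ z = (2, 0, 0) ∨ z = floorUnit (v + 2) := by
  obtain ⟨α, a, b⟩ := z
  obtain ⟨hax, h1, -, -⟩ := hz
  simp only [floorUnit, AxisPt, absCharge, chargeOf, ray, Prod.mk.injEq] at hax h1 heq ⊢
  fin_cases v <;> simp at hax h1 heq ⊢ <;>
    (simp only [abs_eq_max_neg, max_def] at h1; split_ifs at h1 <;> omega)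

/-- **UP5g.** `P{c·ℓ_ψ, 2I, cu_χ, cu_χ'} ∉ C.upper` (`c ≥ 1`, `2c ≠ h`, `χ' ≠ χ`): pin `cu_χ`, the floor letter CLIMBS its ray
(frame `ψ`, coordinate `2c ≠ h`) → UN3 at `c+e`.  ◇₈ 18 ∕ ◇₁₀ 24, 12 ∕ 18 new. -/
theorem floorClimbApexTwo_pair_P_absent {h c : ℤ} {C : MConfig} (hU : C.InDiamond h) (hDN : ∀ Z ∈ C.lower, RuleDMu4N C Z)
    (hDP : ∀ P ∈ C.upper, RuleDMu4P C P) (hX : XPlusClosed C) (hGu : PermClosed C.upper) (hc : 1 ≤ c) (hch : 2 * c ≠ h)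
    {P : MCell} {ψ χ χ' : Fin 4} (hχ : χ' ≠ χ) (h0 : P 0 = floorLetter ψ c) (h1 : P 1 = (2, 0, 0)) (h2 : P 2 = ceilingUnit h χ)
    (h3 : P 3 = ceilingUnit h χ') : P ∉ C.upper := fun hP => by
  obtain ⟨N, hN, hNP⟩ := upLine_of_ruleDMu4P hU hP (hDP P hP) (g := 2) (j := 0) (by decide) (by rw [h2]; exact onCeiling_ceilingUnit h χ)
    (by rw [h0]; exact floorLetter_not_isApex ψ (by omega)) (k := ψ) (by rw [h0]; exact (floorLetter_top ψ c).1)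
    (by rw [h0, (floorLetter_top ψ c).2]; exact hch)
  have hlt := hNP.2.1
  have e : N 0 = floorLetter ψ (c + ((N 0).1 - (P 0).1)) := hNP.2.2.trans (by rw [h0]; exact (ray_add _ ψ _ _).symm)
  exact floorApexTwo_pair_N_absent hU hDN hDP hX hGu (by omega) hχ e ((hNP.1 1 (by decide)).symm.trans h1)
    ((hNP.1 2 (by decide)).symm.trans h2) ((hNP.1 3 (by decide)).symm.trans h3) hN

/-- **UN4.** `N{c·ℓ_ψ, 2I+n·ℓ_v, cu_χ, cu_χ'} ∉ C.lower` (`c ≥ 1`, `2c ≠ h`, `n ≥ 1`, `χ' ≠ χ`; the node-2 line up to `y_{m+1}`):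
floor pin, `2I+nℓ_v` down `v` → A1 ∕ UP5g (`2I`) ∕ A2 (`ℓ_{v+2}`, 0 ↔ 1); `c = 1` is TN2.  ◇₈ 216 ∕ ◇₁₀ 384, 96 ∕ 216 new. -/
theorem floorNodeTwo_pair_N_absent {h c n : ℤ} {C : MConfig} (hU : C.InDiamond h) (hDN : ∀ Z ∈ C.lower, RuleDMu4N C Z)
    (hDP : ∀ P ∈ C.upper, RuleDMu4P C P) (hX : XPlusClosed C) (hGu : PermClosed C.upper) (hc : 1 ≤ c) (hch : 2 * c ≠ h) (hn : 1 ≤ n)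
    {N : MCell} {ψ v χ χ' : Fin 4} (hχ : χ' ≠ χ) (h0 : N 0 = floorLetter ψ c) (h1 : N 1 = nodeTwoLetter v n)
    (h2 : N 2 = ceilingUnit h χ) (h3 : N 3 = ceilingUnit h χ') : N ∉ C.lower := fun hN => by
  have hfl : OnFloor (N 0) := onFloor_of_coord_zero (hU.1 N hN 0) (k := ψ + 2) (by rw [h0]; exact (floorLetter_node ψ c).2)
  have hna : ¬ isApex (N 1) := by rw [h1]; exact nodeTwoLetter_not_isApex v (by omega)
  have hk : Adapted (N 1) v := by rw [h1]; exact (nodeTwoLetter_top v n).1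
  have hk0 : coord (N 1) v ≠ 0 := by rw [h1, (nodeTwoLetter_top v n).2]; omega
  obtain ⟨P, hP, hZP⟩ := servedBelow_of_floorLetter hU hN (hDN N hN) (i := 0) (g := 1) (by decide) hfl hna hk hk0
  have hlt := hZP.2.1
  rcases nodeTwoLetter_downRay (hU.2 P hP 1) (h1.symm.trans hZP.2.2) with ⟨hle, hP1⟩ | hP1 | hP1
  · exact pairFork_nodeTwo_absent hU hDN hDP hX hGu (by omega : 0 ≤ c) hle hχ ((hZP.1 0 (by decide)).trans h0) hP1
      ((hZP.1 2 (by decide)).trans h2) ((hZP.1 3 (by decide)).trans h3) hP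
  · exact floorClimbApexTwo_pair_P_absent hU hDN hDP hX hGu hc hch hχ ((hZP.1 0 (by decide)).trans h0) hP1
      ((hZP.1 2 (by decide)).trans h2) ((hZP.1 3 (by decide)).trans h3) hP
  · exact pairFork_floorUnit_absent hU hDN hDP hX hGu (by omega : 0 ≤ c) hχ (P := P.perm (Equiv.swap 0 1)) (φ := v + 2) (ψ := ψ)
      (by show P (Equiv.swap (0 : Fin 4) 1 0) = _; simpa using hP1)
      (by show P (Equiv.swap (0 : Fin 4) 1 1) = _; simpa using (hZP.1 0 (by decide)).trans h0)
      (by show P (Equiv.swap (0 : Fin 4) 1 2) = _; simpa [Equiv.swap_apply_of_ne_of_ne] using (hZP.1 2 (by decide)).trans h2)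
      (by show P (Equiv.swap (0 : Fin 4) 1 3) = _; simpa [Equiv.swap_apply_of_ne_of_ne] using (hZP.1 3 (by decide)).trans h3)
      (hGu _ P hP)


/-! ## §1 The node-2 LINE `2I + n·ℓ_v` over a floor letter of any charge (`2c ≠ h`) with the sub-apex ∕ the sub-top letter (v0.1; law-free, every `h`) -/

/-- **UP1g.** `P{c·ℓ_ψ, 2I+n·ℓ_v, (h−2)·I, cu_χ} ∉ C.upper` (`c ≥ 1`, `2c ≠ h`, `n ≥ 1`) [◇_h, RULE D, X⁺, `S₄` on E₊; every `h`]: the sub-apex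
up-server (pin `cu_χ`, frame `χ+2`) lifts `(h−2)I` to `cu_r`, `r ≠ χ` — the child `N{c·ℓ_ψ, 2I+nℓ_v, cu_r, cu_χ}` is UN4.  (`c = 1` is UP1.)
Census: ◇₈ 144 ∕ ◇₁₀ 256 orbits (round 2 `B:DP`), 32 ∕ 96 untyped before. -/
theorem floorNodeTwoSubApex_P_absent {h c n : ℤ} {C : MConfig} (hU : C.InDiamond h) (hDN : ∀ Z ∈ C.lower, RuleDMu4N C Z)
    (hDP : ∀ P ∈ C.upper, RuleDMu4P C P) (hX : XPlusClosed C) (hGu : PermClosed C.upper) (hc : 1 ≤ c) (hch : 2 * c ≠ h) (hn : 1 ≤ n)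
    {P : MCell} {ψ v χ : Fin 4} (h0 : P 0 = floorLetter ψ c) (h1 : P 1 = nodeTwoLetter v n) (h2 : P 2 = (h - 2, 0, 0))
    (h3 : P 3 = ceilingUnit h χ) : P ∉ C.upper := fun hP => by
  obtain ⟨N, hN, r, hr, hNP, hN2⟩ := subApex_upServer' hU hP (hDP P hP) (g := 3) (j := 2) (by decide)
    (by rw [h3]; exact onCeiling_ceilingUnit h χ) h2 (χ + 2)
  have hrχ : χ ≠ r := by rintro rfl; exact hr (fin4_add_two_add_two χ).symm
  exact floorNodeTwo_pair_N_absent hU hDN hDP hX hGu hc hch hn hrχ ((hNP 0 (by decide)).trans h0) ((hNP 1 (by decide)).trans h1) hN2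
    ((hNP 3 (by decide)).trans h3) hN

/-- **VN6.** `N{c·ℓ_ψ, 2I+n·ℓ_v, (h−2)·I, cu_χ} ∉ C.lower` (`c ≥ 1`, `2c ≠ h`, `n ≥ 1`) [same]: the floor pin serves `2I+nℓ_v` below along `v` —
the children are UP1g (`2I+(n−d)ℓ_v`), UP4 (`2I`) and UP2 (`ℓ_{v+2}`, slots 0 ↔ 1).  (`c = 1` is VN1; `n = 1` is VN5.)  Census: ◇₈ 144 ∕ ◇₁₀ 256
orbits (round 2 `B:DN`), 32 ∕ 96 untyped before. -/
theorem floorNodeTwoSubApex_N_absent {h c n : ℤ} {C : MConfig} (hU : C.InDiamond h) (hDN : ∀ Z ∈ C.lower, RuleDMu4N C Z)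
    (hDP : ∀ P ∈ C.upper, RuleDMu4P C P) (hX : XPlusClosed C) (hGu : PermClosed C.upper) (hc : 1 ≤ c) (hch : 2 * c ≠ h) (hn : 1 ≤ n)
    {N : MCell} {ψ v χ : Fin 4} (h0 : N 0 = floorLetter ψ c) (h1 : N 1 = nodeTwoLetter v n) (h2 : N 2 = (h - 2, 0, 0))
    (h3 : N 3 = ceilingUnit h χ) : N ∉ C.lower := fun hN => by
  have hfl : OnFloor (N 0) := onFloor_of_coord_zero (hU.1 N hN 0) (k := ψ + 2) (by rw [h0]; exact (floorLetter_node ψ c).2)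
  have hna : ¬ isApex (N 1) := by rw [h1]; exact nodeTwoLetter_not_isApex v (by omega)
  have hk : Adapted (N 1) v := by rw [h1]; exact (nodeTwoLetter_top v n).1
  have hk0 : coord (N 1) v ≠ 0 := by rw [h1, (nodeTwoLetter_top v n).2]; omega
  obtain ⟨P, hP, hZP⟩ := servedBelow_of_floorLetter hU hN (hDN N hN) (i := 0) (g := 1) (by decide) hfl hna hk hk0
  have hlt := hZP.2.1
  rcases nodeTwoLetter_downRay (hU.2 P hP 1) (h1.symm.trans hZP.2.2) with ⟨hle, hP1⟩ | hP1 | hP1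
  · exact floorNodeTwoSubApex_P_absent hU hDN hDP hX hGu hc hch hle ((hZP.1 0 (by decide)).trans h0) hP1
      ((hZP.1 2 (by decide)).trans h2) ((hZP.1 3 (by decide)).trans h3) hP
  · exact floorApexTwoSubApex_P_absent hU hDN hDP hX hGu hc ((hZP.1 0 (by decide)).trans h0) hP1
      ((hZP.1 2 (by decide)).trans h2) ((hZP.1 3 (by decide)).trans h3) hP
  · exact unitFloorSubApex_P_absent hU hDN hDP hX hGu hc (P := P.perm (Equiv.swap 0 1)) (φ := v + 2) (ψ := ψ) (χ := χ)
      (by show P (Equiv.swap (0 : Fin 4) 1 0) = _; simpa using hP1)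
      (by show P (Equiv.swap (0 : Fin 4) 1 1) = _; simpa using (hZP.1 0 (by decide)).trans h0)
      (by show P (Equiv.swap (0 : Fin 4) 1 2) = _; simpa [Equiv.swap_apply_of_ne_of_ne] using (hZP.1 2 (by decide)).trans h2)
      (by show P (Equiv.swap (0 : Fin 4) 1 3) = _; simpa [Equiv.swap_apply_of_ne_of_ne] using (hZP.1 3 (by decide)).trans h3)
      (hGu _ P hP)

/-- **WP1g.** `P{c·ℓ_ψ, 2I+n·ℓ_v, s_m(w), cu_χ} ∉ C.upper` (`c ≥ 1`, `2c ≠ h`, `n ≥ 1`, `χ ≠ w + 2`, `h = 2m+4`) [same]: the sub-top node up-server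
(pin `cu_χ`) lifts `s_m(w)` to `(h−2)I` or to `cu_{w+2}` — the children are VN6 and UN4.  (`c = 1` is WP1a.)  Census: ◇₈ 432 ∕ ◇₁₀ 768 orbits
(◇₈: 384 round 2 `B:DP` + 48 round 1 = the `c = 1` members; ◇₁₀: round 2 `B:DP`), 192 ∕ 432 untyped before. -/
theorem floorNodeTwoSubTop_P_absent {h m c n : ℤ} {C : MConfig} (hU : C.InDiamond h) (hDN : ∀ Z ∈ C.lower, RuleDMu4N C Z)
    (hDP : ∀ P ∈ C.upper, RuleDMu4P C P) (hX : XPlusClosed C) (hGu : PermClosed C.upper) (hh : h = 2 * m + 4) (hc : 1 ≤ c)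
    (hch : 2 * c ≠ h) (hn : 1 ≤ n) {P : MCell} {ψ v w χ : Fin 4} (hχ : χ ≠ w + 2) (h0 : P 0 = floorLetter ψ c)
    (h1 : P 1 = nodeTwoLetter v n) (h2 : P 2 = subCeilLetter m w m) (h3 : P 3 = ceilingUnit h χ) : P ∉ C.upper := fun hP => by
  obtain ⟨N, hN, hNP, hN2 | hN2⟩ := subTopNode_upServer hU hh hP (hDP P hP) (g := 3) (j := 2) (by decide)
    (by rw [h3]; exact onCeiling_ceilingUnit h χ) h2
  · exact floorNodeTwoSubApex_N_absent hU hDN hDP hX hGu hc hch hn ((hNP 0 (by decide)).trans h0) ((hNP 1 (by decide)).trans h1) hN2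
      ((hNP 3 (by decide)).trans h3) hN
  · exact floorNodeTwo_pair_N_absent hU hDN hDP hX hGu hc hch hn hχ ((hNP 0 (by decide)).trans h0) ((hNP 1 (by decide)).trans h1) hN2
      ((hNP 3 (by decide)).trans h3) hN

/-! ### ◇₁₀ census representatives of the §1 families (`c = 2`, `n = 2`: the letter `t₁(v) = 2I + 2ℓ_v` of ◇₁₀) -/
def repUP1g : MCell := ![(2, -2, 0), (4, -2, 0), (8, 0, 0), (9, -1, 0)]
theorem repUP1g_absent {C : MConfig} (hU : C.InDiamond 10) (hG : C.G1Closed) (hS : C.StaticH1) : repUP1g ∉ C.upper :=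
  floorNodeTwoSubApex_P_absent hU hS.1.1 hS.1.2 hS.2.1 hG.2.1 (c := 2) (n := 2) (by norm_num) (by norm_num) (by norm_num) (ψ := 2) (v := 2)
    (χ := 2) (by simp [repUP1g, ray]) (by simp [repUP1g, ray]) (by simp [repUP1g]) (by simp [repUP1g, ray])
theorem repVN6_absent {C : MConfig} (hU : C.InDiamond 10) (hG : C.G1Closed) (hS : C.StaticH1) : repUP1g ∉ C.lower :=
  floorNodeTwoSubApex_N_absent hU hS.1.1 hS.1.2 hS.2.1 hG.2.1 (c := 2) (n := 2) (by norm_num) (by norm_num) (by norm_num) (ψ := 2) (v := 2)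
    (χ := 2) (by simp [repUP1g, ray]) (by simp [repUP1g, ray]) (by simp [repUP1g]) (by simp [repUP1g, ray])
def repWP1g : MCell := ![(2, -2, 0), (4, -2, 0), (7, -1, 0), (9, -1, 0)]
theorem repWP1g_absent {C : MConfig} (hU : C.InDiamond 10) (hG : C.G1Closed) (hS : C.StaticH1) : repWP1g ∉ C.upper :=
  floorNodeTwoSubTop_P_absent hU hS.1.1 hS.1.2 hS.2.1 hG.2.1 (m := 3) (by norm_num) (c := 2) (n := 2) (by norm_num) (by norm_num)
    (by norm_num) (ψ := 2) (v := 2) (w := 2) (χ := 2) (by decide) (by simp [repWP1g, ray]) (by simp [repWP1g, ray])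
    (by simp [repWP1g, subCeilLetter, ray]) (by simp [repWP1g, ray])


/-! ## §2 The A2I⁻ origin interface climbs the charge: `P{O, ℓ_φ, (h−2)I, cu_χ}`, `N{ℓ_ρ, c·ℓ_ψ, (h−2)I, cu_χ}`, `P{ℓ_ρ, c·ℓ_ψ, s_m, cu_χ}` and the
node-2 line over the sub-top letter at level `N` (v0.1; uses `A2IMinusClosed` through B4 of `CeilingPair.lean` §14, every `h`) -/

/-- **OP1.** `P{O, ℓ_φ, (h−2)·I, cu_χ} ∉ C.upper` [◇_h, RULE D, X⁺, A2I⁻, `S₄` both levels, `Δ` on E₊; every `h`]: the sub-apex up-server lifts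
`(h−2)I` to a ceiling unit `cu_r` — the child `N{O, ℓ_φ, cu_r, cu_χ}` is B4 (any `r`).  Census: ◇₈ 4 ∕ ◇₁₀ 4 orbits (round 2 `B:DP`), untyped before. -/
theorem originUnitSubApex_P_absent {h : ℤ} {C : MConfig} (hU : C.InDiamond h) (hDN : ∀ Z ∈ C.lower, RuleDMu4N C Z)
    (hDP : ∀ P ∈ C.upper, RuleDMu4P C P) (hX : XPlusClosed C) (hA : A2IMinusClosed C) (hGl : PermClosed C.lower)
    (hGu : PermClosed C.upper) (hΔu : DeltaClosed C.upper) {P : MCell} {φ χ : Fin 4} (h0 : P 0 = (0, 0, 0))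
    (h1 : P 1 = floorUnit φ) (h2 : P 2 = (h - 2, 0, 0)) (h3 : P 3 = ceilingUnit h χ) : P ∉ C.upper := fun hP => by
  obtain ⟨N, hN, r, -, hNP, hN2⟩ := subApex_upServer' hU hP (hDP P hP) (g := 3) (j := 2) (by decide)
    (by rw [h3]; exact onCeiling_ceilingUnit h χ) h2 χ
  exact loneUnit_pair_N_absent hU hDN hDP hX hA hGl hGu hΔu ((hNP 0 (by decide)).trans h0) ((hNP 1 (by decide)).trans h1) hN2
    ((hNP 3 (by decide)).trans h3) hN

/-- **VN7.** `N{ℓ_ρ, c·ℓ_ψ, (h−2)·I, cu_χ} ∉ C.lower` (`c ≥ 1`; ALL `ρ, ψ`) [as OP1]: the floor pin `ℓ_ρ` serves `c·ℓ_ψ` below along its ray — the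
children `P{ℓ_ρ, c'·ℓ_ψ, (h−2)I, cu_χ}` are UP2 (`c' ≥ 1`) and OP1 (`c' = 0`, slots 0 ↔ 1).  Census: ◇₈ 58 ∕ ◇₁₀ 74 orbits (round 2 `B:DN`),
all untyped before. -/
theorem unitFloorSubApex_N_absent {h c : ℤ} {C : MConfig} (hU : C.InDiamond h) (hDN : ∀ Z ∈ C.lower, RuleDMu4N C Z)
    (hDP : ∀ P ∈ C.upper, RuleDMu4P C P) (hX : XPlusClosed C) (hA : A2IMinusClosed C) (hGl : PermClosed C.lower)
    (hGu : PermClosed C.upper) (hΔu : DeltaClosed C.upper) (hc : 1 ≤ c) {N : MCell} {ρ ψ χ : Fin 4} (h0 : N 0 = floorUnit ρ)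
    (h1 : N 1 = floorLetter ψ c) (h2 : N 2 = (h - 2, 0, 0)) (h3 : N 3 = ceilingUnit h χ) : N ∉ C.lower := fun hN => by
  have hfl : OnFloor (N 0) := onFloor_of_coord_zero (hU.1 N hN 0) (k := ρ + 2) (by rw [h0]; exact (floorLetter_node ρ 1).2)
  have hna : ¬ isApex (N 1) := by rw [h1]; exact floorLetter_not_isApex ψ (by omega)
  have hk : Adapted (N 1) ψ := by rw [h1]; exact (floorLetter_top ψ c).1
  have hk0 : coord (N 1) ψ ≠ 0 := by rw [h1, (floorLetter_top ψ c).2]; omega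
  obtain ⟨P, hP, hZP⟩ := servedBelow_of_floorLetter hU hN (hDN N hN) (i := 0) (g := 1) (by decide) hfl hna hk hk0
  obtain ⟨hc', hP1⟩ := floorLetter_downRay (hU.2 P hP 1) (h1.symm.trans hZP.2.2)
  rcases (show 1 ≤ c - ((N 1).1 - (P 1).1) ∨ c - ((N 1).1 - (P 1).1) = 0 by omega) with hle | hze
  · exact unitFloorSubApex_P_absent hU hDN hDP hX hGu hle ((hZP.1 0 (by decide)).trans h0) hP1 ((hZP.1 2 (by decide)).trans h2)
      ((hZP.1 3 (by decide)).trans h3) hP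
  · rw [hze] at hP1
    have hP1' : P 1 = (0, 0, 0) := hP1.trans (ray_zero _ _)
    exact originUnitSubApex_P_absent hU hDN hDP hX hA hGl hGu hΔu (P := P.perm (Equiv.swap 0 1)) (φ := ρ) (χ := χ)
      (by show P (Equiv.swap (0 : Fin 4) 1 0) = _; simpa using hP1')
      (by show P (Equiv.swap (0 : Fin 4) 1 1) = _; simpa using (hZP.1 0 (by decide)).trans h0)
      (by show P (Equiv.swap (0 : Fin 4) 1 2) = _; simpa [Equiv.swap_apply_of_ne_of_ne] using (hZP.1 2 (by decide)).trans h2)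
      (by show P (Equiv.swap (0 : Fin 4) 1 3) = _; simpa [Equiv.swap_apply_of_ne_of_ne] using (hZP.1 3 (by decide)).trans h3)
      (hGu _ P hP)

/-- **XP1.** `P{ℓ_ρ, c·ℓ_ψ, s_m(w), cu_χ} ∉ C.upper` (`c ≥ 1`, `χ ≠ w + 2`, `h = 2m+4`) [as OP1]: the sub-top node up-server lifts `s_m(w)` to `(h−2)I`
(VN7) or to `cu_{w+2}` (UN1).  (`c = 1` is inside TP20.)  Census: ◇₈ 174 ∕ ◇₁₀ 222 orbits (round 2 `B:DP`), 144 ∕ 192 untyped before. -/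
theorem unitFloorSubTop_P_absent {h m c : ℤ} {C : MConfig} (hU : C.InDiamond h) (hDN : ∀ Z ∈ C.lower, RuleDMu4N C Z)
    (hDP : ∀ P ∈ C.upper, RuleDMu4P C P) (hX : XPlusClosed C) (hA : A2IMinusClosed C) (hGl : PermClosed C.lower)
    (hGu : PermClosed C.upper) (hΔu : DeltaClosed C.upper) (hh : h = 2 * m + 4) (hc : 1 ≤ c) {P : MCell} {ρ ψ w χ : Fin 4}
    (hχ : χ ≠ w + 2) (h0 : P 0 = floorUnit ρ) (h1 : P 1 = floorLetter ψ c) (h2 : P 2 = subCeilLetter m w m)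
    (h3 : P 3 = ceilingUnit h χ) : P ∉ C.upper := fun hP => by
  obtain ⟨N, hN, hNP, hN2 | hN2⟩ := subTopNode_upServer hU hh hP (hDP P hP) (g := 3) (j := 2) (by decide)
    (by rw [h3]; exact onCeiling_ceilingUnit h χ) h2
  · exact unitFloorSubApex_N_absent hU hDN hDP hX hA hGl hGu hΔu hc ((hNP 0 (by decide)).trans h0) ((hNP 1 (by decide)).trans h1) hN2
      ((hNP 3 (by decide)).trans h3) hN
  · exact unitPairFloor_N_absent hU hDN hDP hX hGu hc hχ ((hNP 0 (by decide)).trans h0) ((hNP 1 (by decide)).trans h1) hN2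
      ((hNP 3 (by decide)).trans h3) hN

/-- **WN1g.** `N{c·ℓ_ψ, 2I+n·ℓ_v, s_m(w), cu_χ} ∉ C.lower` (`c ≥ 1`, `2c ≠ h`, `n ≥ 1`, `χ ≠ w + 2`, `h = 2m+4`) [as OP1]: the floor pin serves
`2I+nℓ_v` below along `v` — the children are WP1g (`2I+(n−d)ℓ_v`), WP1d (`2I`) and XP1 (`ℓ_{v+2}`, slots 0 ↔ 1).  (`c = n = 1` is inside TN16.)
Census: ◇₈ 432 ∕ ◇₁₀ 768 orbits (round 2 `B:DN`; at ◇₈ 24 of them round 1 `P:Am`), 240 ∕ 528 untyped before. -/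
theorem floorNodeTwoSubTop_N_absent {h m c n : ℤ} {C : MConfig} (hU : C.InDiamond h) (hDN : ∀ Z ∈ C.lower, RuleDMu4N C Z)
    (hDP : ∀ P ∈ C.upper, RuleDMu4P C P) (hX : XPlusClosed C) (hA : A2IMinusClosed C) (hGl : PermClosed C.lower)
    (hGu : PermClosed C.upper) (hΔu : DeltaClosed C.upper) (hh : h = 2 * m + 4) (hc : 1 ≤ c) (hch : 2 * c ≠ h) (hn : 1 ≤ n)
    {N : MCell} {ψ v w χ : Fin 4} (hχ : χ ≠ w + 2) (h0 : N 0 = floorLetter ψ c) (h1 : N 1 = nodeTwoLetter v n)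
    (h2 : N 2 = subCeilLetter m w m) (h3 : N 3 = ceilingUnit h χ) : N ∉ C.lower := fun hN => by
  have hfl : OnFloor (N 0) := onFloor_of_coord_zero (hU.1 N hN 0) (k := ψ + 2) (by rw [h0]; exact (floorLetter_node ψ c).2)
  have hna : ¬ isApex (N 1) := by rw [h1]; exact nodeTwoLetter_not_isApex v (by omega)
  have hk : Adapted (N 1) v := by rw [h1]; exact (nodeTwoLetter_top v n).1
  have hk0 : coord (N 1) v ≠ 0 := by rw [h1, (nodeTwoLetter_top v n).2]; omega
  obtain ⟨P, hP, hZP⟩ := servedBelow_of_floorLetter hU hN (hDN N hN) (i := 0) (g := 1) (by decide) hfl hna hk hk0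
  rcases nodeTwoLetter_downRay (hU.2 P hP 1) (h1.symm.trans hZP.2.2) with ⟨hle, hP1⟩ | hP1 | hP1
  · exact floorNodeTwoSubTop_P_absent hU hDN hDP hX hGu hh hc hch hle hχ ((hZP.1 0 (by decide)).trans h0) hP1
      ((hZP.1 2 (by decide)).trans h2) ((hZP.1 3 (by decide)).trans h3) hP
  · exact floorApexTwoSubTop_P_absent hU hDN hDP hX hGu hh hc hχ ((hZP.1 0 (by decide)).trans h0) hP1
      ((hZP.1 2 (by decide)).trans h2) ((hZP.1 3 (by decide)).trans h3) hP
  · exact unitFloorSubTop_P_absent hU hDN hDP hX hA hGl hGu hΔu hh hc (P := P.perm (Equiv.swap 0 1)) (ρ := v + 2) (ψ := ψ)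
      (w := w) (χ := χ) hχ
      (by show P (Equiv.swap (0 : Fin 4) 1 0) = _; simpa using hP1)
      (by show P (Equiv.swap (0 : Fin 4) 1 1) = _; simpa using (hZP.1 0 (by decide)).trans h0)
      (by show P (Equiv.swap (0 : Fin 4) 1 2) = _; simpa [Equiv.swap_apply_of_ne_of_ne] using (hZP.1 2 (by decide)).trans h2)
      (by show P (Equiv.swap (0 : Fin 4) 1 3) = _; simpa [Equiv.swap_apply_of_ne_of_ne] using (hZP.1 3 (by decide)).trans h3)
      (hGu _ P hP)

/-! ### ◇₁₀ census representatives of the §2 families -/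
def repOP1 : MCell := ![(0, 0, 0), (1, -1, 0), (8, 0, 0), (9, -1, 0)]
theorem repOP1_absent {C : MConfig} (hU : C.InDiamond 10) (hG : C.G1Closed) (hS : C.StaticH1) : repOP1 ∉ C.upper :=
  originUnitSubApex_P_absent hU hS.1.1 hS.1.2 hS.2.1 hS.2.2 hG.1 hG.2.1 hG.2.2.2 (φ := 2) (χ := 2) (by simp [repOP1])
    (by simp [repOP1, ray]) (by simp [repOP1]) (by simp [repOP1, ray])
def repVN7 : MCell := ![(1, -1, 0), (2, -2, 0), (8, 0, 0), (9, -1, 0)]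
theorem repVN7_absent {C : MConfig} (hU : C.InDiamond 10) (hG : C.G1Closed) (hS : C.StaticH1) : repVN7 ∉ C.lower :=
  unitFloorSubApex_N_absent hU hS.1.1 hS.1.2 hS.2.1 hS.2.2 hG.1 hG.2.1 hG.2.2.2 (c := 2) (by norm_num) (ρ := 2) (ψ := 2) (χ := 2)
    (by simp [repVN7, ray]) (by simp [repVN7, ray]) (by simp [repVN7]) (by simp [repVN7, ray])
def repXP1 : MCell := ![(1, -1, 0), (2, -2, 0), (7, -1, 0), (9, -1, 0)]
theorem repXP1_absent {C : MConfig} (hU : C.InDiamond 10) (hG : C.G1Closed) (hS : C.StaticH1) : repXP1 ∉ C.upper :=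
  unitFloorSubTop_P_absent hU hS.1.1 hS.1.2 hS.2.1 hS.2.2 hG.1 hG.2.1 hG.2.2.2 (m := 3) (by norm_num) (c := 2) (by norm_num) (ρ := 2)
    (ψ := 2) (w := 2) (χ := 2) (by decide) (by simp [repXP1, ray]) (by simp [repXP1, ray]) (by simp [repXP1, subCeilLetter, ray])
    (by simp [repXP1, ray])
def repWN1g : MCell := ![(2, -2, 0), (4, -2, 0), (7, -1, 0), (9, -1, 0)]
theorem repWN1g_absent {C : MConfig} (hU : C.InDiamond 10) (hG : C.G1Closed) (hS : C.StaticH1) : repWN1g ∉ C.lower :=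
  floorNodeTwoSubTop_N_absent hU hS.1.1 hS.1.2 hS.2.1 hS.2.2 hG.1 hG.2.1 hG.2.2.2 (m := 3) (by norm_num) (c := 2) (n := 2) (by norm_num)
    (by norm_num) (by norm_num) (ψ := 2) (v := 2) (w := 2) (χ := 2) (by decide) (by simp [repWN1g, ray]) (by simp [repWN1g, ray])
    (by simp [repWN1g, subCeilLetter, ray]) (by simp [repWN1g, ray])

/-! ## §3 The apex `4I` as second letter (package UN5 UP8 VN8 UP9 WN3a WP4), the apex `6I` over the unit pair (UN6), and the node-4 line with
the sub-top letter at level `N` (WN3)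

The apex `4I` at slot 1 of an `N`-cell with a floor unit is served below in SOME direction `r` (`servedBelow_floor_apex`) by `2I + ℓ_{r+2}` or
`2ℓ_{r+2}` (`apexFour_downRay`); in a `P`-cell with a ceiling unit it is served above in some direction `r` by the node-4 letter `4I + e·ℓ_r`
(`servedAbove_ceiling_apex`).  So over each of the three typed completions `{cu_χ, cu_χ'}` (`χ' ≠ χ`), `{(h−2)I, cu_χ}`, `{s_m(w), cu_χ}` (`χ ≠ w+2`)
of `{ℓ_φ, 4I}` both levels are ABSENT, the children being A1 A2 UN2 ∕ UP1 UP2 UN5 ∕ WP1a XP1 VN8 UN5.  The apex `6I` (`6 < h`) descends to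
`4I + ℓ`, `2I + 2ℓ`, `3ℓ` (`apexSix_downRay`) = WP2 A1 A2.  WN3 is the `N`-level partner of WP1c: the floor pin moves `4I + nℓ_u` down its node line
(`nodeFourLine_downRay`) onto `2I + (n+1)ℓ_u` (WP1a) or `(n+2)ℓ_u` (XP1, §2 — hence `A2I⁻`, `S₄` on E₋, `Δ` on E₊). -/

theorem adapted_apexFour (k : Fin 4) : Adapted (((4 : ℤ), (0 : ℤ), (0 : ℤ)) : BPoint) k := by fin_cases k <;> simp [Adapted]
theorem coord_apexFour (k : Fin 4) : coord (((4 : ℤ), (0 : ℤ), (0 : ℤ)) : BPoint) k = 4 := coord_of_isApex ⟨rfl, rfl⟩ k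
theorem adapted_apexSix (k : Fin 4) : Adapted (((6 : ℤ), (0 : ℤ), (0 : ℤ)) : BPoint) k := by fin_cases k <;> simp [Adapted]
theorem coord_apexSix (k : Fin 4) : coord (((6 : ℤ), (0 : ℤ), (0 : ℤ)) : BPoint) k = 6 := coord_of_isApex ⟨rfl, rfl⟩ k

/-- below the apex `4I` along a ray of direction `r`: `2I + ℓ_{r+2}` (one step) or `2ℓ_{r+2}` (two steps). -/
theorem apexFour_downRay {h d : ℤ} {z : BPoint} {r : Fin 4} (hz : InDiamond h z) (hd : 0 < d)
    (heq : ((4 : ℤ), (0 : ℤ), (0 : ℤ)) = ray z r d) : z = nodeTwoLetter (r + 2) 1 ∨ z = floorLetter (r + 2) 2 := by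
  obtain ⟨α, a, b⟩ := z
  obtain ⟨hax, h1, -, -⟩ := hz
  simp only [nodeTwoLetter, floorLetter, AxisPt, absCharge, chargeOf, ray, Prod.mk.injEq] at hax h1 heq ⊢
  fin_cases r <;> simp at hax h1 heq ⊢ <;>
    (simp only [abs_eq_max_neg, max_def] at h1; split_ifs at h1 <;> omega)

/-- below the apex `6I` along a ray of direction `r`: `4I + ℓ_{r+2}`, `2I + 2ℓ_{r+2}` or `3ℓ_{r+2}`. -/
theorem apexSix_downRay {h d : ℤ} {z : BPoint} {r : Fin 4} (hz : InDiamond h z) (hd : 0 < d)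
    (heq : ((6 : ℤ), (0 : ℤ), (0 : ℤ)) = ray z r d) :
    z = ray ((4, 0, 0) : BPoint) (r + 2) 1 ∨ z = nodeTwoLetter (r + 2) 2 ∨ z = floorLetter (r + 2) 3 := by
  obtain ⟨α, a, b⟩ := z
  obtain ⟨hax, h1, -, -⟩ := hz
  simp only [nodeTwoLetter, floorLetter, AxisPt, absCharge, chargeOf, ray, Prod.mk.injEq] at hax h1 heq ⊢
  fin_cases r <;> simp at hax h1 heq ⊢ <;>
    (simp only [abs_eq_max_neg, max_def] at h1; split_ifs at h1 <;> omega)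

/-- **UN5.** `N{ℓ_φ, 4I, cu_χ, cu_χ'} ∉ C.lower` (`χ' ≠ χ`) [◇_h, RULE D, X⁺, `S₄` on E₊; every `h`]: the floor pin serves the apex `4I` below in some
direction — the child is the pair fork A1 (`2I + ℓ`) or A2 (`2ℓ`).  Census: ◇₈ 6 ∕ ◇₁₀ 6 orbits (round 2 `B:DN`), all untyped before. -/
theorem unitApexFour_pair_N_absent {h : ℤ} {C : MConfig} (hU : C.InDiamond h) (hDN : ∀ Z ∈ C.lower, RuleDMu4N C Z)
    (hDP : ∀ P ∈ C.upper, RuleDMu4P C P) (hX : XPlusClosed C) (hGu : PermClosed C.upper) {N : MCell} {φ χ χ' : Fin 4}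
    (hχ : χ' ≠ χ) (h0 : N 0 = floorUnit φ) (h1 : N 1 = (4, 0, 0)) (h2 : N 2 = ceilingUnit h χ) (h3 : N 3 = ceilingUnit h χ') :
    N ∉ C.lower := fun hN => by
  have hfl : OnFloor (N 0) := onFloor_of_coord_zero (hU.1 N hN 0) (k := φ + 2) (by rw [h0]; exact (floorLetter_node φ 1).2)
  obtain ⟨r, P, hP, hZP⟩ := servedBelow_floor_apex hU hN (hDN N hN) (i := 0) (g := 1) (by decide) hfl (k := 0)
    (by rw [h1]; exact adapted_apexFour 0) (by rw [h1, coord_apexFour]; norm_num)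
  have hP0 : P 0 = floorUnit φ := (hZP.1 0 (by decide)).trans h0
  have hP2 : P 2 = ceilingUnit h χ := (hZP.1 2 (by decide)).trans h2
  have hP3 : P 3 = ceilingUnit h χ' := (hZP.1 3 (by decide)).trans h3
  rcases apexFour_downRay (hU.2 P hP 1) (by have := hZP.2.1; omega) (h1.symm.trans hZP.2.2) with hP1 | hP1
  · exact pairFork_nodeTwo_absent hU hDN hDP hX hGu (by norm_num : (0 : ℤ) ≤ 1) le_rfl hχ hP0 hP1 hP2 hP3 hP
  · exact pairFork_floorUnit_absent hU hDN hDP hX hGu (by norm_num : (0 : ℤ) ≤ 2) hχ hP0 hP1 hP2 hP3 hP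

/-- **UP8.** `P{ℓ_φ, 4I, cu_χ, cu_χ'} ∉ C.upper` (`χ' ≠ χ`, `h ≠ 4`) [same; every `h`]: the ceiling pin serves the apex `4I` above in some direction `r`
— the parent carries the node-4 letter `4I + e·ℓ_r` = UN2.  Census: ◇₈ 6 ∕ ◇₁₀ 6 orbits (round 2 `B:DP`), all untyped before. -/
theorem unitApexFour_pair_P_absent {h : ℤ} {C : MConfig} (hU : C.InDiamond h) (hDN : ∀ Z ∈ C.lower, RuleDMu4N C Z)
    (hDP : ∀ P ∈ C.upper, RuleDMu4P C P) (hX : XPlusClosed C) (hGu : PermClosed C.upper) (hh : h ≠ 4) {P : MCell}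
    {φ χ χ' : Fin 4} (hχ : χ' ≠ χ) (h0 : P 0 = floorUnit φ) (h1 : P 1 = (4, 0, 0)) (h2 : P 2 = ceilingUnit h χ)
    (h3 : P 3 = ceilingUnit h χ') : P ∉ C.upper := fun hP => by
  obtain ⟨r, N, hN, hNP⟩ := servedAbove_ceiling_apex hU hP (hDP P hP) (g := 2) (j := 1) (by decide)
    (by rw [h2]; exact onCeiling_ceilingUnit h χ) (k := 0) (by rw [h1]; exact adapted_apexFour 0) (by rw [h1, coord_apexFour]; exact hh.symm)
  have e : N 1 = ray ((4, 0, 0) : BPoint) r ((N 1).1 - (P 1).1) := by rw [← h1]; exact hNP.2.2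
  exact unitPairNodeFour_N_absent hU hDN hDP hX hGu (by have := hNP.2.1; omega) hχ ((hNP.1 0 (by decide)).symm.trans h0) e
    ((hNP.1 2 (by decide)).symm.trans h2) ((hNP.1 3 (by decide)).symm.trans h3) hN

/-- **VN8.** `N{ℓ_φ, 4I, (h−2)·I, cu_χ} ∉ C.lower` [same; every `h`]: the floor pin serves `4I` below — the child is UP1 (`2I + ℓ`) or UP2 (`2ℓ`).  Census:
◇₈ 4 ∕ ◇₁₀ 4 orbits (round 2 `B:DN`), all untyped before. -/
theorem unitApexFourSubApex_N_absent {h : ℤ} {C : MConfig} (hU : C.InDiamond h) (hDN : ∀ Z ∈ C.lower, RuleDMu4N C Z)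
    (hDP : ∀ P ∈ C.upper, RuleDMu4P C P) (hX : XPlusClosed C) (hGu : PermClosed C.upper) {N : MCell} {φ χ : Fin 4}
    (h0 : N 0 = floorUnit φ) (h1 : N 1 = (4, 0, 0)) (h2 : N 2 = (h - 2, 0, 0)) (h3 : N 3 = ceilingUnit h χ) :
    N ∉ C.lower := fun hN => by
  have hfl : OnFloor (N 0) := onFloor_of_coord_zero (hU.1 N hN 0) (k := φ + 2) (by rw [h0]; exact (floorLetter_node φ 1).2)
  obtain ⟨r, P, hP, hZP⟩ := servedBelow_floor_apex hU hN (hDN N hN) (i := 0) (g := 1) (by decide) hfl (k := 0)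
    (by rw [h1]; exact adapted_apexFour 0) (by rw [h1, coord_apexFour]; norm_num)
  have hP0 : P 0 = floorUnit φ := (hZP.1 0 (by decide)).trans h0
  have hP2 : P 2 = (h - 2, 0, 0) := (hZP.1 2 (by decide)).trans h2
  have hP3 : P 3 = ceilingUnit h χ := (hZP.1 3 (by decide)).trans h3
  rcases apexFour_downRay (hU.2 P hP 1) (by have := hZP.2.1; omega) (h1.symm.trans hZP.2.2) with hP1 | hP1
  · exact unitNodeTwoSubApex_P_absent hU hDN hDP hX hGu le_rfl hP0 hP1 hP2 hP3 hP
  · exact unitFloorSubApex_P_absent hU hDN hDP hX hGu (by norm_num : (1 : ℤ) ≤ 2) hP0 hP1 hP2 hP3 hP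

/-- **UP9.** `P{ℓ_φ, 4I, (h−2)·I, cu_χ} ∉ C.upper` [same; every `h`]: the sub-apex up-server in the frame `χ+2` (pin `cu_χ`) gives
`N{ℓ_φ, 4I, cu_r, cu_χ}` with `r ≠ χ` = UN5.  Census: ◇₈ 4 ∕ ◇₁₀ 4 orbits (round 2 `B:DP`), all untyped before. -/
theorem unitApexFourSubApex_P_absent {h : ℤ} {C : MConfig} (hU : C.InDiamond h) (hDN : ∀ Z ∈ C.lower, RuleDMu4N C Z)
    (hDP : ∀ P ∈ C.upper, RuleDMu4P C P) (hX : XPlusClosed C) (hGu : PermClosed C.upper) {P : MCell} {φ χ : Fin 4}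
    (h0 : P 0 = floorUnit φ) (h1 : P 1 = (4, 0, 0)) (h2 : P 2 = (h - 2, 0, 0)) (h3 : P 3 = ceilingUnit h χ) :
    P ∉ C.upper := fun hP => by
  obtain ⟨N, hN, r, hr, hNP, hN2⟩ := subApex_upServer' hU hP (hDP P hP) (g := 3) (j := 2) (by decide)
    (by rw [h3]; exact onCeiling_ceilingUnit h χ) h2 (χ + 2)
  have hrχ : χ ≠ r := by rintro rfl; exact hr (fin4_add_two_add_two χ).symm
  exact unitApexFour_pair_N_absent hU hDN hDP hX hGu hrχ ((hNP 0 (by decide)).trans h0) ((hNP 1 (by decide)).trans h1) hN2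
    ((hNP 3 (by decide)).trans h3) hN

/-- **UN6.** `N{ℓ_φ, 6I, cu_χ, cu_χ'} ∉ C.lower` (`χ' ≠ χ`, `6 < h`) [same]: the floor pin serves the apex `6I` below in some direction — the child is
WP2 (`4I + ℓ`, strictly below the ceiling since `6 < h`), A1 (`2I + 2ℓ`) or A2 (`3ℓ`).  Census: ◇₁₀ 6 orbits (round 2 `B:DN`), and at ◇₈ (where
`6I = (h−2)I`) the 6 orbits `N{ℓ, (h−2)I, cu, cu'}` (round 2 `B:DN`); all untyped before. -/
theorem unitApexSix_pair_N_absent {h : ℤ} {C : MConfig} (hU : C.InDiamond h) (hDN : ∀ Z ∈ C.lower, RuleDMu4N C Z)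
    (hDP : ∀ P ∈ C.upper, RuleDMu4P C P) (hX : XPlusClosed C) (hGu : PermClosed C.upper) (hh : 6 < h) {N : MCell}
    {φ χ χ' : Fin 4} (hχ : χ' ≠ χ) (h0 : N 0 = floorUnit φ) (h1 : N 1 = (6, 0, 0)) (h2 : N 2 = ceilingUnit h χ)
    (h3 : N 3 = ceilingUnit h χ') : N ∉ C.lower := fun hN => by
  have hfl : OnFloor (N 0) := onFloor_of_coord_zero (hU.1 N hN 0) (k := φ + 2) (by rw [h0]; exact (floorLetter_node φ 1).2)
  obtain ⟨r, P, hP, hZP⟩ := servedBelow_floor_apex hU hN (hDN N hN) (i := 0) (g := 1) (by decide) hfl (k := 0)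
    (by rw [h1]; exact adapted_apexSix 0) (by rw [h1, coord_apexSix]; norm_num)
  have hP0 : P 0 = floorUnit φ := (hZP.1 0 (by decide)).trans h0
  have hP2 : P 2 = ceilingUnit h χ := (hZP.1 2 (by decide)).trans h2
  have hP3 : P 3 = ceilingUnit h χ' := (hZP.1 3 (by decide)).trans h3
  rcases apexSix_downRay (hU.2 P hP 1) (by have := hZP.2.1; omega) (h1.symm.trans hZP.2.2) with hP1 | hP1 | hP1
  · exact unitPairNodeFour_P_absent hU hDN hDP hX hGu le_rfl (by omega) hχ hP0 hP1 hP2 hP3 hP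
  · exact pairFork_nodeTwo_absent hU hDN hDP hX hGu (by norm_num : (0 : ℤ) ≤ 1) (by norm_num : (1 : ℤ) ≤ 2) hχ hP0 hP1 hP2 hP3 hP
  · exact pairFork_floorUnit_absent hU hDN hDP hX hGu (by norm_num : (0 : ℤ) ≤ 3) hχ hP0 hP1 hP2 hP3 hP

/-- **WN3a.** `N{ℓ_φ, 4I, s_m(w), cu_χ} ∉ C.lower` (`χ ≠ w + 2`, `h = 2m+4`) [◇_h, RULE D, X⁺, A2I⁻, `S₄` on both levels, `Δ` on E₊]: the floor pin
serves `4I` below — the child is WP1a (`2I + ℓ`) or XP1 (`2ℓ`, §2).  Census: ◇₈ 12 ∕ ◇₁₀ 12 orbits (round 2 `B:DN`), all untyped before. -/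
theorem unitApexFourSubTop_N_absent {h m : ℤ} {C : MConfig} (hU : C.InDiamond h) (hDN : ∀ Z ∈ C.lower, RuleDMu4N C Z)
    (hDP : ∀ P ∈ C.upper, RuleDMu4P C P) (hX : XPlusClosed C) (hA : A2IMinusClosed C) (hGl : PermClosed C.lower)
    (hGu : PermClosed C.upper) (hΔu : DeltaClosed C.upper) (hh : h = 2 * m + 4) {N : MCell} {φ w χ : Fin 4} (hχ : χ ≠ w + 2)
    (h0 : N 0 = floorUnit φ) (h1 : N 1 = (4, 0, 0)) (h2 : N 2 = subCeilLetter m w m) (h3 : N 3 = ceilingUnit h χ) :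
    N ∉ C.lower := fun hN => by
  have hfl : OnFloor (N 0) := onFloor_of_coord_zero (hU.1 N hN 0) (k := φ + 2) (by rw [h0]; exact (floorLetter_node φ 1).2)
  obtain ⟨r, P, hP, hZP⟩ := servedBelow_floor_apex hU hN (hDN N hN) (i := 0) (g := 1) (by decide) hfl (k := 0)
    (by rw [h1]; exact adapted_apexFour 0) (by rw [h1, coord_apexFour]; norm_num)
  have hP0 : P 0 = floorUnit φ := (hZP.1 0 (by decide)).trans h0
  have hP2 : P 2 = subCeilLetter m w m := (hZP.1 2 (by decide)).trans h2
  have hP3 : P 3 = ceilingUnit h χ := (hZP.1 3 (by decide)).trans h3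
  rcases apexFour_downRay (hU.2 P hP 1) (by have := hZP.2.1; omega) (h1.symm.trans hZP.2.2) with hP1 | hP1
  · exact unitNodeTwoSubTop_P_absent hU hDN hDP hX hGu hh le_rfl hχ hP0 hP1 hP2 hP3 hP
  · exact unitFloorSubTop_P_absent hU hDN hDP hX hA hGl hGu hΔu hh (by norm_num : (1 : ℤ) ≤ 2) hχ hP0 hP1 hP2 hP3 hP

/-- **WP4.** `P{ℓ_φ, 4I, s_m(w), cu_χ} ∉ C.upper` (`χ ≠ w + 2`, `h = 2m+4`) [◇_h, RULE D, X⁺, `S₄` on E₊]: the sub-top node up-server (pin `cu_χ`) gives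
VN8 (`(h−2)I`) or UN5 (`cu_{w+2}`).  Census: ◇₈ 12 ∕ ◇₁₀ 12 orbits (round 2 `B:DP`), all untyped before. -/
theorem unitApexFourSubTop_P_absent {h m : ℤ} {C : MConfig} (hU : C.InDiamond h) (hDN : ∀ Z ∈ C.lower, RuleDMu4N C Z)
    (hDP : ∀ P ∈ C.upper, RuleDMu4P C P) (hX : XPlusClosed C) (hGu : PermClosed C.upper) (hh : h = 2 * m + 4) {P : MCell}
    {φ w χ : Fin 4} (hχ : χ ≠ w + 2) (h0 : P 0 = floorUnit φ) (h1 : P 1 = (4, 0, 0)) (h2 : P 2 = subCeilLetter m w m)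
    (h3 : P 3 = ceilingUnit h χ) : P ∉ C.upper := fun hP => by
  obtain ⟨N, hN, hNP, hN2 | hN2⟩ := subTopNode_upServer hU hh hP (hDP P hP) (g := 3) (j := 2) (by decide)
    (by rw [h3]; exact onCeiling_ceilingUnit h χ) h2
  · exact unitApexFourSubApex_N_absent hU hDN hDP hX hGu ((hNP 0 (by decide)).trans h0) ((hNP 1 (by decide)).trans h1) hN2
      ((hNP 3 (by decide)).trans h3) hN
  · exact unitApexFour_pair_N_absent hU hDN hDP hX hGu hχ ((hNP 0 (by decide)).trans h0) ((hNP 1 (by decide)).trans h1) hN2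
      ((hNP 3 (by decide)).trans h3) hN

/-- **WN3.** `N{ℓ_φ, 4I + n·ℓ_u, s_m(w), cu_χ} ∉ C.lower` (`n ≥ 1`, `χ ≠ w + 2`, `h = 2m+4`) [◇_h, RULE D, X⁺, A2I⁻, `S₄` on both levels, `Δ` on E₊]
— the `N`-level partner of WP1c: the floor pin moves the node-4 letter down its node line (`nodeFourLine_downRay`) onto `2I + (n+1)ℓ_u` (WP1a) or
`(n+2)ℓ_u` (XP1).  Census: ◇₈ 84 ∕ ◇₁₀ 144 orbits (round 2 `B:DN`), all untyped before — the residue classes `N{ℓ, t_2 ∕ s_2 ∕ y_2, s_m, cu}` with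
`χ ≠ w+2` (◇₈: `N{ℓ, s_m(u), s_m(w), cu}` and `N{ℓ, y_2, s_m, cu}`). -/
theorem unitNodeFourSubTop_N_absent {h m n : ℤ} {C : MConfig} (hU : C.InDiamond h) (hDN : ∀ Z ∈ C.lower, RuleDMu4N C Z)
    (hDP : ∀ P ∈ C.upper, RuleDMu4P C P) (hX : XPlusClosed C) (hA : A2IMinusClosed C) (hGl : PermClosed C.lower)
    (hGu : PermClosed C.upper) (hΔu : DeltaClosed C.upper) (hh : h = 2 * m + 4) (hn : 1 ≤ n) {N : MCell} {φ u w χ : Fin 4}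
    (hχ : χ ≠ w + 2) (h0 : N 0 = floorUnit φ) (h1 : N 1 = ray ((4, 0, 0) : BPoint) u n) (h2 : N 2 = subCeilLetter m w m)
    (h3 : N 3 = ceilingUnit h χ) : N ∉ C.lower := fun hN => by
  have hfl : OnFloor (N 0) := onFloor_of_coord_zero (hU.1 N hN 0) (k := φ + 2) (by rw [h0]; exact (floorLetter_node φ 1).2)
  have hna : ¬ isApex (N 1) := by rw [h1]; exact nodeFourLine_not_isApex u (by omega)
  have hk : Adapted (N 1) (u + 2) := by rw [h1]; exact (adapted_ray_apex 4 u n).2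
  have hk0 : coord (N 1) (u + 2) ≠ 0 := by rw [h1, coord_ray_apex_antip]; norm_num
  obtain ⟨P, hP, hZP⟩ := servedBelow_of_floorLetter hU hN (hDN N hN) (i := 0) (g := 1) (by decide) hfl hna hk hk0
  have hP0 : P 0 = floorUnit φ := (hZP.1 0 (by decide)).trans h0
  have hP2 : P 2 = subCeilLetter m w m := (hZP.1 2 (by decide)).trans h2
  have hP3 : P 3 = ceilingUnit h χ := (hZP.1 3 (by decide)).trans h3
  rcases nodeFourLine_downRay (by omega) (hU.2 P hP 1) (by have := hZP.2.1; omega) (h1.symm.trans hZP.2.2) with hP1 | hP1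
  · exact unitNodeTwoSubTop_P_absent hU hDN hDP hX hGu hh (by omega : 1 ≤ n + 1) hχ hP0 hP1 hP2 hP3 hP
  · exact unitFloorSubTop_P_absent hU hDN hDP hX hA hGl hGu hΔu hh (by omega : 1 ≤ n + 2) hχ hP0 hP1 hP2 hP3 hP

/-! ### ◇₁₀ census representatives of the §3 families (`h = 10`, `m = 3`; orbits of the j318002 peel tables, all peel round 2) -/

def repUN5 : MCell := ![(1, -1, 0), (4, 0, 0), (9, -1, 0), (9, 0, -1)]
def repUP8 : MCell := ![(1, -1, 0), (4, 0, 0), (9, -1, 0), (9, 0, -1)]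
def repVN8 : MCell := ![(1, -1, 0), (4, 0, 0), (8, 0, 0), (9, -1, 0)]
def repUP9 : MCell := ![(1, -1, 0), (4, 0, 0), (8, 0, 0), (9, -1, 0)]
def repUN6 : MCell := ![(1, -1, 0), (6, 0, 0), (9, -1, 0), (9, 0, -1)]
def repWN3a : MCell := ![(1, -1, 0), (4, 0, 0), (7, -1, 0), (9, -1, 0)]
def repWP4 : MCell := ![(1, -1, 0), (4, 0, 0), (7, -1, 0), (9, -1, 0)]
def repWN3 : MCell := ![(1, -1, 0), (5, -1, 0), (7, -1, 0), (9, -1, 0)]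

/-- `N[ℓ₋₁ | 4I | 8I+ℓ₋₁ | 8I+ℓ₋ᵢ] ∉ E₋` (◇₁₀ orbit of `N[l-1|4I|8I+l-1|8I+li]`, round 2). -/
theorem repUN5_absent {C : MConfig} (hU : C.InDiamond 10) (hG : C.G1Closed) (hS : C.StaticH1) : repUN5 ∉ C.lower :=
  unitApexFour_pair_N_absent hU hS.1.1 hS.1.2 hS.2.1 hG.2.1 (φ := 2) (χ := 2) (χ' := 1) (by decide)
    (by simp [repUN5, ray]) (by simp [repUN5]) (by simp [repUN5, ray]) (by simp [repUN5, ray])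
/-- `P[ℓ₋₁ | 4I | 8I+ℓ₋₁ | 8I+ℓ₋ᵢ] ∉ E₊`. -/
theorem repUP8_absent {C : MConfig} (hU : C.InDiamond 10) (hG : C.G1Closed) (hS : C.StaticH1) : repUP8 ∉ C.upper :=
  unitApexFour_pair_P_absent hU hS.1.1 hS.1.2 hS.2.1 hG.2.1 (by norm_num) (φ := 2) (χ := 2) (χ' := 1) (by decide)
    (by simp [repUP8, ray]) (by simp [repUP8]) (by simp [repUP8, ray]) (by simp [repUP8, ray])
/-- `N[ℓ₋₁ | 4I | 8I | 8I+ℓ₋₁] ∉ E₋`. -/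
theorem repVN8_absent {C : MConfig} (hU : C.InDiamond 10) (hG : C.G1Closed) (hS : C.StaticH1) : repVN8 ∉ C.lower :=
  unitApexFourSubApex_N_absent hU hS.1.1 hS.1.2 hS.2.1 hG.2.1 (φ := 2) (χ := 2)
    (by simp [repVN8, ray]) (by simp [repVN8]) (by simp [repVN8]) (by simp [repVN8, ray])
/-- `P[ℓ₋₁ | 4I | 8I | 8I+ℓ₋₁] ∉ E₊`. -/
theorem repUP9_absent {C : MConfig} (hU : C.InDiamond 10) (hG : C.G1Closed) (hS : C.StaticH1) : repUP9 ∉ C.upper :=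
  unitApexFourSubApex_P_absent hU hS.1.1 hS.1.2 hS.2.1 hG.2.1 (φ := 2) (χ := 2)
    (by simp [repUP9, ray]) (by simp [repUP9]) (by simp [repUP9]) (by simp [repUP9, ray])
/-- `N[ℓ₋₁ | 6I | 8I+ℓ₋₁ | 8I+ℓ₋ᵢ] ∉ E₋`. -/
theorem repUN6_absent {C : MConfig} (hU : C.InDiamond 10) (hG : C.G1Closed) (hS : C.StaticH1) : repUN6 ∉ C.lower :=
  unitApexSix_pair_N_absent hU hS.1.1 hS.1.2 hS.2.1 hG.2.1 (by norm_num) (φ := 2) (χ := 2) (χ' := 1) (by decide)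
    (by simp [repUN6, ray]) (by simp [repUN6]) (by simp [repUN6, ray]) (by simp [repUN6, ray])
/-- `N[ℓ₋₁ | 4I | 6I+ℓ₋₁ | 8I+ℓ₋₁] ∉ E₋` (`s_3(2) = (7,−1,0)`). -/
theorem repWN3a_absent {C : MConfig} (hU : C.InDiamond 10) (hG : C.G1Closed) (hS : C.StaticH1) : repWN3a ∉ C.lower :=
  unitApexFourSubTop_N_absent hU hS.1.1 hS.1.2 hS.2.1 hS.2.2 hG.1 hG.2.1 hG.2.2.2 (m := 3) (by norm_num) (φ := 2) (w := 2) (χ := 2)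
    (by decide) (by simp [repWN3a, ray]) (by simp [repWN3a]) (by simp [repWN3a, subCeilLetter, ray])
    (by simp [repWN3a, ray])
/-- `P[ℓ₋₁ | 4I | 6I+ℓ₋₁ | 8I+ℓ₋₁] ∉ E₊`. -/
theorem repWP4_absent {C : MConfig} (hU : C.InDiamond 10) (hG : C.G1Closed) (hS : C.StaticH1) : repWP4 ∉ C.upper :=
  unitApexFourSubTop_P_absent hU hS.1.1 hS.1.2 hS.2.1 hG.2.1 (m := 3) (by norm_num) (φ := 2) (w := 2) (χ := 2) (by decide)
    (by simp [repWP4, ray]) (by simp [repWP4]) (by simp [repWP4, subCeilLetter, ray]) (by simp [repWP4, ray])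
/-- `N[ℓ₋₁ | 4I+ℓ₋₁ | 6I+ℓ₋₁ | 8I+ℓ₋₁] ∉ E₋` (`t_2`-type node-4 letter `4I + ℓ₂ = (5,−1,0)`). -/
theorem repWN3_absent {C : MConfig} (hU : C.InDiamond 10) (hG : C.G1Closed) (hS : C.StaticH1) : repWN3 ∉ C.lower :=
  unitNodeFourSubTop_N_absent hU hS.1.1 hS.1.2 hS.2.1 hS.2.2 hG.1 hG.2.1 hG.2.2.2 (m := 3) (n := 1) (by norm_num) le_rfl (φ := 2) (u := 2)
    (w := 2) (χ := 2) (by decide) (by simp [repWN3, ray]) (by simp [repWN3, ray]) (by simp [repWN3, subCeilLetter, ray])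
    (by simp [repWN3, ray])

/-! ## §4 The ceiling-line COLUMN `y_d` (`d ≥ 1`) over the unit pair and over the origin interface, by induction on `d`

`y_d = ceilLetter h v d = (h−2−2d)I + (1+d)ℓ_v` (`y_0 = cu_v`, `y_{−1} = hI`, `y_{m+1}` = the full floor letter).  In a `P`-cell pinned by `cu_χ`
the up-line of `y_d` is `{y_{d−e} : 1 ≤ e ≤ d+1}` (`upLine_ceilLetter`); in an `N`-cell the origin interface (A2I⁻, `a2i_origin_interface`) and the
unit-pair descent turn `N{O, ℓ, y_d, cu}` ∕ `N{ℓ, ℓ', y_d, cu}` into `P{O, ℓ, y_d, cu}`.  Hence ONE induction on `d` (the control quantity is the node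
level `h−2−2d`, which the up-line strictly raises) proves, for EVERY `d ≥ 1` and every `h`:
OP_d `P{O, ℓ_φ, y_d, cu_χ} ∉ E₊` (base: B4 at `y_0 = cu_v`, the lone-unit apex family at `y_{−1} = hI`), ON_d `N{O, ℓ_φ, y_d, cu_χ} ∉ E₋`,
TN_d `N{ℓ_φ, ℓ_ψ, y_d, cu_χ} ∉ E₋`, TP_d `P{ℓ_φ, ℓ_ψ, y_d, cu_χ} ∉ E₊` (`φ ≠ ψ`; base B3 and the g18 ceiling fork), YN_d
`N{ℓ_φ, 2ℓ_u, y_d, cu_χ} ∉ E₋` (`φ ≠ u`; the floor pin lowers the charge of `2ℓ_u`: TP_d ∕ OP_d) — `d = 1` of the first four is TP18 ∕ — ∕ TN17 ∕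
TP19 of `CeilingPair.lean` §14.  These are the first TOWER families of the programme: members of every peel round (2, 3, 4, … up to the full
floor letter `y_{m+1}`), all ABSENT in the census, 0 survivors. -/

/-- the UP-LINE OF A CEILING-LINE LETTER: in a `P`-cell with `y_d(v)` (`d ≥ 1`) in slot 2 and `cu_χ` in slot 3, slot 2 is served above along the
node ray of `y_d` by some `y_{d−e}`, `1 ≤ e ≤ d+1`. -/
theorem upLine_ceilLetter {h d : ℤ} {C : MConfig} (hU : C.InDiamond h) {P : MCell} (hP : P ∈ C.upper) (hD : RuleDMu4P C P)
    {v χ : Fin 4} (hd : 1 ≤ d) (h2 : P 2 = ceilLetter h v d) (h3 : P 3 = ceilingUnit h χ) :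
    ∃ N ∈ C.lower, (∀ i, i ≠ 2 → N i = P i) ∧ ∃ e, 1 ≤ e ∧ e ≤ d + 1 ∧ N 2 = ceilLetter h v (d - e) := by
  have hna : ¬ isApex (P 2) := by rw [h2]; exact ceilLetter_not_isApex v (by omega)
  have hk : Adapted (P 2) (v + 2) := by rw [h2]; exact (ceilLetter_node h v d).1
  have hkh : coord (P 2) (v + 2) ≠ h := by rw [h2, (ceilLetter_node h v d).2]; omega
  obtain ⟨N, hN, hNP⟩ := upLine_of_ruleDMu4P hU hP hD (g := 3) (j := 2) (by decide) (by rw [h3]; exact onCeiling_ceilingUnit h χ) hna hk hkh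
  have he0 : 0 < (N 2).1 - (P 2).1 := by have := hNP.2.1; omega
  have e : N 2 = ray (ceilLetter h v d) (v + 2) ((N 2).1 - (P 2).1) := by rw [← h2]; exact hNP.2.2
  obtain ⟨-, hle, hN2⟩ := above_ceilLetter_offRay (by omega) (hU.1 N hN 2) he0 e
  exact ⟨N, hN, fun g hg => (hNP.1 g hg).symm, (N 2).1 - (P 2).1, by omega, hle, hN2⟩

/-- the induction behind OP_d: `P{O, ℓ_φ, y_d, cu_χ} ∉ C.upper` for `1 ≤ d ≤ n`, by induction on `n`. -/
theorem originUnitCeilLine_aux {h : ℤ} {C : MConfig} (hU : C.InDiamond h) (hDN : ∀ Z ∈ C.lower, RuleDMu4N C Z)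
    (hDP : ∀ P ∈ C.upper, RuleDMu4P C P) (hX : XPlusClosed C) (hA : A2IMinusClosed C) (hGl : PermClosed C.lower)
    (hGu : PermClosed C.upper) (hΔu : DeltaClosed C.upper) :
    ∀ n : ℕ, ∀ {P : MCell} {d : ℤ} {φ v χ : Fin 4}, 1 ≤ d → d ≤ n → P 0 = (0, 0, 0) → P 1 = floorUnit φ →
      P 2 = ceilLetter h v d → P 3 = ceilingUnit h χ → P ∉ C.upper := by
  intro n
  induction n with
  | zero => intro P d φ v χ hd hdn _ _ _ _ _; omega
  | succ n ih =>
    intro P d φ v χ hd hdn h0 h1 h2 h3 hP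
    obtain ⟨N, hN, hNP, e, he1, he2, hN2⟩ := upLine_ceilLetter hU hP (hDP P hP) hd h2 h3
    have hN0 : N 0 = (0, 0, 0) := (hNP 0 (by decide)).trans h0
    have hN1 : N 1 = floorUnit φ := (hNP 1 (by decide)).trans h1
    have hN3 : N 3 = ceilingUnit h χ := (hNP 3 (by decide)).trans h3
    rcases (show 1 ≤ d - e ∨ d - e = 0 ∨ d - e = -1 by omega) with hge | hze | hneg
    · have hN0' : N 0 = floorLetter φ 0 := hN0.trans (ray_zero _ φ).symm
      obtain ⟨q, hq, hqN, hq1⟩ := descent_of_floorNode_floorUnit hU (hDN N hN) (b := 0) (c := 1) (by decide) le_rfl hN0' hN1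
      obtain ⟨P', hP', hP'N, hP'0, hP'1⟩ := a2i_origin_interface hU hA hGl hN (a := 0) (b := 1) (by decide) hN0 hN1 hq hqN hq1
      exact ih (P := P'.perm (Equiv.swap 0 1)) (d := d - e) (φ := φ) (v := v) (χ := χ) hge (by omega)
        (by show P' (Equiv.swap (0 : Fin 4) 1 0) = _; simpa using hP'1)
        (by show P' (Equiv.swap (0 : Fin 4) 1 1) = _; simpa using hP'0)
        (by show P' (Equiv.swap (0 : Fin 4) 1 2) = _; simpa [Equiv.swap_apply_of_ne_of_ne] using (hP'N 2 (by decide) (by decide)).trans hN2)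
        (by show P' (Equiv.swap (0 : Fin 4) 1 3) = _; simpa [Equiv.swap_apply_of_ne_of_ne] using (hP'N 3 (by decide) (by decide)).trans hN3)
        (hGu _ P' hP')
    · rw [hze, ceilLetter_zero] at hN2
      exact loneUnit_pair_N_absent hU hDN hDP hX hA hGl hGu hΔu hN0 hN1 hN2 hN3 hN
    · rw [hneg, ceilLetter_neg_one] at hN2
      exact loneUnit_apex_absent hU hDN hDP hX hΔu (N := N.perm (Equiv.swap 2 3)) (φ := φ) (χ := χ)
        (by show N (Equiv.swap (2 : Fin 4) 3 0) = _; simpa [Equiv.swap_apply_of_ne_of_ne] using hN0)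
        (by show N (Equiv.swap (2 : Fin 4) 3 1) = _; simpa [Equiv.swap_apply_of_ne_of_ne] using hN1)
        (by show N (Equiv.swap (2 : Fin 4) 3 2) = _; simpa using hN3)
        (by show N (Equiv.swap (2 : Fin 4) 3 3) = _; simpa using hN2) (hGl _ N hN)

/-- **OP_d.** `P{O, ℓ_φ, y_d(v), cu_χ} ∉ C.upper` for EVERY `d ≥ 1` [◇_h, RULE D, X⁺, A2I⁻, `S₄` on both levels, `Δ` on E₊; every `h`] (`d = 1` is TP18).
Census: ◇₈ 16 + 16 + 16 ∕ ◇₁₀ 16 + 16 + 16 + 16 orbits (`d = 1, …, m+1`; peel rounds 2, 2, 3(, 3)), 0 survivors; new for `d ≥ 2`. -/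
theorem originUnitCeilLine_P_absent {h d : ℤ} {C : MConfig} (hU : C.InDiamond h) (hDN : ∀ Z ∈ C.lower, RuleDMu4N C Z)
    (hDP : ∀ P ∈ C.upper, RuleDMu4P C P) (hX : XPlusClosed C) (hA : A2IMinusClosed C) (hGl : PermClosed C.lower)
    (hGu : PermClosed C.upper) (hΔu : DeltaClosed C.upper) (hd : 1 ≤ d) {P : MCell} {φ v χ : Fin 4} (h0 : P 0 = (0, 0, 0))
    (h1 : P 1 = floorUnit φ) (h2 : P 2 = ceilLetter h v d) (h3 : P 3 = ceilingUnit h χ) : P ∉ C.upper :=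
  originUnitCeilLine_aux hU hDN hDP hX hA hGl hGu hΔu d.toNat hd (Int.self_le_toNat d) h0 h1 h2 h3

/-- **ON_d.** `N{O, ℓ_φ, y_d(v), cu_χ} ∉ C.lower` for every `d ≥ 1` [same]: the descent `N(1 ↦ O)` and the origin interface give OP_d after (0 1).
Census: ◇₈ 16 ∕ 16 ∕ 16, ◇₁₀ 16 ∕ 16 ∕ 16 ∕ 16 orbits (rounds 2, 2, 3, 3), 0 survivors, all untyped before. -/
theorem originUnitCeilLine_N_absent {h d : ℤ} {C : MConfig} (hU : C.InDiamond h) (hDN : ∀ Z ∈ C.lower, RuleDMu4N C Z)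
    (hDP : ∀ P ∈ C.upper, RuleDMu4P C P) (hX : XPlusClosed C) (hA : A2IMinusClosed C) (hGl : PermClosed C.lower)
    (hGu : PermClosed C.upper) (hΔu : DeltaClosed C.upper) (hd : 1 ≤ d) {N : MCell} {φ v χ : Fin 4} (h0 : N 0 = (0, 0, 0))
    (h1 : N 1 = floorUnit φ) (h2 : N 2 = ceilLetter h v d) (h3 : N 3 = ceilingUnit h χ) : N ∉ C.lower := fun hN => by
  have h0' : N 0 = floorLetter φ 0 := h0.trans (ray_zero _ φ).symm
  obtain ⟨q, hq, hqN, hq1⟩ := descent_of_floorNode_floorUnit hU (hDN N hN) (b := 0) (c := 1) (by decide) le_rfl h0' h1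
  obtain ⟨P, hP, hPN, hP0, hP1⟩ := a2i_origin_interface hU hA hGl hN (a := 0) (b := 1) (by decide) h0 h1 hq hqN hq1
  exact originUnitCeilLine_P_absent hU hDN hDP hX hA hGl hGu hΔu hd (P := P.perm (Equiv.swap 0 1)) (φ := φ) (v := v) (χ := χ)
    (by show P (Equiv.swap (0 : Fin 4) 1 0) = _; simpa using hP1)
    (by show P (Equiv.swap (0 : Fin 4) 1 1) = _; simpa using hP0)
    (by show P (Equiv.swap (0 : Fin 4) 1 2) = _; simpa [Equiv.swap_apply_of_ne_of_ne] using (hPN 2 (by decide) (by decide)).trans h2)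
    (by show P (Equiv.swap (0 : Fin 4) 1 3) = _; simpa [Equiv.swap_apply_of_ne_of_ne] using (hPN 3 (by decide) (by decide)).trans h3)
    (hGu _ P hP)

/-- **TN_d.** `N{ℓ_φ, ℓ_ψ, y_d(v), cu_χ} ∉ C.lower` for every `d ≥ 1` (all `φ, ψ`) [same] (`d = 1` is TN17): the unit-pair descent `N(1 ↦ O)` is OP_d
after (0 1).  Census: ◇₈ 40 ∕ 40 ∕ 40, ◇₁₀ 40 ∕ 40 ∕ 40 ∕ 40 orbits (rounds 2, 2, 3, 3), 0 survivors; new for `d ≥ 2`. -/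
theorem unitPairCeilLine_N_absent {h d : ℤ} {C : MConfig} (hU : C.InDiamond h) (hDN : ∀ Z ∈ C.lower, RuleDMu4N C Z)
    (hDP : ∀ P ∈ C.upper, RuleDMu4P C P) (hX : XPlusClosed C) (hA : A2IMinusClosed C) (hGl : PermClosed C.lower)
    (hGu : PermClosed C.upper) (hΔu : DeltaClosed C.upper) (hd : 1 ≤ d) {N : MCell} {φ ψ v χ : Fin 4} (h0 : N 0 = floorUnit φ)
    (h1 : N 1 = floorUnit ψ) (h2 : N 2 = ceilLetter h v d) (h3 : N 3 = ceilingUnit h χ) : N ∉ C.lower := fun hN => by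
  obtain ⟨P, hP, hPN, hP1⟩ := descent_of_floorUnitPair hU (hDN N hN) (b := 0) (c := 1) (by decide) h0 h1
  exact originUnitCeilLine_P_absent hU hDN hDP hX hA hGl hGu hΔu hd (P := P.perm (Equiv.swap 0 1)) (φ := φ) (v := v) (χ := χ)
    (by show P (Equiv.swap (0 : Fin 4) 1 0) = _; simpa using hP1)
    (by show P (Equiv.swap (0 : Fin 4) 1 1) = _; simpa using (hPN 0 (by decide)).trans h0)
    (by show P (Equiv.swap (0 : Fin 4) 1 2) = _; simpa [Equiv.swap_apply_of_ne_of_ne] using (hPN 2 (by decide)).trans h2)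
    (by show P (Equiv.swap (0 : Fin 4) 1 3) = _; simpa [Equiv.swap_apply_of_ne_of_ne] using (hPN 3 (by decide)).trans h3)
    (hGu _ P hP)

/-- **TP_d.** `P{ℓ_φ, ℓ_ψ, y_d(v), cu_χ} ∉ C.upper` for every `d ≥ 1` and `φ ≠ ψ` [◇_h, RULE D, X⁺, A2I⁻ (for `d ≥ 2`), `S₄` on both levels, `Δ` on E₊]
(`d = 1` is TP19): the up-line of `y_d` meets TN_{d−e}, B3 (`cu_v`) or the g18 ceiling fork (`hI`, after (2 3)).  Census: ◇₈ 24 ∕ 24 ∕ 24, ◇₁₀ 24 ∕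
24 ∕ 24 ∕ 24 orbits (rounds 2, 2, 2, 3), 0 survivors; new for `d ≥ 2`.  The equal-phase orbits `φ = ψ` (kind `P:Xp`, rounds 2–4) are NOT claimed. -/
theorem unitPairCeilLine_P_absent {h d : ℤ} {C : MConfig} (hU : C.InDiamond h) (hDN : ∀ Z ∈ C.lower, RuleDMu4N C Z)
    (hDP : ∀ P ∈ C.upper, RuleDMu4P C P) (hX : XPlusClosed C) (hA : A2IMinusClosed C) (hGl : PermClosed C.lower)
    (hGu : PermClosed C.upper) (hΔu : DeltaClosed C.upper) (hd : 1 ≤ d) {P : MCell} {φ ψ v χ : Fin 4} (hφψ : φ ≠ ψ)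
    (h0 : P 0 = floorUnit φ) (h1 : P 1 = floorUnit ψ) (h2 : P 2 = ceilLetter h v d) (h3 : P 3 = ceilingUnit h χ) :
    P ∉ C.upper := fun hP => by
  obtain ⟨N, hN, hNP, e, he1, he2, hN2⟩ := upLine_ceilLetter hU hP (hDP P hP) hd h2 h3
  have hN0 : N 0 = floorUnit φ := (hNP 0 (by decide)).trans h0
  have hN1 : N 1 = floorUnit ψ := (hNP 1 (by decide)).trans h1
  have hN3 : N 3 = ceilingUnit h χ := (hNP 3 (by decide)).trans h3
  rcases (show 1 ≤ d - e ∨ d - e = 0 ∨ d - e = -1 by omega) with hge | hze | hneg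
  · exact unitPairCeilLine_N_absent hU hDN hDP hX hA hGl hGu hΔu hge hN0 hN1 hN2 hN3 hN
  · rw [hze, ceilLetter_zero] at hN2
    exact unitPair_pair_absent hU hDN hDP hX hΔu hN0 hN1 hN2 hN3 hN
  · rw [hneg, ceilLetter_neg_one] at hN2
    exact ceilingForkFamily_absent hU hDN hDP hX hGu hΔu hφψ (Z := N.perm (Equiv.swap 2 3))
      (by show N (Equiv.swap (2 : Fin 4) 3 0) = _; simpa [Equiv.swap_apply_of_ne_of_ne] using hN0)
      (by show N (Equiv.swap (2 : Fin 4) 3 1) = _; simpa [Equiv.swap_apply_of_ne_of_ne] using hN1)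
      (by show N (Equiv.swap (2 : Fin 4) 3 2) = _; simpa using hN3)
      (by show N (Equiv.swap (2 : Fin 4) 3 3) = _; simpa using hN2) (hGl _ N hN)

/-- **YN_d.** `N{ℓ_φ, 2ℓ_u, y_d(v), cu_χ} ∉ C.lower` for every `d ≥ 1` and `φ ≠ u` [same]: the floor pin `ℓ_φ` lowers the charge of `2ℓ_u`
(`floorLetter_downRay`) — the child is TP_d (`ℓ_u`) or OP_d (`O`, after (0 1)).  Census: ◇₈ 48 ∕ 48 ∕ 48, ◇₁₀ 48 ∕ 48 ∕ 48 ∕ 48 orbits (rounds 2, 2,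
3, 3–4), 0 survivors, all untyped before. -/
theorem unitFloorTwoCeilLine_N_absent {h d : ℤ} {C : MConfig} (hU : C.InDiamond h) (hDN : ∀ Z ∈ C.lower, RuleDMu4N C Z)
    (hDP : ∀ P ∈ C.upper, RuleDMu4P C P) (hX : XPlusClosed C) (hA : A2IMinusClosed C) (hGl : PermClosed C.lower)
    (hGu : PermClosed C.upper) (hΔu : DeltaClosed C.upper) (hd : 1 ≤ d) {N : MCell} {φ u v χ : Fin 4} (hφu : φ ≠ u)
    (h0 : N 0 = floorUnit φ) (h1 : N 1 = floorLetter u 2) (h2 : N 2 = ceilLetter h v d) (h3 : N 3 = ceilingUnit h χ) :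
    N ∉ C.lower := fun hN => by
  have hfl : OnFloor (N 0) := onFloor_of_coord_zero (hU.1 N hN 0) (k := φ + 2) (by rw [h0]; exact (floorLetter_node φ 1).2)
  have hna : ¬ isApex (N 1) := by rw [h1]; exact floorLetter_not_isApex u (by norm_num)
  have hk : Adapted (N 1) u := by rw [h1]; exact (floorLetter_top u 2).1
  have hk0 : coord (N 1) u ≠ 0 := by rw [h1, (floorLetter_top u 2).2]; norm_num
  obtain ⟨P, hP, hZP⟩ := servedBelow_of_floorLetter hU hN (hDN N hN) (i := 0) (g := 1) (by decide) hfl hna hk hk0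
  obtain ⟨hc', hP1⟩ := floorLetter_downRay (hU.2 P hP 1) (h1.symm.trans hZP.2.2)
  have hP0 : P 0 = floorUnit φ := (hZP.1 0 (by decide)).trans h0
  have hP2 : P 2 = ceilLetter h v d := (hZP.1 2 (by decide)).trans h2
  have hP3 : P 3 = ceilingUnit h χ := (hZP.1 3 (by decide)).trans h3
  rcases (show 2 - ((N 1).1 - (P 1).1) = 1 ∨ 2 - ((N 1).1 - (P 1).1) = 0 by have := hZP.2.1; omega) with hone | hze
  · rw [hone] at hP1
    exact unitPairCeilLine_P_absent hU hDN hDP hX hA hGl hGu hΔu hd hφu hP0 hP1 hP2 hP3 hP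
  · rw [hze] at hP1
    have hP1' : P 1 = (0, 0, 0) := hP1.trans (ray_zero _ _)
    exact originUnitCeilLine_P_absent hU hDN hDP hX hA hGl hGu hΔu hd (P := P.perm (Equiv.swap 0 1)) (φ := φ) (v := v) (χ := χ)
      (by show P (Equiv.swap (0 : Fin 4) 1 0) = _; simpa using hP1')
      (by show P (Equiv.swap (0 : Fin 4) 1 1) = _; simpa using hP0)
      (by show P (Equiv.swap (0 : Fin 4) 1 2) = _; simpa [Equiv.swap_apply_of_ne_of_ne] using hP2)
      (by show P (Equiv.swap (0 : Fin 4) 1 3) = _; simpa [Equiv.swap_apply_of_ne_of_ne] using hP3)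
      (hGu _ P hP)

/-! ### ◇₁₀ census representatives of the §4 families at `d = 2` (`y_2(2) = 4I + 3ℓ₂ = (7,−3,0)`; orbits of the j318002 peel tables, round 2) -/

def repOP2 : MCell := ![(0, 0, 0), (1, -1, 0), (7, -3, 0), (9, -1, 0)]
def repON2 : MCell := ![(0, 0, 0), (1, -1, 0), (7, -3, 0), (9, -1, 0)]
def repTN2d : MCell := ![(1, -1, 0), (1, 0, -1), (7, -3, 0), (9, -1, 0)]
def repTP2d : MCell := ![(1, -1, 0), (1, 0, -1), (7, -3, 0), (9, -1, 0)]
def repYN2 : MCell := ![(1, 0, -1), (2, -2, 0), (7, -3, 0), (9, -1, 0)]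

/-- `P[O | ℓ₋₁ | 4I+3ℓ₋₁ | 8I+ℓ₋₁] ∉ E₊`. -/
theorem repOP2_absent {C : MConfig} (hU : C.InDiamond 10) (hG : C.G1Closed) (hS : C.StaticH1) : repOP2 ∉ C.upper :=
  originUnitCeilLine_P_absent hU hS.1.1 hS.1.2 hS.2.1 hS.2.2 hG.1 hG.2.1 hG.2.2.2 (d := 2) (by norm_num) (φ := 2) (v := 2) (χ := 2)
    (by simp [repOP2]) (by simp [repOP2, ray]) (by simp [repOP2, ceilLetter, ray]) (by simp [repOP2, ray])
/-- `N[O | ℓ₋₁ | 4I+3ℓ₋₁ | 8I+ℓ₋₁] ∉ E₋`. -/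
theorem repON2_absent {C : MConfig} (hU : C.InDiamond 10) (hG : C.G1Closed) (hS : C.StaticH1) : repON2 ∉ C.lower :=
  originUnitCeilLine_N_absent hU hS.1.1 hS.1.2 hS.2.1 hS.2.2 hG.1 hG.2.1 hG.2.2.2 (d := 2) (by norm_num) (φ := 2) (v := 2) (χ := 2)
    (by simp [repON2]) (by simp [repON2, ray]) (by simp [repON2, ceilLetter, ray]) (by simp [repON2, ray])
/-- `N[ℓ₋₁ | ℓ₋ᵢ | 4I+3ℓ₋₁ | 8I+ℓ₋₁] ∉ E₋`. -/
theorem repTN2d_absent {C : MConfig} (hU : C.InDiamond 10) (hG : C.G1Closed) (hS : C.StaticH1) : repTN2d ∉ C.lower :=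
  unitPairCeilLine_N_absent hU hS.1.1 hS.1.2 hS.2.1 hS.2.2 hG.1 hG.2.1 hG.2.2.2 (d := 2) (by norm_num) (φ := 2) (ψ := 1) (v := 2) (χ := 2)
    (by simp [repTN2d, ray]) (by simp [repTN2d, ray]) (by simp [repTN2d, ceilLetter, ray]) (by simp [repTN2d, ray])
/-- `P[ℓ₋₁ | ℓ₋ᵢ | 4I+3ℓ₋₁ | 8I+ℓ₋₁] ∉ E₊`. -/
theorem repTP2d_absent {C : MConfig} (hU : C.InDiamond 10) (hG : C.G1Closed) (hS : C.StaticH1) : repTP2d ∉ C.upper :=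
  unitPairCeilLine_P_absent hU hS.1.1 hS.1.2 hS.2.1 hS.2.2 hG.1 hG.2.1 hG.2.2.2 (d := 2) (by norm_num) (φ := 2) (ψ := 1) (v := 2) (χ := 2)
    (by decide) (by simp [repTP2d, ray]) (by simp [repTP2d, ray]) (by simp [repTP2d, ceilLetter, ray]) (by simp [repTP2d, ray])
/-- `N[ℓ₋ᵢ | 2ℓ₋₁ | 4I+3ℓ₋₁ | 8I+ℓ₋₁] ∉ E₋`. -/
theorem repYN2_absent {C : MConfig} (hU : C.InDiamond 10) (hG : C.G1Closed) (hS : C.StaticH1) : repYN2 ∉ C.lower :=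
  unitFloorTwoCeilLine_N_absent hU hS.1.1 hS.1.2 hS.2.1 hS.2.2 hG.1 hG.2.1 hG.2.2.2 (d := 2) (by norm_num) (φ := 1) (u := 2) (v := 2)
    (χ := 2) (by decide) (by simp [repYN2, ray]) (by simp [repYN2, ray]) (by simp [repYN2, ceilLetter, ray]) (by simp [repYN2, ray])

/-! ## §5 (v0.3) The FREE fourth letter over the origin-unit base `{O, ℓ_φ, ·, cu_χ}` and the unit-pair base `{ℓ_φ, ℓ_ψ, ·, cu_χ}`

ONE induction on the HEIGHT `h − X.1` of the fourth letter `X`, no case analysis on its shape.  In `N{O, ℓ_φ, X, cu_χ} ∈ E₋` the floor pin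
`O = 0·ℓ_φ` lowers `ℓ_φ` (`descent_of_floorNode_floorUnit`) and the origin interface (A2I⁻ + `S₄`, `a2i_origin_interface`) returns
`P{ℓ_φ, O, X, cu_χ} ∈ E₊`; there the ceiling pin `cu_χ` SERVES `X` ABOVE along some ray (`servedAbove_ceiling_apex` = RULE D on (pin frame) ×
(a frame of `X` whose coordinate is `≠ h` — one exists iff `X ≠ hI`, `exists_frame_ne_h`): no down branch, no cover branch), and the served
letter `X'` is strictly HIGHER (`X'.1 > X.1`), so `N{ℓ_φ, O, X', cu_χ}` is absent by induction; the apex `X = hI` is `loneUnit_apex_absent`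
(g19).  Hence the fourth letter is FREE:

* **F1** `N{O, ℓ_φ, X, cu_χ} ∉ E₋` for EVERY letter `X` (even `X = O`, a floor letter, an interior letter `aI + c·ℓ`, an apex, `hI`);
* **F2** `P{O, ℓ_φ, X, cu_χ} ∉ E₊` for every `X ≠ hI`;
* **F3** `N{ℓ_φ, ℓ_ψ, X, cu_χ} ∉ E₋` for every `X ≠ hI` and ALL phases (the descent `ℓ_ψ ↦ O` gives F2);
* **F4** `P{ℓ_φ, ℓ_ψ, X, cu_χ} ∉ E₊` for every `X` BELOW the ceiling and all phases (serve `X` above: the served letter is `≠ hI` because an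
  up-move reaching `hI` starts on the ceiling, `onCeiling_below_apex`; then F3);
* **F5** `N{ℓ_φ, 2ℓ_u, X, cu_χ} ∉ E₋` for every `X` below the ceiling and all `φ, u` (the floor pin lowers `2ℓ_u` to `ℓ_u` (F4) or `O` (F2)).

They SUBSUME B2 ∕ B4 ∕ B3 (`X = cu`), TP18 ∕ TN17 ∕ TP20 ∕ TN16-type unit-pair families, OP_d ∕ ON_d ∕ TN_d of §4 (`X = y_d`) and every
`{ℓ, ℓ′, s_k ∕ t_k ∕ r_k ∕ aI ∕ aI + nℓ ∕ cℓ″, cu}` class.  Hypotheses: ◇_h, RULE D (both levels), X⁺, A2I⁻, `S₄` on E₋ (F5: also on E₊), `Δ` on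
E₊; every `h : ℤ`.  Census (`tools/famT.py`, BAD = survivor): members ◇₄ 234 ∕ ◇₆ 678 ∕ ◇₈ 1 322 ∕ ◇₁₀ 2 142 orbits of peel rounds 1 – 5,
0 survivors at every `h`; NEW (untyped by any earlier kernel family) ◇₈ 976 ∕ ◇₁₀ 1 724 (◇₁₀: 252 of round 2, 686 of round 3, 738 of
round 4, 48 of round 5) — the first kernel families with members of peel rounds 4 and 5. -/

/-- below the apex `hI`, some adapted frame coordinate of a ◇_h letter is not `h` (the node frame): RULE D at a `P`-cell can serve it ABOVE. -/
theorem exists_frame_ne_h {h : ℤ} {z : BPoint} (hz : InDiamond h z) (hne : z ≠ (h, 0, 0)) : ∃ k : Fin 4, Adapted z k ∧ coord z k ≠ h := by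
  obtain ⟨k, hk, hkc⟩ := exists_node_dir hz.1
  refine ⟨k, hk, fun e => hne ?_⟩
  have c0 : 0 ≤ absCharge z := abs_nonneg _
  have htop : z.1 + absCharge z ≤ h := hz.2.2.2
  have hz1 : z.1 = h := by rw [hkc] at e; omega
  have hc : absCharge z = 0 := by rw [hkc] at e; omega
  have hax := hz.1
  obtain ⟨α, a, b⟩ := z
  simp only [absCharge, chargeOf, AxisPt, Prod.mk.injEq, abs_eq_zero, sub_eq_zero] at hc hax hz1 ⊢
  refine ⟨hz1, ?_, ?_⟩ <;> omega

/-- the induction step of F1: if every HIGHER completion `N{O, ℓ_φ, X', cu_χ}` (`X'.1 > X.1`) is absent, so is `N{O, ℓ_φ, X, cu_χ}`. -/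
theorem originUnitFree_step {h : ℤ} {C : MConfig} (hU : C.InDiamond h) (hDN : ∀ Z ∈ C.lower, RuleDMu4N C Z)
    (hDP : ∀ P ∈ C.upper, RuleDMu4P C P) (hX : XPlusClosed C) (hA : A2IMinusClosed C) (hGl : PermClosed C.lower)
    (hΔu : DeltaClosed C.upper) {N : MCell} {φ χ : Fin 4}
    (ih : ∀ N' : MCell, (N 2).1 < (N' 2).1 → N' 0 = (0, 0, 0) → N' 1 = floorUnit φ → N' 3 = ceilingUnit h χ → N' ∉ C.lower)
    (h0 : N 0 = (0, 0, 0)) (h1 : N 1 = floorUnit φ) (h3 : N 3 = ceilingUnit h χ) : N ∉ C.lower := fun hN => by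
  by_cases hap : N 2 = (h, 0, 0)
  · exact loneUnit_apex_absent hU hDN hDP hX hΔu (N := N.perm (Equiv.swap 2 3)) (φ := φ) (χ := χ)
      (by show N (Equiv.swap (2 : Fin 4) 3 0) = _; simpa [Equiv.swap_apply_of_ne_of_ne] using h0)
      (by show N (Equiv.swap (2 : Fin 4) 3 1) = _; simpa [Equiv.swap_apply_of_ne_of_ne] using h1)
      (by show N (Equiv.swap (2 : Fin 4) 3 2) = _; simpa using h3)
      (by show N (Equiv.swap (2 : Fin 4) 3 3) = _; simpa using hap) (hGl _ N hN)
  · have h0' : N 0 = floorLetter φ 0 := h0.trans (ray_zero _ φ).symm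
    obtain ⟨q, hq, hqN, hq1⟩ := descent_of_floorNode_floorUnit hU (hDN N hN) (b := 0) (c := 1) (by decide) le_rfl h0' h1
    obtain ⟨P, hP, hPN, hP0, hP1⟩ := a2i_origin_interface hU hA hGl hN (a := 0) (b := 1) (by decide) h0 h1 hq hqN hq1
    have hP2 : P 2 = N 2 := hPN 2 (by decide) (by decide)
    have hP3 : P 3 = ceilingUnit h χ := (hPN 3 (by decide) (by decide)).trans h3
    obtain ⟨k, hk, hkh⟩ := exists_frame_ne_h (hU.2 P hP 2) (by rw [hP2]; exact hap)
    obtain ⟨r, N', hN', hN'P⟩ := servedAbove_ceiling_apex hU hP (hDP P hP) (g := 3) (j := 2) (by decide)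
      (by rw [hP3]; exact onCeiling_ceilingUnit h χ) hk hkh
    have hlt : (N 2).1 < (N' 2).1 := by rw [← hP2]; exact hN'P.2.1
    exact ih (N'.perm (Equiv.swap 0 1))
      (by show (N 2).1 < (N' (Equiv.swap (0 : Fin 4) 1 2)).1; simpa [Equiv.swap_apply_of_ne_of_ne] using hlt)
      (by show N' (Equiv.swap (0 : Fin 4) 1 0) = _; simpa using (hN'P.1 1 (by decide)).symm.trans hP1)
      (by show N' (Equiv.swap (0 : Fin 4) 1 1) = _; simpa using (hN'P.1 0 (by decide)).symm.trans hP0)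
      (by show N' (Equiv.swap (0 : Fin 4) 1 3) = _; simpa [Equiv.swap_apply_of_ne_of_ne] using (hN'P.1 3 (by decide)).symm.trans hP3)
      (hGl _ N' hN')

theorem originUnitFree_aux {h : ℤ} {C : MConfig} (hU : C.InDiamond h) (hDN : ∀ Z ∈ C.lower, RuleDMu4N C Z)
    (hDP : ∀ P ∈ C.upper, RuleDMu4P C P) (hX : XPlusClosed C) (hA : A2IMinusClosed C) (hGl : PermClosed C.lower)
    (hΔu : DeltaClosed C.upper) : ∀ n : ℕ, ∀ {N : MCell} {φ χ : Fin 4}, h - (N 2).1 ≤ n → N 0 = (0, 0, 0) → N 1 = floorUnit φ →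
      N 3 = ceilingUnit h χ → N ∉ C.lower := by
  intro n
  induction n with
  | zero =>
    intro N φ χ hn h0 h1 h3
    exact originUnitFree_step hU hDN hDP hX hA hGl hΔu (fun N' hlt _ _ _ hN' => by
      have c0 : 0 ≤ absCharge (N' 2) := abs_nonneg _
      have htop : (N' 2).1 + absCharge (N' 2) ≤ h := (hU.1 N' hN' 2).2.2.2
      omega) h0 h1 h3
  | succ n ih =>
    intro N φ χ hn h0 h1 h3
    exact originUnitFree_step hU hDN hDP hX hA hGl hΔu (fun N' hlt h0' h1' h3' => ih (by omega) h0' h1' h3') h0 h1 h3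

/-- **F1.** `N{O, ℓ_φ, X, cu_χ} ∉ C.lower` for EVERY fourth letter `X` [◇_h, RULE D, X⁺, A2I⁻, `S₄` on E₋, `Δ` on E₊; every `h`] — the origin,
a floor unit and a ceiling unit never share an `N`-cell (B4 is `X = cu`, ON_d is `X = y_d`, `loneUnit_apex_absent` is `X = hI`).
Census: ◇₈ 168 ∕ ◇₁₀ 252 orbits (peel rounds 1 – 5), 0 survivors; new ◇₈ 106 ∕ ◇₁₀ 174. -/
theorem originUnitFree_N_absent {h : ℤ} {C : MConfig} (hU : C.InDiamond h) (hDN : ∀ Z ∈ C.lower, RuleDMu4N C Z)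
    (hDP : ∀ P ∈ C.upper, RuleDMu4P C P) (hX : XPlusClosed C) (hA : A2IMinusClosed C) (hGl : PermClosed C.lower)
    (hΔu : DeltaClosed C.upper) {N : MCell} {φ χ : Fin 4} (h0 : N 0 = (0, 0, 0)) (h1 : N 1 = floorUnit φ)
    (h3 : N 3 = ceilingUnit h χ) : N ∉ C.lower :=
  originUnitFree_aux hU hDN hDP hX hA hGl hΔu (h - (N 2).1).toNat (Int.self_le_toNat _) h0 h1 h3

/-- **F2.** `P{O, ℓ_φ, X, cu_χ} ∉ C.upper` for every fourth letter `X ≠ hI` [same]: the ceiling pin serves `X` above, then F1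
(B2 is `X = cu`, TP18 ∕ OP_d are `X = y_d`).  Census: ◇₈ 164 ∕ ◇₁₀ 248 orbits (rounds 1 – 5), 0 survivors; new ◇₈ 102 ∕ ◇₁₀ 170. -/
theorem originUnitFree_P_absent {h : ℤ} {C : MConfig} (hU : C.InDiamond h) (hDN : ∀ Z ∈ C.lower, RuleDMu4N C Z)
    (hDP : ∀ P ∈ C.upper, RuleDMu4P C P) (hX : XPlusClosed C) (hA : A2IMinusClosed C) (hGl : PermClosed C.lower)
    (hΔu : DeltaClosed C.upper) {P : MCell} {φ χ : Fin 4} (h2 : P 2 ≠ (h, 0, 0)) (h0 : P 0 = (0, 0, 0)) (h1 : P 1 = floorUnit φ)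
    (h3 : P 3 = ceilingUnit h χ) : P ∉ C.upper := fun hP => by
  obtain ⟨k, hk, hkh⟩ := exists_frame_ne_h (hU.2 P hP 2) h2
  obtain ⟨r, N, hN, hNP⟩ := servedAbove_ceiling_apex hU hP (hDP P hP) (g := 3) (j := 2) (by decide)
    (by rw [h3]; exact onCeiling_ceilingUnit h χ) hk hkh
  exact originUnitFree_N_absent hU hDN hDP hX hA hGl hΔu ((hNP.1 0 (by decide)).symm.trans h0) ((hNP.1 1 (by decide)).symm.trans h1)
    ((hNP.1 3 (by decide)).symm.trans h3) hN

/-- **F3.** `N{ℓ_φ, ℓ_ψ, X, cu_χ} ∉ C.lower` for every fourth letter `X ≠ hI` and ALL phases `φ, ψ, χ` [same]: the floor descent `ℓ_ψ ↦ O`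
gives F2 (B3 is `X = cu`, TN17 ∕ TN_d are `X = y_d`; `X = hI` with `φ ≠ ψ` is the ceiling fork TN0).
Census: ◇₈ 406 ∕ ◇₁₀ 616 orbits (rounds 1 – 5), 0 survivors; new ◇₈ 250 ∕ ◇₁₀ 420. -/
theorem unitPairFree_N_absent {h : ℤ} {C : MConfig} (hU : C.InDiamond h) (hDN : ∀ Z ∈ C.lower, RuleDMu4N C Z)
    (hDP : ∀ P ∈ C.upper, RuleDMu4P C P) (hX : XPlusClosed C) (hA : A2IMinusClosed C) (hGl : PermClosed C.lower)
    (hΔu : DeltaClosed C.upper) {N : MCell} {φ ψ χ : Fin 4} (h2 : N 2 ≠ (h, 0, 0)) (h0 : N 0 = floorUnit φ) (h1 : N 1 = floorUnit ψ)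
    (h3 : N 3 = ceilingUnit h χ) : N ∉ C.lower := fun hN => by
  obtain ⟨P, hP, hagree, hP0⟩ := descent_of_floorUnitPair hU (hDN N hN) (b := 1) (c := 0) (by decide) h1 h0
  exact originUnitFree_P_absent hU hDN hDP hX hA hGl hΔu (by rw [hagree 2 (by decide)]; exact h2) hP0
    ((hagree 1 (by decide)).trans h1) ((hagree 3 (by decide)).trans h3) hP

/-- **F4.** `P{ℓ_φ, ℓ_ψ, X, cu_χ} ∉ C.upper` for every fourth letter `X` BELOW the ceiling (`X.1 + |c(X)| ≠ h`) and ALL phases [same]: the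
ceiling pin serves `X` above; the served letter is not `hI` (an up-move reaching `hI` starts on the ceiling), so F3 applies
(TP20 is `X = s_m`; every `{ℓ, ℓ′, s_k ∕ t_k ∕ r_k ∕ aI ∕ aI + nℓ ∕ cℓ″}` completion).
Census: ◇₈ 260 ∕ ◇₁₀ 430 orbits (rounds 2 – 5), 0 survivors; new ◇₈ 210 ∕ ◇₁₀ 380. -/
theorem unitPairFree_P_absent {h : ℤ} {C : MConfig} (hU : C.InDiamond h) (hDN : ∀ Z ∈ C.lower, RuleDMu4N C Z)
    (hDP : ∀ P ∈ C.upper, RuleDMu4P C P) (hX : XPlusClosed C) (hA : A2IMinusClosed C) (hGl : PermClosed C.lower)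
    (hΔu : DeltaClosed C.upper) {P : MCell} {φ ψ χ : Fin 4} (h2 : ¬ OnCeiling h (P 2)) (h0 : P 0 = floorUnit φ)
    (h1 : P 1 = floorUnit ψ) (h3 : P 3 = ceilingUnit h χ) : P ∉ C.upper := fun hP => by
  obtain ⟨k, hk, hkh⟩ := exists_frame_ne_h (hU.2 P hP 2) (fun e => h2 (by rw [e]; exact onCeiling_apex h))
  obtain ⟨r, N, hN, hNP⟩ := servedAbove_ceiling_apex hU hP (hDP P hP) (g := 3) (j := 2) (by decide)
    (by rw [h3]; exact onCeiling_ceilingUnit h χ) hk hkh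
  refine unitPairFree_N_absent hU hDN hDP hX hA hGl hΔu (fun e => h2 ?_) ((hNP.1 0 (by decide)).symm.trans h0)
    ((hNP.1 1 (by decide)).symm.trans h1) ((hNP.1 3 (by decide)).symm.trans h3) hN
  exact onCeiling_below_apex (by have := hNP.2.1; omega) (e.symm.trans hNP.2.2)

/-- **F5.** `N{ℓ_φ, 2ℓ_u, X, cu_χ} ∉ C.lower` for every fourth letter `X` below the ceiling and ALL `φ, u, χ` [same + `S₄` on E₊]: the floor
pin `ℓ_φ` lowers `2ℓ_u` to `ℓ_u` (F4) or to `O` (F2 after (0 1)) (YN_d of §4 is `X = y_d`).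
Census: ◇₈ 400 ∕ ◇₁₀ 672 orbits (rounds 2 – 4), 0 survivors; new ◇₈ 384 ∕ ◇₁₀ 656. -/
theorem unitFloorTwoFree_N_absent {h : ℤ} {C : MConfig} (hU : C.InDiamond h) (hDN : ∀ Z ∈ C.lower, RuleDMu4N C Z)
    (hDP : ∀ P ∈ C.upper, RuleDMu4P C P) (hX : XPlusClosed C) (hA : A2IMinusClosed C) (hGl : PermClosed C.lower)
    (hGu : PermClosed C.upper) (hΔu : DeltaClosed C.upper) {N : MCell} {φ u χ : Fin 4} (h2 : ¬ OnCeiling h (N 2))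
    (h0 : N 0 = floorUnit φ) (h1 : N 1 = floorLetter u 2) (h3 : N 3 = ceilingUnit h χ) : N ∉ C.lower := fun hN => by
  have hfl : OnFloor (N 0) := onFloor_of_coord_zero (hU.1 N hN 0) (k := φ + 2) (by rw [h0]; exact (floorLetter_node φ 1).2)
  have hna : ¬ isApex (N 1) := by rw [h1]; exact floorLetter_not_isApex u (by norm_num)
  have hk : Adapted (N 1) u := by rw [h1]; exact (floorLetter_top u 2).1
  have hk0 : coord (N 1) u ≠ 0 := by rw [h1, (floorLetter_top u 2).2]; norm_num
  obtain ⟨P, hP, hZP⟩ := servedBelow_of_floorLetter hU hN (hDN N hN) (i := 0) (g := 1) (by decide) hfl hna hk hk0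
  obtain ⟨hc', hP1⟩ := floorLetter_downRay (hU.2 P hP 1) (h1.symm.trans hZP.2.2)
  have hP0 : P 0 = floorUnit φ := (hZP.1 0 (by decide)).trans h0
  have hP2 : P 2 = N 2 := hZP.1 2 (by decide)
  have hP3 : P 3 = ceilingUnit h χ := (hZP.1 3 (by decide)).trans h3
  rcases (show 2 - ((N 1).1 - (P 1).1) = 1 ∨ 2 - ((N 1).1 - (P 1).1) = 0 by have := hZP.2.1; omega) with hone | hze
  · rw [hone] at hP1
    exact unitPairFree_P_absent hU hDN hDP hX hA hGl hΔu (by rw [hP2]; exact h2) hP0 hP1 hP3 hP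
  · rw [hze] at hP1
    have hP1' : P 1 = (0, 0, 0) := hP1.trans (ray_zero _ _)
    have hne : P 2 ≠ (h, 0, 0) := fun e => h2 (by rw [← hP2, e]; exact onCeiling_apex h)
    exact originUnitFree_P_absent hU hDN hDP hX hA hGl hΔu (P := P.perm (Equiv.swap 0 1)) (φ := φ) (χ := χ)
      (by show P (Equiv.swap (0 : Fin 4) 1 2) ≠ _; simpa [Equiv.swap_apply_of_ne_of_ne] using hne)
      (by show P (Equiv.swap (0 : Fin 4) 1 0) = _; simpa using hP1')
      (by show P (Equiv.swap (0 : Fin 4) 1 1) = _; simpa using hP0)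
      (by show P (Equiv.swap (0 : Fin 4) 1 3) = _; simpa [Equiv.swap_apply_of_ne_of_ne] using hP3)
      (hGu _ P hP)

/-! ### ◇₁₀ census representatives of the §5 families (orbits of the j318002 peel tables; the free letter `X = O` — peel rounds 5, 5, 5, 5, 4 —
and an interior letter `X = 2I + 2ℓ₋₁ = (4,−2,0)` of the `t`-line, rounds 4, 4) -/

def repF1 : MCell := ![(0, 0, 0), (1, -1, 0), (0, 0, 0), (9, -1, 0)]
def repF2 : MCell := ![(0, 0, 0), (1, -1, 0), (0, 0, 0), (9, -1, 0)]
def repF3 : MCell := ![(1, -1, 0), (1, -1, 0), (0, 0, 0), (9, -1, 0)]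
def repF4 : MCell := ![(1, -1, 0), (1, -1, 0), (0, 0, 0), (9, -1, 0)]
def repF5 : MCell := ![(1, -1, 0), (2, 0, -2), (0, 0, 0), (9, -1, 0)]
def repF1t : MCell := ![(0, 0, 0), (1, -1, 0), (4, -2, 0), (9, -1, 0)]
def repF4t : MCell := ![(1, -1, 0), (1, 0, -1), (4, -2, 0), (9, -1, 0)]

/-- `N[O | ℓ₋₁ | O | 8I+ℓ₋₁] ∉ E₋` (peel round 5). -/
theorem repF1_absent {C : MConfig} (hU : C.InDiamond 10) (hG : C.G1Closed) (hS : C.StaticH1) : repF1 ∉ C.lower :=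
  originUnitFree_N_absent hU hS.1.1 hS.1.2 hS.2.1 hS.2.2 hG.1 hG.2.2.2 (φ := 2) (χ := 2)
    (by simp [repF1]) (by simp [repF1, ray]) (by simp [repF1, ray])
/-- `P[O | ℓ₋₁ | O | 8I+ℓ₋₁] ∉ E₊` (peel round 5). -/
theorem repF2_absent {C : MConfig} (hU : C.InDiamond 10) (hG : C.G1Closed) (hS : C.StaticH1) : repF2 ∉ C.upper :=
  originUnitFree_P_absent hU hS.1.1 hS.1.2 hS.2.1 hS.2.2 hG.1 hG.2.2.2 (φ := 2) (χ := 2)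
    (by simp [repF2]) (by simp [repF2]) (by simp [repF2, ray]) (by simp [repF2, ray])
/-- `N[ℓ₋₁ | ℓ₋₁ | O | 8I+ℓ₋₁] ∉ E₋` (equal phases; peel round 5). -/
theorem repF3_absent {C : MConfig} (hU : C.InDiamond 10) (hG : C.G1Closed) (hS : C.StaticH1) : repF3 ∉ C.lower :=
  unitPairFree_N_absent hU hS.1.1 hS.1.2 hS.2.1 hS.2.2 hG.1 hG.2.2.2 (φ := 2) (ψ := 2) (χ := 2)
    (by simp [repF3]) (by simp [repF3, ray]) (by simp [repF3, ray]) (by simp [repF3, ray])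
/-- `P[ℓ₋₁ | ℓ₋₁ | O | 8I+ℓ₋₁] ∉ E₊` (peel round 5). -/
theorem repF4_absent {C : MConfig} (hU : C.InDiamond 10) (hG : C.G1Closed) (hS : C.StaticH1) : repF4 ∉ C.upper :=
  unitPairFree_P_absent hU hS.1.1 hS.1.2 hS.2.1 hS.2.2 hG.1 hG.2.2.2 (φ := 2) (ψ := 2) (χ := 2)
    (by simp [repF4, OnCeiling, absCharge, chargeOf]) (by simp [repF4, ray]) (by simp [repF4, ray]) (by simp [repF4, ray])
/-- `N[ℓ₋₁ | 2ℓ_i | O | 8I+ℓ₋₁] ∉ E₋` (peel round 4). -/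
theorem repF5_absent {C : MConfig} (hU : C.InDiamond 10) (hG : C.G1Closed) (hS : C.StaticH1) : repF5 ∉ C.lower :=
  unitFloorTwoFree_N_absent hU hS.1.1 hS.1.2 hS.2.1 hS.2.2 hG.1 hG.2.1 hG.2.2.2 (φ := 2) (u := 1) (χ := 2)
    (by simp [repF5, OnCeiling, absCharge, chargeOf]) (by simp [repF5, ray]) (by simp [repF5, ray]) (by simp [repF5, ray])
/-- `N[O | ℓ₋₁ | 2I+2ℓ₋₁ | 8I+ℓ₋₁] ∉ E₋` (the `t`-letter `t_1`; peel round 4). -/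
theorem repF1t_absent {C : MConfig} (hU : C.InDiamond 10) (hG : C.G1Closed) (hS : C.StaticH1) : repF1t ∉ C.lower :=
  originUnitFree_N_absent hU hS.1.1 hS.1.2 hS.2.1 hS.2.2 hG.1 hG.2.2.2 (φ := 2) (χ := 2)
    (by simp [repF1t]) (by simp [repF1t, ray]) (by simp [repF1t, ray])
/-- `P[ℓ₋₁ | ℓ_i | 2I+2ℓ₋₁ | 8I+ℓ₋₁] ∉ E₊` (peel round 3). -/
theorem repF4t_absent {C : MConfig} (hU : C.InDiamond 10) (hG : C.G1Closed) (hS : C.StaticH1) : repF4t ∉ C.upper :=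
  unitPairFree_P_absent hU hS.1.1 hS.1.2 hS.2.1 hS.2.2 hG.1 hG.2.2.2 (φ := 2) (ψ := 1) (χ := 2)
    (by simp [repF4t, OnCeiling, absCharge, chargeOf]) (by simp [repF4t, ray]) (by simp [repF4t, ray]) (by simp [repF4t, ray])


/-! ## §6 (v0.4) The ceiling is free too over a unit pair of DISTINCT phases; the floor letter climbs to `2ℓ_u` at level `P` and `3ℓ_u` at level `N`

Over `{ℓ_φ, ℓ_ψ}` with `φ ≠ ψ` the letter served above may reach the apex `hI`: that row is the g18 CEILING FORK `N{ℓ_φ, ℓ_ψ, cu_χ, hI} ∉ E₋`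
(`ceilingForkFamily_absent`, §0, after the transposition `(2 3)` — `S₄` on E₋).  Hence F4 holds for EVERY `X ≠ hI`, on or below the ceiling
(**F4c**), F5 for every `X ≠ hI` when `φ ≠ u` (**F5c**), and two NEW classes follow by the same two moves (ceiling pin serves `X` above ∕
floor pin lowers the charged floor letter): **F6** `P{ℓ_φ, 2ℓ_u, X, cu_χ} ∉ E₊` and **F7** `N{ℓ_φ, 3ℓ_u, X, cu_χ} ∉ E₋`, both for `φ ≠ u` and
every `X` BELOW the ceiling.  The equal-phase rows and `P{ℓ_φ, 3ℓ_u, X, cu_χ}` stop exactly at the deep untyped rows `N{ℓ_φ, ℓ_φ, hI, cu_χ}`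
(peel round 4) and `N{ℓ_φ, 2ℓ_u, hI, cu_χ}` (round 7) of the census.  Pre-typing census map (`tools/ucl_map.py` → `data/ucl_h10.txt`, 264 rows,
and `ucl_h8.txt`): EVERY class `{ℓ_φ, c·ℓ_u, X, cu_χ}` with `c ∈ {2, 3}` is absent at both levels for every `X` and every phase relation at
`h = 8, 10` (0 survivors; rounds 2 – 9).  Hypotheses as §5 plus `S₄` on E₊; every `h : ℤ`. -/

/-- **F4c.** `P{ℓ_φ, ℓ_ψ, X, cu_χ} ∉ C.upper` for `φ ≠ ψ` and EVERY fourth letter `X ≠ hI`, on or below the ceiling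
[◇_h, RULE D, X⁺, A2I⁻, `S₄`(E₋), `S₄`(E₊), `Δ`(E₊)]: the ceiling pin serves `X` above; the served letter is `hI` (the ceiling fork, after
`(2 3)`) or not (F3).  TP_d (`X = y_d`) and the pair forks (`X = cu_v`) are the ceiling instances. -/
theorem unitPairFreeCeil_P_absent {h : ℤ} {C : MConfig} (hU : C.InDiamond h) (hDN : ∀ Z ∈ C.lower, RuleDMu4N C Z)
    (hDP : ∀ P ∈ C.upper, RuleDMu4P C P) (hX : XPlusClosed C) (hA : A2IMinusClosed C) (hGl : PermClosed C.lower)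
    (hGu : PermClosed C.upper) (hΔu : DeltaClosed C.upper) {P : MCell} {φ ψ χ : Fin 4} (hφψ : φ ≠ ψ) (h2 : P 2 ≠ (h, 0, 0))
    (h0 : P 0 = floorUnit φ) (h1 : P 1 = floorUnit ψ) (h3 : P 3 = ceilingUnit h χ) : P ∉ C.upper := fun hP => by
  obtain ⟨k, hk, hkh⟩ := exists_frame_ne_h (hU.2 P hP 2) h2
  obtain ⟨r, N, hN, hNP⟩ := servedAbove_ceiling_apex hU hP (hDP P hP) (g := 3) (j := 2) (by decide)
    (by rw [h3]; exact onCeiling_ceilingUnit h χ) hk hkh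
  have hN0 : N 0 = floorUnit φ := (hNP.1 0 (by decide)).symm.trans h0
  have hN1 : N 1 = floorUnit ψ := (hNP.1 1 (by decide)).symm.trans h1
  have hN3 : N 3 = ceilingUnit h χ := (hNP.1 3 (by decide)).symm.trans h3
  by_cases hap : N 2 = (h, 0, 0)
  · exact ceilingForkFamily_absent hU hDN hDP hX hGu hΔu (Z := N.perm (Equiv.swap 2 3)) hφψ
      (by show N (Equiv.swap (2 : Fin 4) 3 0) = _; simpa [Equiv.swap_apply_of_ne_of_ne] using hN0)
      (by show N (Equiv.swap (2 : Fin 4) 3 1) = _; simpa [Equiv.swap_apply_of_ne_of_ne] using hN1)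
      (by show N (Equiv.swap (2 : Fin 4) 3 2) = _; simpa using hN3)
      (by show N (Equiv.swap (2 : Fin 4) 3 3) = _; simpa using hap) (hGl _ N hN)
  · exact unitPairFree_N_absent hU hDN hDP hX hA hGl hΔu hap hN0 hN1 hN3 hN

/-- **F5c.** `N{ℓ_φ, 2ℓ_u, X, cu_χ} ∉ C.lower` for `φ ≠ u` and every fourth letter `X ≠ hI` [same]: the floor pin `ℓ_φ` lowers `2ℓ_u` to
`ℓ_u` (F4c) or to `O` (F2 after `(0 1)`).  `X = cu_χ` of equal phase is the census row `N{ℓ_φ, 2ℓ_u, cu_χ, cu_χ}` (peel round 2; the 12 NEW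
orbits of F5c at ◇₁₀). -/
theorem unitFloorTwoFreeCeil_N_absent {h : ℤ} {C : MConfig} (hU : C.InDiamond h) (hDN : ∀ Z ∈ C.lower, RuleDMu4N C Z)
    (hDP : ∀ P ∈ C.upper, RuleDMu4P C P) (hX : XPlusClosed C) (hA : A2IMinusClosed C) (hGl : PermClosed C.lower)
    (hGu : PermClosed C.upper) (hΔu : DeltaClosed C.upper) {N : MCell} {φ u χ : Fin 4} (hφu : φ ≠ u) (h2 : N 2 ≠ (h, 0, 0))
    (h0 : N 0 = floorUnit φ) (h1 : N 1 = floorLetter u 2) (h3 : N 3 = ceilingUnit h χ) : N ∉ C.lower := fun hN => by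
  have hfl : OnFloor (N 0) := onFloor_of_coord_zero (hU.1 N hN 0) (k := φ + 2) (by rw [h0]; exact (floorLetter_node φ 1).2)
  have hna : ¬ isApex (N 1) := by rw [h1]; exact floorLetter_not_isApex u (by norm_num)
  have hk : Adapted (N 1) u := by rw [h1]; exact (floorLetter_top u 2).1
  have hk0 : coord (N 1) u ≠ 0 := by rw [h1, (floorLetter_top u 2).2]; norm_num
  obtain ⟨P, hP, hZP⟩ := servedBelow_of_floorLetter hU hN (hDN N hN) (i := 0) (g := 1) (by decide) hfl hna hk hk0
  obtain ⟨hc', hP1⟩ := floorLetter_downRay (hU.2 P hP 1) (h1.symm.trans hZP.2.2)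
  have hP0 : P 0 = floorUnit φ := (hZP.1 0 (by decide)).trans h0
  have hP2 : P 2 = N 2 := hZP.1 2 (by decide)
  have hP3 : P 3 = ceilingUnit h χ := (hZP.1 3 (by decide)).trans h3
  have hne : P 2 ≠ (h, 0, 0) := by rw [hP2]; exact h2
  rcases (show 2 - ((N 1).1 - (P 1).1) = 1 ∨ 2 - ((N 1).1 - (P 1).1) = 0 by have := hZP.2.1; omega) with hone | hze
  · rw [hone] at hP1
    exact unitPairFreeCeil_P_absent hU hDN hDP hX hA hGl hGu hΔu hφu hne hP0 hP1 hP3 hP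
  · rw [hze] at hP1
    have hP1' : P 1 = (0, 0, 0) := hP1.trans (ray_zero _ _)
    exact originUnitFree_P_absent hU hDN hDP hX hA hGl hΔu (P := P.perm (Equiv.swap 0 1)) (φ := φ) (χ := χ)
      (by show P (Equiv.swap (0 : Fin 4) 1 2) ≠ _; simpa [Equiv.swap_apply_of_ne_of_ne] using hne)
      (by show P (Equiv.swap (0 : Fin 4) 1 0) = _; simpa using hP1')
      (by show P (Equiv.swap (0 : Fin 4) 1 1) = _; simpa using hP0)
      (by show P (Equiv.swap (0 : Fin 4) 1 3) = _; simpa [Equiv.swap_apply_of_ne_of_ne] using hP3)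
      (hGu _ P hP)

/-- **F6.** `P{ℓ_φ, 2ℓ_u, X, cu_χ} ∉ C.upper` for `φ ≠ u` and every fourth letter `X` BELOW the ceiling [same] — a NEW class (the census rows
`P{ℓ_φ, 2ℓ_u, s_k ∕ t_k ∕ aI ∕ aI + c·ℓ_v ∕ c'·ℓ_v, cu_χ}`, peel rounds 2 – 4): the ceiling pin serves `X` above, the served letter is `≠ hI`
(`onCeiling_below_apex`), F5c.  Census: see `repF6_absent`; ◇₁₀ members by `tools/famU.py`. -/
theorem unitFloorTwoFree_P_absent {h : ℤ} {C : MConfig} (hU : C.InDiamond h) (hDN : ∀ Z ∈ C.lower, RuleDMu4N C Z)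
    (hDP : ∀ P ∈ C.upper, RuleDMu4P C P) (hX : XPlusClosed C) (hA : A2IMinusClosed C) (hGl : PermClosed C.lower)
    (hGu : PermClosed C.upper) (hΔu : DeltaClosed C.upper) {P : MCell} {φ u χ : Fin 4} (hφu : φ ≠ u) (h2 : ¬ OnCeiling h (P 2))
    (h0 : P 0 = floorUnit φ) (h1 : P 1 = floorLetter u 2) (h3 : P 3 = ceilingUnit h χ) : P ∉ C.upper := fun hP => by
  obtain ⟨k, hk, hkh⟩ := exists_frame_ne_h (hU.2 P hP 2) (fun e => h2 (by rw [e]; exact onCeiling_apex h))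
  obtain ⟨r, N, hN, hNP⟩ := servedAbove_ceiling_apex hU hP (hDP P hP) (g := 3) (j := 2) (by decide)
    (by rw [h3]; exact onCeiling_ceilingUnit h χ) hk hkh
  refine unitFloorTwoFreeCeil_N_absent hU hDN hDP hX hA hGl hGu hΔu hφu (fun e => h2 ?_) ((hNP.1 0 (by decide)).symm.trans h0)
    ((hNP.1 1 (by decide)).symm.trans h1) ((hNP.1 3 (by decide)).symm.trans h3) hN
  exact onCeiling_below_apex (by have := hNP.2.1; omega) (e.symm.trans hNP.2.2)

/-- **F7.** `N{ℓ_φ, 3ℓ_u, X, cu_χ} ∉ C.lower` for `φ ≠ u` and every fourth letter `X` BELOW the ceiling [same] — a NEW class (peel rounds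
2 – 4): the floor pin `ℓ_φ` lowers `3ℓ_u` to `2ℓ_u` (F6), `ℓ_u` (F4) or `O` (F2 after `(0 1)`). -/
theorem unitFloorThreeFree_N_absent {h : ℤ} {C : MConfig} (hU : C.InDiamond h) (hDN : ∀ Z ∈ C.lower, RuleDMu4N C Z)
    (hDP : ∀ P ∈ C.upper, RuleDMu4P C P) (hX : XPlusClosed C) (hA : A2IMinusClosed C) (hGl : PermClosed C.lower)
    (hGu : PermClosed C.upper) (hΔu : DeltaClosed C.upper) {N : MCell} {φ u χ : Fin 4} (hφu : φ ≠ u) (h2 : ¬ OnCeiling h (N 2))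
    (h0 : N 0 = floorUnit φ) (h1 : N 1 = floorLetter u 3) (h3 : N 3 = ceilingUnit h χ) : N ∉ C.lower := fun hN => by
  have hfl : OnFloor (N 0) := onFloor_of_coord_zero (hU.1 N hN 0) (k := φ + 2) (by rw [h0]; exact (floorLetter_node φ 1).2)
  have hna : ¬ isApex (N 1) := by rw [h1]; exact floorLetter_not_isApex u (by norm_num)
  have hk : Adapted (N 1) u := by rw [h1]; exact (floorLetter_top u 3).1
  have hk0 : coord (N 1) u ≠ 0 := by rw [h1, (floorLetter_top u 3).2]; norm_num
  obtain ⟨P, hP, hZP⟩ := servedBelow_of_floorLetter hU hN (hDN N hN) (i := 0) (g := 1) (by decide) hfl hna hk hk0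
  obtain ⟨hc', hP1⟩ := floorLetter_downRay (hU.2 P hP 1) (h1.symm.trans hZP.2.2)
  have hP0 : P 0 = floorUnit φ := (hZP.1 0 (by decide)).trans h0
  have hP2 : P 2 = N 2 := hZP.1 2 (by decide)
  have hP3 : P 3 = ceilingUnit h χ := (hZP.1 3 (by decide)).trans h3
  have h2' : ¬ OnCeiling h (P 2) := by rw [hP2]; exact h2
  rcases (show 3 - ((N 1).1 - (P 1).1) = 2 ∨ 3 - ((N 1).1 - (P 1).1) = 1 ∨ 3 - ((N 1).1 - (P 1).1) = 0 by
    have := hZP.2.1; omega) with htwo | hone | hze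
  · rw [htwo] at hP1
    exact unitFloorTwoFree_P_absent hU hDN hDP hX hA hGl hGu hΔu hφu h2' hP0 hP1 hP3 hP
  · rw [hone] at hP1
    exact unitPairFree_P_absent hU hDN hDP hX hA hGl hΔu h2' hP0 hP1 hP3 hP
  · rw [hze] at hP1
    have hP1' : P 1 = (0, 0, 0) := hP1.trans (ray_zero _ _)
    have hne : P 2 ≠ (h, 0, 0) := fun e => h2 (by rw [← hP2, e]; exact onCeiling_apex h)
    exact originUnitFree_P_absent hU hDN hDP hX hA hGl hΔu (P := P.perm (Equiv.swap 0 1)) (φ := φ) (χ := χ)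
      (by show P (Equiv.swap (0 : Fin 4) 1 2) ≠ _; simpa [Equiv.swap_apply_of_ne_of_ne] using hne)
      (by show P (Equiv.swap (0 : Fin 4) 1 0) = _; simpa using hP1')
      (by show P (Equiv.swap (0 : Fin 4) 1 1) = _; simpa using hP0)
      (by show P (Equiv.swap (0 : Fin 4) 1 3) = _; simpa [Equiv.swap_apply_of_ne_of_ne] using hP3)
      (hGu _ P hP)

/-! ### ◇₁₀ census representatives of the §6 families (`ℓ₋₁ = ℓ_2 = (1,−1,0)`, `ℓ_{−i} = ℓ_1 = (1,0,−1)`, `cu = 8I + ℓ₋₁ = (9,−1,0)`) -/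

def repF4c : MCell := ![(1, -1, 0), (1, 0, -1), (9, -1, 0), (9, -1, 0)]
def repF5c : MCell := ![(1, -1, 0), (2, 0, -2), (9, -1, 0), (9, -1, 0)]
def repF6 : MCell := ![(1, -1, 0), (2, 0, -2), (3, 1, 0), (9, -1, 0)]
def repF7 : MCell := ![(1, -1, 0), (3, 0, -3), (3, 1, 0), (9, -1, 0)]
def repF7s : MCell := ![(1, -1, 0), (3, 0, -3), (7, 1, 0), (9, -1, 0)]

/-- `P[ℓ₋₁ | ℓ₋ᵢ | 8I+ℓ₋₁ | 8I+ℓ₋₁] ∉ E₊` — the free letter EQUAL to the pin (typed before; shown for the shape). -/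
theorem repF4c_absent {C : MConfig} (hU : C.InDiamond 10) (hG : C.G1Closed) (hS : C.StaticH1) : repF4c ∉ C.upper :=
  unitPairFreeCeil_P_absent hU hS.1.1 hS.1.2 hS.2.1 hS.2.2 hG.1 hG.2.1 hG.2.2.2 (φ := 2) (ψ := 1) (χ := 2) (by decide)
    (by simp [repF4c]) (by simp [repF4c, ray]) (by simp [repF4c, ray]) (by simp [repF4c, ray])
/-- `N[ℓ₋₁ | 2ℓ₋ᵢ | 8I+ℓ₋₁ | 8I+ℓ₋₁] ∉ E₋` (the equal-phase ceiling row `N{ℓ, 2ℓ′, cu_χ, cu_χ}`; peel round 2). -/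
theorem repF5c_absent {C : MConfig} (hU : C.InDiamond 10) (hG : C.G1Closed) (hS : C.StaticH1) : repF5c ∉ C.lower :=
  unitFloorTwoFreeCeil_N_absent hU hS.1.1 hS.1.2 hS.2.1 hS.2.2 hG.1 hG.2.1 hG.2.2.2 (φ := 2) (u := 1) (χ := 2) (by decide)
    (by simp [repF5c]) (by simp [repF5c, ray]) (by simp [repF5c, ray]) (by simp [repF5c, ray])
/-- `P[ℓ₋₁ | 2ℓ₋ᵢ | 2I+ℓ₁ | 8I+ℓ₋₁] ∉ E₊` (peel round 4). -/
theorem repF6_absent {C : MConfig} (hU : C.InDiamond 10) (hG : C.G1Closed) (hS : C.StaticH1) : repF6 ∉ C.upper :=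
  unitFloorTwoFree_P_absent hU hS.1.1 hS.1.2 hS.2.1 hS.2.2 hG.1 hG.2.1 hG.2.2.2 (φ := 2) (u := 1) (χ := 2) (by decide)
    (by simp [repF6, OnCeiling, absCharge, chargeOf]) (by simp [repF6, ray]) (by simp [repF6, ray]) (by simp [repF6, ray])
/-- `N[ℓ₋₁ | 3ℓ₋ᵢ | 2I+ℓ₁ | 8I+ℓ₋₁] ∉ E₋` (peel round 4). -/
theorem repF7_absent {C : MConfig} (hU : C.InDiamond 10) (hG : C.G1Closed) (hS : C.StaticH1) : repF7 ∉ C.lower :=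
  unitFloorThreeFree_N_absent hU hS.1.1 hS.1.2 hS.2.1 hS.2.2 hG.1 hG.2.1 hG.2.2.2 (φ := 2) (u := 1) (χ := 2) (by decide)
    (by simp [repF7, OnCeiling, absCharge, chargeOf]) (by simp [repF7, ray]) (by simp [repF7, ray]) (by simp [repF7, ray])
/-- `N[ℓ₋₁ | 3ℓ₋ᵢ | 6I+ℓ₁ | 8I+ℓ₋₁] ∉ E₋` (the sub-top letter `s_m` of a third phase; peel round 2). -/
theorem repF7s_absent {C : MConfig} (hU : C.InDiamond 10) (hG : C.G1Closed) (hS : C.StaticH1) : repF7s ∉ C.lower :=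
  unitFloorThreeFree_N_absent hU hS.1.1 hS.1.2 hS.2.1 hS.2.2 hG.1 hG.2.1 hG.2.2.2 (φ := 2) (u := 1) (χ := 2) (by decide)
    (by simp [repF7s, OnCeiling, absCharge, chargeOf]) (by simp [repF7s, ray]) (by simp [repF7s, ray]) (by simp [repF7s, ray])


/-! ## §7 (v0.5, g22) THE NODE-2 TOWER over the pins `{O, ·, ·, hI}` by ONE downward induction on the level, the apex row
`P{O, ℓ_φ, cu_χ, hI}` (OPA) and the equal-phase unit-pair rows `N{ℓ_φ, ℓ_ψ, cu_χ, hI}` — the census's deep apex rows of the unit corner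

THE TOWER.  Fix `h = 2μ`, a phase `v` and the node-2 line `L(m) = 2I + m·ℓ_v = nodeTwoLetter v m` (`L(−1) = ℓ_{v+2}`, `L(0) = 2I`,
`L(μ−1) = hI − (μ−1)·n_{v+2}` the ceiling-line letter); the TOWER CELL of level `m` with free letter `W` is `T(m)[W] = {O, L(m), W, hI}`
(slots 0, 1, 2, 3).  **T1** for `1 ≤ m ≤ μ − 2` and EVERY `W ≠ O`: `T(m)[W] ∉ E₊` and `T(m)[W] ∉ E₋`
[◇_h, RULE D (both levels), X⁺, A2I⁻, `S₄` on E₋ and on E₊].  Proof = ONE downward ℕ-induction on `μ − 2 − m` (`tower_aux`):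
* P-STEP (`towerP_step`, any `W`, also `m = −1`): RULE D at `T(m)[W] ∈ E₊` on the pair (`L(m)`, top frame `v`, coordinate `2 + 2m ≠ h`) ×
  (the apex pin `hI`) is the UP-LINE of `L(m)` (`upLine_of_ruleDMu4P`): a server `T(m+e)[W] ∈ E₋`, absent by induction unless it is the TOP
  one `m + e = μ − 1`; there RULE D on the pair (`O`, `L(μ−1)`) is the descent `P♭ = T(μ−1)[W](1 ↦ μ·ℓ_v) ∈ E₊` (`descent_of_floorNode_nodeTwo`),
  and the X⁺ FORK (`xplus_fork` of the tree, template `child_not_node_four`) at `z = hI − (μ−1)·n_{v+2}` with the partners `T(m)[W]`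
  (direction `v`, lowest server = the top one by induction) and `P♭` (direction `v+2`, on the ceiling line) fires: an (H-e′) breaker would be
  a ceiling letter `hI − d₂·n_{v+2}` (`ceiling_effective_sameRay`) and `fork_effective` places it causally below `z`.
* N-STEP (`originPin_lower_step`, slots 1 and 3 ARBITRARY): at `N = {O, L, W, X} ∈ E₋` with `W ≠ O` the floor pin `O` serves `W` BELOW
  (`servedBelow_floor_apex`); the child `{O, L, W′, X} ∈ E₊` has `W′ ≠ O` (P-step) unless `W = d·ℓ_r` is a floor letter lowered onto
  `O`; then the A2I⁻ ORIGIN INTERFACE FOR A FLOOR LETTER OF ANY CHARGE (`a2i_origin_floor_interface`: the instance `(N; 2, r; q; 0, r,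
  N∘(0 2))`, whose `inter` escape — a shallower `r`-partner `{O, L, d′ℓ_r, X}`, `1 ≤ d′ < d` — is excluded by the P-step, and whose only
  possible polluter is the conclusion) returns `{c′ℓ_r, L, O, X} ∈ E₊`, i.e. `T[c′ℓ_r] ∈ E₊` after `(0 2)` — the P-step again.
**OPA** (`originUnitCeilingUnitApex_P_absent`): `P{O, ℓ_φ, cu_χ, hI} ∉ E₊` for ALL `φ, χ` [adds `Δ` on E₊] = the P-step at level `m = −1`
(`ℓ_φ = L(−1)` on the line of phase `v = φ + 2`), whose intermediate servers are the tower's `N`-cells `T(m′)[cu_χ]` (T1) and the apex row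
`N{O, 2I, cu_χ, hI}`, absent RELATIVE to `P{O, ℓ_φ, cu_χ, hI}` (`apexTwoCeilingUnit_N_rel`: the floor pin lowers `2I` off the frame `φ` onto
`ℓ_ψ`, `ψ ≠ φ`, and a `Δ`-rotation of that child is a second child `P(2 ↦ cu_χ′)` — `apexCeilingUnit_absent_of_secondChild`, g19).
COROLLARIES: **UPA** `N{ℓ_φ, ℓ_ψ, cu_χ, hI} ∉ E₋` for ALL phases (`descent_of_floorUnitPair` → OPA; `φ ≠ ψ` was the g18 ceiling fork, `φ = ψ`
is the census's round-4 row `N{ℓ_φ, ℓ_φ, hI, cu_χ}`), hence the §5 ∕ §6 free-letter families WITHOUT their phase ∕ ceiling provisos: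
F2⁺ `P{O, ℓ_φ, X, cu_χ} ∉ E₊` for EVERY `X`; F3⁺ `N{ℓ_φ, ℓ_ψ, X, cu_χ} ∉ E₋` for EVERY `X` and all phases; F4⁺ `P{ℓ_φ, ℓ_ψ, X, cu_χ} ∉ E₊`
(`X ≠ hI`, all phases); F5⁺ `N{ℓ_φ, 2ℓ_u, X, cu_χ} ∉ E₋` (`X ≠ hI`, all phases); F6⁺ `P{ℓ_φ, 2ℓ_u, X, cu_χ} ∉ E₊` and F7⁺ `N{ℓ_φ, 3ℓ_u, X, cu_χ}
∉ E₋` (`X` below the ceiling, ALL phases).  Census (`tools/famV.py 4 6 8 10` vs j318002 ◇₈ a459e02921a60310 ∕ ◇₁₀ 74004db439790926): see the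
memo CEILING-TOWER-g22; the tower's `P`-cells are peel rounds 2 – 3, its `N`-cells rounds 2 – 5, OPA round 3 (◇₈) ∕ 5 (◇₁₀), UPA round 4;
the excluded columns `W = O` and the apex level `m = 0` ARE deep (rounds 6 – 9) and are not claimed.  Every `h : ℤ` (`h = 2μ` where stated).
HC ∕ HC_CM ∕ HC_AV ∕ H2 ∕ (T_h) ∕ KAbsent_h are NOT proved; census-neutral. -/

theorem nodeTwoLetter_fst (u : Fin 4) (n : ℤ) : (nodeTwoLetter u n).1 = 2 + n := rfl

theorem floorLetter_fst (φ : Fin 4) (c : ℤ) : (floorLetter φ c).1 = c := show (0 : ℤ) + c = c from zero_add c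

/-- a letter of ◇_h other than the origin has an adapted frame coordinate `≠ 0` (RULE D at an `N`-cell with a floor pin can serve it BELOW). -/
theorem exists_frame_ne_zero {z : BPoint} (hzax : z.2 = (0, 0) ∨ AxisPt z) (hne : z ≠ (0, 0, 0)) :
    ∃ k : Fin 4, Adapted z k ∧ coord z k ≠ 0 := by
  obtain ⟨α, a, b⟩ := z
  simp only [AxisPt, Prod.mk.injEq] at hzax
  simp only [ne_eq, Prod.mk.injEq] at hne
  rcases hzax with ⟨ha, hb⟩ | ⟨ha, hb⟩ | ⟨ha, hb⟩
  · exact ⟨0, by simp [Adapted, hb], by simp [coord]; omega⟩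
  · by_cases e : α + a = 0
    · exact ⟨2, by simp [Adapted, hb], by simp [coord]; omega⟩
    · exact ⟨0, by simp [Adapted, hb], by simp [coord]; omega⟩
  · by_cases e : α - b = 0
    · exact ⟨3, by simp [Adapted, ha], by simp [coord]; omega⟩
    · exact ⟨1, by simp [Adapted, ha], by simp [coord]; omega⟩

/-- `servedBelow_floor_apex` keeping the direction datum of RULE D: served below in a direction other than the antipode `k + 2`. -/
theorem servedBelow_floor_dir {h : ℤ} {C : MConfig} (hU : C.InDiamond h) {Z : MCell} (hZ : Z ∈ C.lower) (hD : RuleDMu4N C Z) {i g : Fin 4}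
    (hig : i ≠ g) (hi : OnFloor (Z i)) {k : Fin 4} (hk : Adapted (Z g) k) (hk0 : coord (Z g) k ≠ 0) :
    ∃ r, r ≠ k + 2 ∧ MServedBelow C Z g r := by
  obtain ⟨m, hm, hm0⟩ := exists_node_dir (hU.1 Z hZ i).1
  have hm0' : coord (Z i) m = 0 := by rw [hm0, hi, sub_self]
  have hne : coord (Z i) m ≠ coord (Z g) k := by rw [hm0']; exact Ne.symm hk0
  have below : ∀ P ∈ C.upper, ∀ a : Fin 4, a ≠ m + 2 → (P i).1 < (Z i).1 → Z i = ray (P i) a ((Z i).1 - (P i).1) → False :=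
    fun P hP a ha hlt hray =>
      not_inDiamond_below_offtop hi (hU.1 Z hZ i).1 hm hm0' ha (by omega) hray (hU.2 P hP i).1 (hU.2 P hP i).2.1
  rcases hD i g hig m k hm hk hne with ⟨r, hr, P, hP, hZP⟩ | ⟨r, hr, P, hP, hZP⟩ | ⟨a, b, ha, -, P, hP, -, hi1, hi2, -, -⟩
  · exact (below P hP r hr hZP.2.1 hZP.2.2).elim
  · exact ⟨r, hr, P, hP, hZP⟩
  · have ha' : a ≠ m + 2 := by
      rcases ha with e | ⟨-, hne2⟩
      · rw [e]; exact fin4_ne_add_two m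
      · exact hne2
    exact (below P hP a ha' hi1 hi2).elim

/-- **THE A2I⁻ ORIGIN INTERFACE FOR A FLOOR LETTER OF ANY CHARGE** (KERNEL, every `h`; A2I⁻, `S₄` on E₋): `Z ∈ E₋` with `Z a = O`,
`Z b = c·ℓ_ψ` (`c ≥ 1`), its full descent `q = Z(b ↦ O) ∈ E₊`, and NO shallower `ψ`-partner `Z(b ↦ c″ℓ_ψ)`, `0 < c″ < c`, present (the
`inter` escape) ⇒ some `P = Z(a ↦ c′·ℓ_ψ, b ↦ O) ∈ E₊` with `1 ≤ c′ ≤ c` (the only possible (3b)-polluter of the instance `(Z; b, ψ; q; a, ψ,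
Z∘(a b))`; every other escape is below `O` or spacelike from `O`).  `c = 1` is `a2i_origin_interface` (g20). -/
theorem a2i_origin_floor_interface {h c : ℤ} {C : MConfig} (hU : C.InDiamond h) (hA : A2IMinusClosed C) (hGl : PermClosed C.lower)
    {Z : MCell} (hZ : Z ∈ C.lower) {a b : Fin 4} (hab : a ≠ b) {ψ : Fin 4} (ha : Z a = (0, 0, 0)) (hb : Z b = floorLetter ψ c)
    (hc : 1 ≤ c) {q : MCell} (hq : q ∈ C.upper) (hqZ : MAgree q Z b) (hqb : q b = (0, 0, 0))
    (hinter : ∀ P ∈ C.upper, UPartner Z P b ψ → (P b).1 ≤ 0) :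
    ∃ P ∈ C.upper, ∃ c', 1 ≤ c' ∧ c' ≤ c ∧ MAgree2 P Z a b ∧ P a = floorLetter ψ c' ∧ P b = (0, 0, 0) := by
  by_contra hno
  have hN' : Z.perm (Equiv.swap a b) ∈ C.lower := hGl (Equiv.swap a b) Z hZ
  have eNa : Z.perm (Equiv.swap a b) a = floorLetter ψ c := by show Z (Equiv.swap a b a) = _; rw [Equiv.swap_apply_left, hb]
  have eNb : Z.perm (Equiv.swap a b) b = (0, 0, 0) := by show Z (Equiv.swap a b b) = _; rw [Equiv.swap_apply_right, ha]
  have hqa : q a = (0, 0, 0) := (hqZ a hab).trans ha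
  have hZb1 : (Z b).1 = c := by rw [hb, floorLetter_fst]
  have hqb1 : (q b).1 = 0 := by rw [hqb]
  have hZa1 : (Z a).1 = 0 := by rw [ha]
  have hqa1 : (q a).1 = 0 := by rw [hqa]
  have hc0 : |c| = c := abs_of_nonneg (by omega)
  have h0c : (0 : ℤ) ≤ c := by omega
  have nob : ∀ P ∈ C.upper, ∀ w : Fin 4, UPartner Z P b w → w = ψ := fun P hP w hZP => by
    have hd : 0 < (Z b).1 - (P b).1 := by have := hZP.2.1; omega
    have e : floorLetter ψ c = ray (P b) w ((Z b).1 - (P b).1) := by rw [← hb]; exact hZP.2.2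
    exact below_floorLetter (hU.2 P hP b) h0c hd e
  refine hA Z hZ q hq _ hN' b ψ a ψ ⟨by rw [hb]; exact floorLetter_not_isApex ψ (by omega), ?_, ?_, fun _ => ?_, hab, ?_, ?_, ?_, ?_, ?_, ?_⟩
  · rw [hb]; left
    fin_cases ψ <;> simp [EncDir, cabs, ray, hc0, h0c]
  · exact ⟨hqZ, by omega, by rw [hZb1, hqb1, hb, hqb, sub_zero]⟩
  · rw [hZb1, hqb1, hb]; fin_cases ψ <;> simp [cabs, ray, hc0, h0c]
  · refine ⟨fun g hg => ?_, by rw [eNa, floorLetter_fst, hqa1]; omega, by rw [eNa, floorLetter_fst, hqa1, hqa, sub_zero]⟩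
    by_cases hgb : g = b
    · rw [hgb, hqb, eNb]
    · show q g = Z (Equiv.swap a b g)
      rw [Equiv.swap_apply_of_ne_of_ne hg hgb]; exact hqZ g hgb
  · exact fun P hP w hw hZP => hw (nob P hP w hZP)
  · exact fun P hP hZP => by rw [hqb1]; exact hinter P hP hZP
  · exact fun P hP hqP => by
      have h1 := hqP.2.1; have h2 := fst_nonneg_of_inDiamond (hU.2 P hP b); rw [hqb1] at h1; exact absurd h1 (by omega)
  · exact fun P hP hnb _ => by
      have h1 := hnb.1; have h2 := fst_nonneg_of_inDiamond (hU.2 P hP a); rw [hZa1] at h1; exact absurd h1 (by omega)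
  · intro P hP hPg hul
    refine ⟨fun h3b => ?_, fun h3d => not_spacelike_of_inDiamond (hU.2 P hP a) (by rw [ha] at h3d; exact h3d.2)⟩
    have hNa1 : (Z.perm (Equiv.swap a b) a).1 = c := by rw [eNa, floorLetter_fst]
    obtain ⟨c', hc'⟩ : ∃ c', c' = (P a).1 := ⟨_, rfl⟩
    have hc'1 : 1 ≤ c' := by have := h3b.1; omega
    have hc'c : c' ≤ c := by have := h3b.2.1; omega
    have hPa : P a = floorLetter ψ c' := by
      have e := h3b.2.2; rw [hZa1, sub_zero, ha, ← hc'] at e; exact e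
    have hPb1 : (P b).1 = 0 := by have := hul.1; have := fst_nonneg_of_inDiamond (hU.2 P hP b); omega
    have hPb : P b = (0, 0, 0) := by
      have e := hul.2; rw [hqb1, hPb1, show ((0:ℤ) - 0) = 0 by norm_num, ray_zero] at e; rw [← e, hqb]
    exact hno ⟨P, hP, c', hc'1, hc'c, fun g hga hgb => hPg g hgb hga, hPa, hPb⟩

/-- **N-STEP: THE ORIGIN PIN LOWERS THE FREE LETTER** (KERNEL, every `h`; RULE D on E₋, A2I⁻, `S₄` on both levels): if every present
`P`-cell `{O, L, W′, X}` (slots 0 ↦ `O`, 1 ↦ `L`, 3 ↦ `X` fixed, ANY letters) has `W′ = O`, then so does every present `N`-cell `{O, L, W, X}`: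
the floor pin serves `W ≠ O` below onto `W′ = O`, so `W = d·ℓ_r`, and the origin interface + `(0 2)` give `{O, L, c′ℓ_r, X} ∈ E₊`, `c′ ≥ 1`. -/
theorem originPin_lower_step {h : ℤ} {C : MConfig} (hU : C.InDiamond h) (hDN : ∀ Z ∈ C.lower, RuleDMu4N C Z) (hA : A2IMinusClosed C)
    (hGl : PermClosed C.lower) (hGu : PermClosed C.upper) {N : MCell} (hN : N ∈ C.lower) (h0 : N 0 = (0, 0, 0)) (h2 : N 2 ≠ (0, 0, 0))
    (hP : ∀ P ∈ C.upper, P 0 = (0, 0, 0) → P 1 = N 1 → P 3 = N 3 → P 2 = (0, 0, 0)) : False := by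
  obtain ⟨k, hk, hk0⟩ := exists_frame_ne_zero (hU.1 N hN 2).1 h2
  have hfl : OnFloor (N 0) := by rw [h0]; simp [OnFloor, absCharge, chargeOf]
  obtain ⟨r, P, hPu, hNP⟩ := servedBelow_floor_apex hU hN (hDN N hN) (i := 0) (g := 2) (by decide) hfl hk hk0
  have hP0 : P 0 = (0, 0, 0) := (hNP.1 0 (by decide)).trans h0
  have hW' : P 2 = (0, 0, 0) := hP P hPu hP0 (hNP.1 1 (by decide)) (hNP.1 3 (by decide))
  obtain ⟨d, hdd⟩ : ∃ d, d = (N 2).1 - (P 2).1 := ⟨_, rfl⟩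
  have hd : 1 ≤ d := by have := hNP.2.1; omega
  have hN2 : N 2 = floorLetter r d := by have e := hNP.2.2; rw [← hdd, hW'] at e; exact e
  obtain ⟨P', hP', c', hc1, -, hagree, hP'0, hP'2⟩ := a2i_origin_floor_interface hU hA hGl hN (a := 0) (b := 2) (by decide) h0 hN2 hd
    hPu hNP.1 hW' (fun Q hQ hNQ => by rw [hP Q hQ ((hNQ.1 0 (by decide)).trans h0) (hNQ.1 1 (by decide)) (hNQ.1 3 (by decide))])
  have e := hP _ (hGu (Equiv.swap 0 2) P' hP') (by show P' (Equiv.swap (0 : Fin 4) 2 0) = _; simpa using hP'2)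
    (by show P' (Equiv.swap (0 : Fin 4) 2 1) = _; simpa [Equiv.swap_apply_of_ne_of_ne] using hagree 1 (by decide) (by decide))
    (by show P' (Equiv.swap (0 : Fin 4) 2 3) = _; simpa [Equiv.swap_apply_of_ne_of_ne] using hagree 3 (by decide) (by decide))
  have e' : P' 0 = (0, 0, 0) := by have e2 : P' (Equiv.swap (0 : Fin 4) 2 2) = (0, 0, 0) := e; simpa using e2
  have := congrArg Prod.fst e'
  rw [hP'0, floorLetter_fst] at this
  simp at this; omega

/-- **P-STEP: THE APEX PIN RAISES THE NODE-2 LETTER TO THE CEILING, WHERE THE X⁺ FORK FIRES** (KERNEL, `h = 2μ`; RULE D both levels, X⁺):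
`P = {O, L(m), W, hI}` (`L(m) = 2I + m·ℓ_v`, `m ≠ 0`, `−1 ≤ m ≤ μ − 2`, `μ ≥ 2`, ANY `W`) is absent provided the intermediate servers
`{O, L(m′), W, hI} ∈ E₋`, `m < m′ ≤ μ − 2`, are (hypothesis `ih`). -/
theorem towerP_step {h μ m : ℤ} {C : MConfig} (hU : C.InDiamond h) (hDN : ∀ Z ∈ C.lower, RuleDMu4N C Z)
    (hDP : ∀ P ∈ C.upper, RuleDMu4P C P) (hX : XPlusClosed C) (hh : h = 2 * μ) (hμ : 2 ≤ μ) (hm0 : m ≠ 0) (hm1 : -1 ≤ m)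
    (hmμ : m ≤ μ - 2) {P : MCell} {v : Fin 4}
    (ih : ∀ m', m < m' → m' ≤ μ - 2 → ∀ X ∈ C.lower, X 0 = (0, 0, 0) → X 1 = nodeTwoLetter v m' → X 2 = P 2 → X 3 = (h, 0, 0) → False)
    (h0 : P 0 = (0, 0, 0)) (h1 : P 1 = nodeTwoLetter v m) (h3 : P 3 = (h, 0, 0)) : P ∉ C.upper := fun hP => by
  have hna : ¬ isApex (P 1) := by rw [h1]; exact nodeTwoLetter_not_isApex v hm0
  have hk : Adapted (P 1) v := by rw [h1]; exact (nodeTwoLetter_top v m).1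
  have hkh : coord (P 1) v ≠ h := by rw [h1, (nodeTwoLetter_top v m).2]; omega
  have hP1 : (P 1).1 = 2 + m := by rw [h1, nodeTwoLetter_fst]
  -- every `v`-server `X` of `P` at slot 1 is `P(1 ↦ L(m+e))`, `m + e ≤ μ − 1`; by `ih` it is the TOP one
  have server : ∀ X ∈ C.lower, UPartner X P 1 v → (X 1).1 = μ + 1 ∧ X 1 = nodeTwoLetter v (μ - 1) := fun X hXl hXP => by
    obtain ⟨e, he⟩ : ∃ e, e = (X 1).1 - (P 1).1 := ⟨_, rfl⟩
    have he0 : 0 < e := by have := hXP.2.1; omega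
    have hX1 : X 1 = ray ((2, 0, 0) : BPoint) v (m + e) := by rw [hXP.2.2, ← he, h1]; exact (ray_add _ v m e).symm
    have htop := (hU.1 X hXl 1).2.2.2
    rw [hX1, top_ray_apex 2 v (by omega)] at htop
    by_cases hlt : m + e ≤ μ - 2
    · exact (ih (m + e) (by omega) hlt X hXl ((hXP.1 0 (by decide)).symm.trans h0) hX1 (hXP.1 2 (by decide)).symm
        ((hXP.1 3 (by decide)).symm.trans h3)).elim
    · have hme : m + e = μ - 1 := by omega
      rw [hme] at hX1
      exact ⟨by rw [hX1]; show (2 : ℤ) + (μ - 1) = μ + 1; ring, hX1⟩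
  obtain ⟨N, hN, hNP⟩ := upLine_of_ruleDMu4P hU hP (hDP P hP) (g := 3) (j := 1) (by decide) (by rw [h3]; exact onCeiling_apex h) hna hk hkh
  obtain ⟨hN1, hN1'⟩ := server N hN hNP
  have hN0 : N 0 = (0, 0, 0) := (hNP.1 0 (by decide)).symm.trans h0
  have hN3 : N 3 = (h, 0, 0) := (hNP.1 3 (by decide)).symm.trans h3
  -- RULE D at the top server (pins `O`, `L(μ−1)`): the descent `Q = N(1 ↦ μ·ℓ_v) ∈ E₊` on the ceiling line
  have hN0' : N 0 = floorLetter v 0 := hN0.trans (ray_zero _ v).symm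
  obtain ⟨Q, hQ, hNQ, hQ1⟩ := descent_of_floorNode_nodeTwo hU le_rfl (by omega : (1 : ℤ) ≤ μ - 1) (hDN N hN) (b := 0) (c := 1)
    (by decide) hN0' hN1'
  have hQ1f : (Q 1).1 = μ := by rw [hQ1, floorLetter_fst]; ring
  have hQc : OnCeiling h (Q 1) := by
    rw [hQ1]; show (ray ((0, 0, 0) : BPoint) v (μ - 1 + 1)).1 + absCharge (ray ((0, 0, 0) : BPoint) v (μ - 1 + 1)) = h
    rw [top_ray_apex 0 v (by omega)]; omega
  have hzI : N 1 = ray ((h, 0, 0) : BPoint) (v + 2) (-(μ - 1)) := by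
    rw [hN1', show nodeTwoLetter v (μ - 1) = ray ((2, 0, 0) : BPoint) v (μ - 1) from rfl, ray_apex_flip,
      show (2 : ℤ) + 2 * (μ - 1) = h by omega]
  have hwI : Q 1 = ray ((h, 0, 0) : BPoint) (v + 2) (-μ) := by
    rw [hQ1, show floorLetter v (μ - 1 + 1) = ray ((0, 0, 0) : BPoint) v μ by rw [sub_add_cancel], ray_apex_flip,
      show (0 : ℤ) + 2 * μ = h by omega]
  have hs0 : 0 < μ - 1 - m := by omega
  have hyz : P 1 = ray (N 1) (v + 2 + 2) (-(μ - 1 - m)) := by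
    rw [fin4_add_two_add_two, show -(μ - 1 - m) = -((N 1).1 - (P 1).1) by rw [hN1, hP1]; ring]
    exact eq_ray_neg hNP.2.2
  refine xplus_fork hU hX hN (g := 1) (f := 3) (by decide) hN3 hP hQ (r₁ := v) (r₂ := v + 2) (fin4_ne_add_two v).symm hNP hNQ hna
    (fun X hXl hXP => by have := (server X hXl hXP).1; omega) (fun X _ _ hlt hlt2 _ => by omega) (fun X hXl _ _ hE hnT => ?_)
  have hxc : OnCeiling h (X 1) := onCeiling_of_effective_above hQc (hU.2 Q hQ 1).1 (hU.1 X hXl 1) hE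
  obtain ⟨d₂, -, -, hxd⟩ := ceiling_effective_sameRay (by omega : (0 : ℤ) < μ) hwI hxc (hU.1 X hXl 1).1 hE
  exact fork_effective hs0 hzI hyz hxd hnT

/-- the two levels of the tower at once, by downward induction on `μ − 2 − m`. -/
theorem tower_aux {h μ : ℤ} {C : MConfig} (hU : C.InDiamond h) (hDN : ∀ Z ∈ C.lower, RuleDMu4N C Z)
    (hDP : ∀ P ∈ C.upper, RuleDMu4P C P) (hX : XPlusClosed C) (hA : A2IMinusClosed C) (hGl : PermClosed C.lower)
    (hGu : PermClosed C.upper) (hh : h = 2 * μ) (v : Fin 4) :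
    ∀ n : ℕ, ∀ m : ℤ, μ - 2 - m ≤ n → 1 ≤ m → m ≤ μ - 2 →
      (∀ P ∈ C.upper, P 0 = (0, 0, 0) → P 1 = nodeTwoLetter v m → P 3 = (h, 0, 0) → P 2 ≠ (0, 0, 0) → False) ∧
      (∀ N ∈ C.lower, N 0 = (0, 0, 0) → N 1 = nodeTwoLetter v m → N 3 = (h, 0, 0) → N 2 ≠ (0, 0, 0) → False) := by
  -- one level, given the `N`-claim at every higher level `≤ μ − 2`
  have level : ∀ m : ℤ, 1 ≤ m → m ≤ μ - 2 →
      (∀ m', m < m' → m' ≤ μ - 2 → ∀ X ∈ C.lower, X 0 = (0, 0, 0) → X 1 = nodeTwoLetter v m' → X 3 = (h, 0, 0) → X 2 ≠ (0, 0, 0) → False) →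
      (∀ P ∈ C.upper, P 0 = (0, 0, 0) → P 1 = nodeTwoLetter v m → P 3 = (h, 0, 0) → P 2 ≠ (0, 0, 0) → False) ∧
      (∀ N ∈ C.lower, N 0 = (0, 0, 0) → N 1 = nodeTwoLetter v m → N 3 = (h, 0, 0) → N 2 ≠ (0, 0, 0) → False) := by
    intro m hm1 hmμ ihN
    have hPA : ∀ P ∈ C.upper, P 0 = (0, 0, 0) → P 1 = nodeTwoLetter v m → P 3 = (h, 0, 0) → P 2 ≠ (0, 0, 0) → False :=
      fun P hP h0 h1 h3 h2 => towerP_step hU hDN hDP hX hh (by omega) (by omega) (by omega) hmμ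
        (fun m' hlt hle X hXl hX0 hX1 hX2 hX3 => ihN m' hlt hle X hXl hX0 hX1 hX3 (by rw [hX2]; exact h2)) h0 h1 h3 hP
    exact ⟨hPA, fun N hN h0 h1 h3 h2 => originPin_lower_step hU hDN hA hGl hGu hN h0 h2
      (fun P hP hP0 hP1 hP3 => by_contra fun hP2 => hPA P hP hP0 (hP1.trans h1) (hP3.trans h3) hP2)⟩
  intro n
  induction n with
  | zero => intro m hn hm1 hmμ; exact level m hm1 hmμ (fun m' hlt hle => absurd hle (by omega))
  | succ n ih => intro m hn hm1 hmμ; exact level m hm1 hmμ (fun m' hlt hle => (ih m' (by omega) (by omega) hle).2)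

/-- **T1 (level `P`).** `P{O, 2I + m·ℓ_v, W, hI} ∉ C.upper` for `1 ≤ m ≤ μ − 2` (`h = 2μ`) and EVERY fourth letter `W ≠ O`
[◇_h, RULE D, X⁺, A2I⁻, `S₄` on E₋ and E₊].  Census: ◇₈ `m = 1, 2`, ◇₁₀ `m = 1, 2, 3`, every `W` (floor ∕ interior ∕ sub-ceiling ∕ ceiling
letters, `cu`, `hI`; all phases): peel rounds 2 – 3, 0 survivors. -/
theorem towerP_absent {h μ m : ℤ} {C : MConfig} (hU : C.InDiamond h) (hDN : ∀ Z ∈ C.lower, RuleDMu4N C Z)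
    (hDP : ∀ P ∈ C.upper, RuleDMu4P C P) (hX : XPlusClosed C) (hA : A2IMinusClosed C) (hGl : PermClosed C.lower)
    (hGu : PermClosed C.upper) (hh : h = 2 * μ) (hm1 : 1 ≤ m) (hmμ : m ≤ μ - 2) {P : MCell} {v : Fin 4} (h0 : P 0 = (0, 0, 0))
    (h1 : P 1 = nodeTwoLetter v m) (h2 : P 2 ≠ (0, 0, 0)) (h3 : P 3 = (h, 0, 0)) : P ∉ C.upper := fun hP =>
  (tower_aux hU hDN hDP hX hA hGl hGu hh v (μ - 2 - m).toNat m (Int.self_le_toNat _) hm1 hmμ).1 P hP h0 h1 h3 h2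

/-- **T1 (level `N`).** `N{O, 2I + m·ℓ_v, W, hI} ∉ C.lower` for `1 ≤ m ≤ μ − 2` (`h = 2μ`) and EVERY `W ≠ O` [same].
Census: peel rounds 2 – 5 (the top level `m = μ − 2` was famC ∕ famD of g19), 0 survivors. -/
theorem towerN_absent {h μ m : ℤ} {C : MConfig} (hU : C.InDiamond h) (hDN : ∀ Z ∈ C.lower, RuleDMu4N C Z)
    (hDP : ∀ P ∈ C.upper, RuleDMu4P C P) (hX : XPlusClosed C) (hA : A2IMinusClosed C) (hGl : PermClosed C.lower)
    (hGu : PermClosed C.upper) (hh : h = 2 * μ) (hm1 : 1 ≤ m) (hmμ : m ≤ μ - 2) {N : MCell} {v : Fin 4} (h0 : N 0 = (0, 0, 0))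
    (h1 : N 1 = nodeTwoLetter v m) (h2 : N 2 ≠ (0, 0, 0)) (h3 : N 3 = (h, 0, 0)) : N ∉ C.lower := fun hN =>
  (tower_aux hU hDN hDP hX hA hGl hGu hh v (μ - 2 - m).toNat m (Int.self_le_toNat _) hm1 hmμ).2 N hN h0 h1 h3 h2

/-- **(R0)** relative to a present `P₁ = P{O, ℓ_φ, cu_χ, hI}` the apex row `N{O, 2I, cu_χ, hI}` is absent [RULE D, X⁺, `Δ` on E₊]: the floor pin
lowers `2I` in a direction off the frame `φ` onto `ℓ_ψ`, `ψ ≠ φ`; the `Δ`-rotate of that child with floor unit `ℓ_φ` is a second child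
`P₁(2 ↦ cu_χ′)`, `χ′ ≠ χ`, of the lift of `P₁` (`apexCeilingUnit_absent_of_secondChild`). -/
theorem apexTwoCeilingUnit_N_rel {h : ℤ} {C : MConfig} (hU : C.InDiamond h) (hDN : ∀ Z ∈ C.lower, RuleDMu4N C Z)
    (hDP : ∀ P ∈ C.upper, RuleDMu4P C P) (hX : XPlusClosed C) (hΔu : DeltaClosed C.upper) {P₁ : MCell} (hP₁ : P₁ ∈ C.upper)
    {φ χ : Fin 4} (h0 : P₁ 0 = (0, 0, 0)) (h1 : P₁ 1 = floorUnit φ) (h2 : P₁ 2 = ceilingUnit h χ) (h3 : P₁ 3 = (h, 0, 0))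
    {X : MCell} (hXl : X ∈ C.lower) (hX0 : X 0 = (0, 0, 0)) (hX1 : X 1 = (2, 0, 0)) (hX2 : X 2 = ceilingUnit h χ)
    (hX3 : X 3 = (h, 0, 0)) : False := by
  have hfl : OnFloor (X 0) := by rw [hX0]; simp [OnFloor, absCharge, chargeOf]
  obtain ⟨r, hr, P, hP, hXP⟩ := servedBelow_floor_dir hU hXl (hDN X hXl) (i := 0) (g := 1) (by decide) hfl (k := φ)
    (by rw [hX1]; exact adapted_apexTwo φ) (by rw [hX1, coord_apexTwo]; decide)
  have hd : 0 < (X 1).1 - (P 1).1 := by have := hXP.2.1; omega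
  have hP1 : P 1 = floorUnit (r + 2) := apexTwo_downRay (hU.2 P hP 1) hd (by rw [← hX1]; exact hXP.2.2)
  have hψ : r + 2 ≠ φ := fun e => hr (by rw [← e, fin4_add_two_add_two])
  have hP0 : P 0 = (0, 0, 0) := (hXP.1 0 (by decide)).trans hX0
  have hP2 : P 2 = ceilingUnit h χ := (hXP.1 2 (by decide)).trans hX2
  have hP3 : P 3 = (h, 0, 0) := (hXP.1 3 (by decide)).trans hX3
  have child : ∀ Q ∈ C.upper, Q 0 = (0, 0, 0) → Q 1 = floorUnit φ → (∃ χ', χ' ≠ χ ∧ Q 2 = ceilingUnit h χ') → Q 3 = (h, 0, 0) → False :=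
    fun Q hQ hQ0 hQ1 ⟨χ', hχ', hQ2⟩ hQ3 =>
      apexCeilingUnit_absent_of_secondChild hU hDP hX (Z := P₁) (Z' := Q) (d := 2) (f := 3) (by decide) hχ' h2 h3 (fun _ => hQ)
        (fun j hj => by
          fin_cases j
          · simpa using hQ0.trans h0.symm
          · simpa using hQ1.trans h1.symm
          · exact absurd rfl hj
          · simpa using hQ3.trans h3.symm) hQ2 hP₁
  have d1 : ∀ Q : MCell, ∀ f, Q.delta f = deltaPt (Q f) := fun Q f => rfl
  rcases deltaPt_align 0 1 φ (r + 2) with e | e | e | e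
  · exact hψ (floorUnit_inj e).symm
  · refine child P.delta (hΔu P hP) ?_ ?_ ⟨χ + 3, fin4_add3_ne χ, ?_⟩ ?_
    · rw [d1, hP0, deltaPt_apex]
    · rw [d1, hP1]; exact e.symm
    · rw [d1, hP2, deltaPt_ceilingUnit]
    · rw [d1, hP3, deltaPt_apex]
  · refine child P.delta.delta (hΔu _ (hΔu P hP)) ?_ ?_ ⟨χ + 3 + 3, fin4_add33_ne χ, ?_⟩ ?_
    · rw [d1, d1, hP0, deltaPt_apex, deltaPt_apex]
    · rw [d1, d1, hP1]; exact e.symm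
    · rw [d1, d1, hP2, deltaPt_ceilingUnit, deltaPt_ceilingUnit]
    · rw [d1, d1, hP3, deltaPt_apex, deltaPt_apex]
  · refine child P.delta.delta.delta (hΔu _ (hΔu _ (hΔu P hP))) ?_ ?_ ⟨χ + 3 + 3 + 3, fin4_add333_ne χ, ?_⟩ ?_
    · rw [d1, d1, d1, hP0, deltaPt_apex, deltaPt_apex, deltaPt_apex]
    · rw [d1, d1, d1, hP1]; exact e.symm
    · rw [d1, d1, d1, hP2, deltaPt_ceilingUnit, deltaPt_ceilingUnit, deltaPt_ceilingUnit]
    · rw [d1, d1, d1, hP3, deltaPt_apex, deltaPt_apex, deltaPt_apex]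

theorem ceilingUnit_ne_origin {h : ℤ} (hh : 2 ≤ h) (χ : Fin 4) : ceilingUnit h χ ≠ (0, 0, 0) := fun e => by
  have := congrArg Prod.fst e; rw [ceilingUnit_fst] at this; simp at this; omega

/-- **OPA.** `P{O, ℓ_φ, cu_χ, hI} ∉ C.upper` for ALL `φ, χ` [◇_h, RULE D, X⁺, A2I⁻, `S₄` on E₋ and E₊, `Δ` on E₊; every `h`]: the P-step at
level `m = −1` of the tower of phase `v = φ + 2` (`ℓ_φ = 2I − n_v`); its servers are the apex row (R0) and the tower's `N`-cells
`{O, 2I + m′ℓ_v, cu_χ, hI}` (T1).  Census: ◇₈ peel round 3, ◇₁₀ round 5 (the deep apex row `P{O, ℓ, hI, cu}` of memo g21 §4), 0 survivors. -/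
theorem originUnitCeilingUnitApex_P_absent {h : ℤ} {C : MConfig} (hU : C.InDiamond h) (hDN : ∀ Z ∈ C.lower, RuleDMu4N C Z)
    (hDP : ∀ P ∈ C.upper, RuleDMu4P C P) (hX : XPlusClosed C) (hA : A2IMinusClosed C) (hGl : PermClosed C.lower)
    (hGu : PermClosed C.upper) (hΔu : DeltaClosed C.upper) {P : MCell} {φ χ : Fin 4} (h0 : P 0 = (0, 0, 0)) (h1 : P 1 = floorUnit φ)
    (h2 : P 2 = ceilingUnit h χ) (h3 : P 3 = (h, 0, 0)) : P ∉ C.upper := fun hP => by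
  obtain ⟨μ, hμ⟩ : ∃ μ, h = 2 * μ := ⟨h / 2, by
    have := (hU.2 P hP 3).2.2.1; rw [h3] at this; simp [absCharge, chargeOf] at this; omega⟩
  have h2h : (2 : ℤ) ≤ h := by
    have := (hU.2 P hP 1).2.2.2; rw [h1, show floorUnit φ = ray ((0, 0, 0) : BPoint) φ 1 from rfl, top_ray_apex 0 φ zero_le_one] at this
    omega
  have h1' : P 1 = nodeTwoLetter (φ + 2) (-1) := by
    rw [h1]; show ray ((0, 0, 0) : BPoint) φ 1 = ray ((2, 0, 0) : BPoint) (φ + 2) (-1); rw [ray_apex_flip]; norm_num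
  by_cases hμ1 : μ = 1
  · -- ◇₂: the only server of `ℓ_φ` along `v = φ + 2` is the apex row `N{O, 2I, cu_χ, hI}` of (R0)
    have hna : ¬ isApex (P 1) := by rw [h1']; exact nodeTwoLetter_not_isApex (φ + 2) (by decide)
    have hk : Adapted (P 1) (φ + 2) := by rw [h1']; exact (nodeTwoLetter_top (φ + 2) (-1)).1
    have hkh : coord (P 1) (φ + 2) ≠ h := by rw [h1', (nodeTwoLetter_top (φ + 2) (-1)).2]; omega
    obtain ⟨N, hN, hNP⟩ := upLine_of_ruleDMu4P hU hP (hDP P hP) (g := 3) (j := 1) (by decide) (by rw [h3]; exact onCeiling_apex h)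
      hna hk hkh
    obtain ⟨e, he⟩ : ∃ e, e = (N 1).1 - (P 1).1 := ⟨_, rfl⟩
    have he0 : 0 < e := by have := hNP.2.1; omega
    have hN1 : N 1 = ray ((2, 0, 0) : BPoint) (φ + 2) (-1 + e) := by rw [hNP.2.2, ← he, h1']; exact (ray_add _ _ _ _).symm
    have htop := (hU.1 N hN 1).2.2.2
    rw [hN1, top_ray_apex 2 (φ + 2) (by omega)] at htop
    rw [show -1 + e = 0 by omega, ray_zero] at hN1
    exact apexTwoCeilingUnit_N_rel hU hDN hDP hX hΔu hP h0 h1 h2 h3 hN ((hNP.1 0 (by decide)).symm.trans h0) hN1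
      ((hNP.1 2 (by decide)).symm.trans h2) ((hNP.1 3 (by decide)).symm.trans h3)
  refine towerP_step hU hDN hDP hX hμ (by omega) (m := -1) (by decide) le_rfl (by omega) (v := φ + 2)
    (fun m' hm' hm'μ X hXl hX0 hX1 hX2 hX3 => ?_) h0 h1' h3 hP
  rw [h2] at hX2
  rcases (show m' = 0 ∨ 1 ≤ m' by omega) with rfl | hm'1
  · exact apexTwoCeilingUnit_N_rel hU hDN hDP hX hΔu hP h0 h1 h2 h3 hXl hX0 (hX1.trans (ray_zero _ _)) hX2 hX3
  · exact towerN_absent hU hDN hDP hX hA hGl hGu hμ hm'1 hm'μ hX0 hX1 (by rw [hX2]; exact ceilingUnit_ne_origin h2h χ) hX3 hXl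

/-- **UPA.** `N{ℓ_φ, ℓ_ψ, cu_χ, hI} ∉ C.lower` for ALL phases `φ, ψ, χ` [same]: the descent `ℓ_φ ↦ O` (RULE D on the two floor units) is OPA.
`φ ≠ ψ` is the g18 ceiling fork; `φ = ψ` is the census's round-4 row `N{ℓ_φ, ℓ_φ, hI, cu_χ}` (memo g21 §4), 0 survivors. -/
theorem unitPairCeilingUnitApex_N_absent {h : ℤ} {C : MConfig} (hU : C.InDiamond h) (hDN : ∀ Z ∈ C.lower, RuleDMu4N C Z)
    (hDP : ∀ P ∈ C.upper, RuleDMu4P C P) (hX : XPlusClosed C) (hA : A2IMinusClosed C) (hGl : PermClosed C.lower)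
    (hGu : PermClosed C.upper) (hΔu : DeltaClosed C.upper) {N : MCell} {φ ψ χ : Fin 4} (h0 : N 0 = floorUnit φ) (h1 : N 1 = floorUnit ψ)
    (h2 : N 2 = ceilingUnit h χ) (h3 : N 3 = (h, 0, 0)) : N ∉ C.lower := fun hN => by
  obtain ⟨P, hP, hagree, hP0⟩ := descent_of_floorUnitPair hU (hDN N hN) (b := 1) (c := 0) (by decide) h1 h0
  exact originUnitCeilingUnitApex_P_absent hU hDN hDP hX hA hGl hGu hΔu hP0 ((hagree 1 (by decide)).trans h1)
    ((hagree 2 (by decide)).trans h2) ((hagree 3 (by decide)).trans h3) hP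

/-! ### The §5 ∕ §6 free-letter families without their phase ∕ ceiling provisos -/

/-- **F2⁺.** `P{O, ℓ_φ, X, cu_χ} ∉ C.upper` for EVERY fourth letter `X` (F2 + OPA after `(2 3)`). -/
theorem originUnitFree_P_absent' {h : ℤ} {C : MConfig} (hU : C.InDiamond h) (hDN : ∀ Z ∈ C.lower, RuleDMu4N C Z)
    (hDP : ∀ P ∈ C.upper, RuleDMu4P C P) (hX : XPlusClosed C) (hA : A2IMinusClosed C) (hGl : PermClosed C.lower)
    (hGu : PermClosed C.upper) (hΔu : DeltaClosed C.upper) {P : MCell} {φ χ : Fin 4} (h0 : P 0 = (0, 0, 0)) (h1 : P 1 = floorUnit φ)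
    (h3 : P 3 = ceilingUnit h χ) : P ∉ C.upper := fun hP => by
  by_cases h2 : P 2 = (h, 0, 0)
  · exact originUnitCeilingUnitApex_P_absent hU hDN hDP hX hA hGl hGu hΔu (P := P.perm (Equiv.swap 2 3)) (φ := φ) (χ := χ)
      (by show P (Equiv.swap (2 : Fin 4) 3 0) = _; simpa [Equiv.swap_apply_of_ne_of_ne] using h0)
      (by show P (Equiv.swap (2 : Fin 4) 3 1) = _; simpa [Equiv.swap_apply_of_ne_of_ne] using h1)
      (by show P (Equiv.swap (2 : Fin 4) 3 2) = _; simpa using h3)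
      (by show P (Equiv.swap (2 : Fin 4) 3 3) = _; simpa using h2) (hGu _ P hP)
  · exact originUnitFree_P_absent hU hDN hDP hX hA hGl hΔu h2 h0 h1 h3 hP

/-- **F3⁺.** `N{ℓ_φ, ℓ_ψ, X, cu_χ} ∉ C.lower` for EVERY fourth letter `X` and ALL phases (F3 + UPA after `(2 3)`). -/
theorem unitPairFree_N_absent' {h : ℤ} {C : MConfig} (hU : C.InDiamond h) (hDN : ∀ Z ∈ C.lower, RuleDMu4N C Z)
    (hDP : ∀ P ∈ C.upper, RuleDMu4P C P) (hX : XPlusClosed C) (hA : A2IMinusClosed C) (hGl : PermClosed C.lower)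
    (hGu : PermClosed C.upper) (hΔu : DeltaClosed C.upper) {N : MCell} {φ ψ χ : Fin 4} (h0 : N 0 = floorUnit φ) (h1 : N 1 = floorUnit ψ)
    (h3 : N 3 = ceilingUnit h χ) : N ∉ C.lower := fun hN => by
  by_cases h2 : N 2 = (h, 0, 0)
  · exact unitPairCeilingUnitApex_N_absent hU hDN hDP hX hA hGl hGu hΔu (N := N.perm (Equiv.swap 2 3)) (φ := φ) (ψ := ψ) (χ := χ)
      (by show N (Equiv.swap (2 : Fin 4) 3 0) = _; simpa [Equiv.swap_apply_of_ne_of_ne] using h0)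
      (by show N (Equiv.swap (2 : Fin 4) 3 1) = _; simpa [Equiv.swap_apply_of_ne_of_ne] using h1)
      (by show N (Equiv.swap (2 : Fin 4) 3 2) = _; simpa using h3)
      (by show N (Equiv.swap (2 : Fin 4) 3 3) = _; simpa using h2) (hGl _ N hN)
  · exact unitPairFree_N_absent hU hDN hDP hX hA hGl hΔu h2 h0 h1 h3 hN

/-- **F4⁺.** `P{ℓ_φ, ℓ_ψ, X, cu_χ} ∉ C.upper` for every `X ≠ hI` and ALL phases (the ceiling pin serves `X` above; F3⁺).
`φ = ψ` with `X` on the ceiling is NEW (F4 needed `X` below the ceiling, F4c needed `φ ≠ ψ`). -/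
theorem unitPairFree_P_absent' {h : ℤ} {C : MConfig} (hU : C.InDiamond h) (hDN : ∀ Z ∈ C.lower, RuleDMu4N C Z)
    (hDP : ∀ P ∈ C.upper, RuleDMu4P C P) (hX : XPlusClosed C) (hA : A2IMinusClosed C) (hGl : PermClosed C.lower)
    (hGu : PermClosed C.upper) (hΔu : DeltaClosed C.upper) {P : MCell} {φ ψ χ : Fin 4} (h2 : P 2 ≠ (h, 0, 0))
    (h0 : P 0 = floorUnit φ) (h1 : P 1 = floorUnit ψ) (h3 : P 3 = ceilingUnit h χ) : P ∉ C.upper := fun hP => by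
  obtain ⟨k, hk, hkh⟩ := exists_frame_ne_h (hU.2 P hP 2) h2
  obtain ⟨r, N, hN, hNP⟩ := servedAbove_ceiling_apex hU hP (hDP P hP) (g := 3) (j := 2) (by decide)
    (by rw [h3]; exact onCeiling_ceilingUnit h χ) hk hkh
  exact unitPairFree_N_absent' hU hDN hDP hX hA hGl hGu hΔu ((hNP.1 0 (by decide)).symm.trans h0)
    ((hNP.1 1 (by decide)).symm.trans h1) ((hNP.1 3 (by decide)).symm.trans h3) hN

/-- **F5⁺.** `N{ℓ_φ, 2ℓ_u, X, cu_χ} ∉ C.lower` for every `X ≠ hI` and ALL `φ, u, χ` (floor pin lowers `2ℓ_u` to `ℓ_u` (F4⁺) or `O` (F2⁺)).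
`φ = u` with `X` on the ceiling is NEW; `X = hI` is the deep row `N{ℓ_φ, 2ℓ_u, hI, cu}` (rounds 5 – 7), not claimed. -/
theorem unitFloorTwoFree_N_absent' {h : ℤ} {C : MConfig} (hU : C.InDiamond h) (hDN : ∀ Z ∈ C.lower, RuleDMu4N C Z)
    (hDP : ∀ P ∈ C.upper, RuleDMu4P C P) (hX : XPlusClosed C) (hA : A2IMinusClosed C) (hGl : PermClosed C.lower)
    (hGu : PermClosed C.upper) (hΔu : DeltaClosed C.upper) {N : MCell} {φ u χ : Fin 4} (h2 : N 2 ≠ (h, 0, 0))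
    (h0 : N 0 = floorUnit φ) (h1 : N 1 = floorLetter u 2) (h3 : N 3 = ceilingUnit h χ) : N ∉ C.lower := fun hN => by
  have hfl : OnFloor (N 0) := onFloor_of_coord_zero (hU.1 N hN 0) (k := φ + 2) (by rw [h0]; exact (floorLetter_node φ 1).2)
  have hna : ¬ isApex (N 1) := by rw [h1]; exact floorLetter_not_isApex u (by norm_num)
  have hk : Adapted (N 1) u := by rw [h1]; exact (floorLetter_top u 2).1
  have hk0 : coord (N 1) u ≠ 0 := by rw [h1, (floorLetter_top u 2).2]; norm_num
  obtain ⟨P, hP, hZP⟩ := servedBelow_of_floorLetter hU hN (hDN N hN) (i := 0) (g := 1) (by decide) hfl hna hk hk0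
  obtain ⟨hc', hP1⟩ := floorLetter_downRay (hU.2 P hP 1) (h1.symm.trans hZP.2.2)
  have hP0 : P 0 = floorUnit φ := (hZP.1 0 (by decide)).trans h0
  have hP2 : P 2 = N 2 := hZP.1 2 (by decide)
  have hP3 : P 3 = ceilingUnit h χ := (hZP.1 3 (by decide)).trans h3
  have hne : P 2 ≠ (h, 0, 0) := by rw [hP2]; exact h2
  rcases (show 2 - ((N 1).1 - (P 1).1) = 1 ∨ 2 - ((N 1).1 - (P 1).1) = 0 by have := hZP.2.1; omega) with hone | hze
  · rw [hone] at hP1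
    exact unitPairFree_P_absent' hU hDN hDP hX hA hGl hGu hΔu hne hP0 hP1 hP3 hP
  · rw [hze] at hP1
    have hP1' : P 1 = (0, 0, 0) := hP1.trans (ray_zero _ _)
    exact originUnitFree_P_absent' hU hDN hDP hX hA hGl hGu hΔu (P := P.perm (Equiv.swap 0 1)) (φ := φ) (χ := χ)
      (by show P (Equiv.swap (0 : Fin 4) 1 0) = _; simpa using hP1')
      (by show P (Equiv.swap (0 : Fin 4) 1 1) = _; simpa using hP0)
      (by show P (Equiv.swap (0 : Fin 4) 1 3) = _; simpa [Equiv.swap_apply_of_ne_of_ne] using hP3)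
      (hGu _ P hP)

/-- **F6⁺.** `P{ℓ_φ, 2ℓ_u, X, cu_χ} ∉ C.upper` for ALL `φ, u, χ` and every `X` BELOW the ceiling (the served letter is `≠ hI`; F5⁺).
`φ = u` is NEW. -/
theorem unitFloorTwoFree_P_absent' {h : ℤ} {C : MConfig} (hU : C.InDiamond h) (hDN : ∀ Z ∈ C.lower, RuleDMu4N C Z)
    (hDP : ∀ P ∈ C.upper, RuleDMu4P C P) (hX : XPlusClosed C) (hA : A2IMinusClosed C) (hGl : PermClosed C.lower)
    (hGu : PermClosed C.upper) (hΔu : DeltaClosed C.upper) {P : MCell} {φ u χ : Fin 4} (h2 : ¬ OnCeiling h (P 2))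
    (h0 : P 0 = floorUnit φ) (h1 : P 1 = floorLetter u 2) (h3 : P 3 = ceilingUnit h χ) : P ∉ C.upper := fun hP => by
  obtain ⟨k, hk, hkh⟩ := exists_frame_ne_h (hU.2 P hP 2) (fun e => h2 (by rw [e]; exact onCeiling_apex h))
  obtain ⟨r, N, hN, hNP⟩ := servedAbove_ceiling_apex hU hP (hDP P hP) (g := 3) (j := 2) (by decide)
    (by rw [h3]; exact onCeiling_ceilingUnit h χ) hk hkh
  refine unitFloorTwoFree_N_absent' hU hDN hDP hX hA hGl hGu hΔu (fun e => h2 ?_) ((hNP.1 0 (by decide)).symm.trans h0)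
    ((hNP.1 1 (by decide)).symm.trans h1) ((hNP.1 3 (by decide)).symm.trans h3) hN
  exact onCeiling_below_apex (by have := hNP.2.1; omega) (e.symm.trans hNP.2.2)

/-- **F7⁺.** `N{ℓ_φ, 3ℓ_u, X, cu_χ} ∉ C.lower` for ALL `φ, u, χ` and every `X` BELOW the ceiling (floor pin lowers `3ℓ_u` to `2ℓ_u` (F6⁺), `ℓ_u`
(F4⁺) or `O` (F2⁺)).  `φ = u` is NEW. -/
theorem unitFloorThreeFree_N_absent' {h : ℤ} {C : MConfig} (hU : C.InDiamond h) (hDN : ∀ Z ∈ C.lower, RuleDMu4N C Z)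
    (hDP : ∀ P ∈ C.upper, RuleDMu4P C P) (hX : XPlusClosed C) (hA : A2IMinusClosed C) (hGl : PermClosed C.lower)
    (hGu : PermClosed C.upper) (hΔu : DeltaClosed C.upper) {N : MCell} {φ u χ : Fin 4} (h2 : ¬ OnCeiling h (N 2))
    (h0 : N 0 = floorUnit φ) (h1 : N 1 = floorLetter u 3) (h3 : N 3 = ceilingUnit h χ) : N ∉ C.lower := fun hN => by
  have hfl : OnFloor (N 0) := onFloor_of_coord_zero (hU.1 N hN 0) (k := φ + 2) (by rw [h0]; exact (floorLetter_node φ 1).2)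
  have hna : ¬ isApex (N 1) := by rw [h1]; exact floorLetter_not_isApex u (by norm_num)
  have hk : Adapted (N 1) u := by rw [h1]; exact (floorLetter_top u 3).1
  have hk0 : coord (N 1) u ≠ 0 := by rw [h1, (floorLetter_top u 3).2]; norm_num
  obtain ⟨P, hP, hZP⟩ := servedBelow_of_floorLetter hU hN (hDN N hN) (i := 0) (g := 1) (by decide) hfl hna hk hk0
  obtain ⟨hc', hP1⟩ := floorLetter_downRay (hU.2 P hP 1) (h1.symm.trans hZP.2.2)
  have hP0 : P 0 = floorUnit φ := (hZP.1 0 (by decide)).trans h0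
  have hP2 : P 2 = N 2 := hZP.1 2 (by decide)
  have hP3 : P 3 = ceilingUnit h χ := (hZP.1 3 (by decide)).trans h3
  have h2' : ¬ OnCeiling h (P 2) := by rw [hP2]; exact h2
  have hne : P 2 ≠ (h, 0, 0) := fun e => h2 (by rw [← hP2, e]; exact onCeiling_apex h)
  rcases (show 3 - ((N 1).1 - (P 1).1) = 2 ∨ 3 - ((N 1).1 - (P 1).1) = 1 ∨ 3 - ((N 1).1 - (P 1).1) = 0 by
    have := hZP.2.1; omega) with htwo | hone | hze
  · rw [htwo] at hP1
    exact unitFloorTwoFree_P_absent' hU hDN hDP hX hA hGl hGu hΔu h2' hP0 hP1 hP3 hP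
  · rw [hone] at hP1
    exact unitPairFree_P_absent' hU hDN hDP hX hA hGl hGu hΔu hne hP0 hP1 hP3 hP
  · rw [hze] at hP1
    have hP1' : P 1 = (0, 0, 0) := hP1.trans (ray_zero _ _)
    exact originUnitFree_P_absent' hU hDN hDP hX hA hGl hGu hΔu (P := P.perm (Equiv.swap 0 1)) (φ := φ) (χ := χ)
      (by show P (Equiv.swap (0 : Fin 4) 1 0) = _; simpa using hP1')
      (by show P (Equiv.swap (0 : Fin 4) 1 1) = _; simpa using hP0)
      (by show P (Equiv.swap (0 : Fin 4) 1 3) = _; simpa [Equiv.swap_apply_of_ne_of_ne] using hP3)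
      (hGu _ P hP)

end Summit.HodgeConjecture.HodgeConjecture.Cruxes.BlochSeedDiscOne.CeilingTower
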